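/-
Copyright: cell `langlands-arthur-audit` (papers/Langlands/langlands-arthur-audit), unit `pub-arthur-down-g7`
(downstream tracer, gen 7).  Staged for the tree under `Literature/NumberTheory/Automorphic/Arthur2013/`
(LEAN-IN-TREE rule 2026-08-18); companion of `Downstream.lean` (p177018 … p179405) and of the three leaf-support
modules `Arthur2013/LeafSupport.lean` (p179578), `Mok2015/LeafSupport.lean` (p180006), `KMSW2014/LeafSupport.lean`
(p180007).  It adds NO edge, NO node, NO leaf and NO consumer: it reads the register of `Downstream.lean` and the
kernel countermodels of the leaf-support modules and proves facts about them.  v1.1 (same unit, APPEND-ONLY, after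
`Downstream.lean` v6 = p180363): section 8 — `canon₄`, `canon_implications₄` and the supports of the fourth tranche
(`book_leaf_support₄`, `mok_leaf_support₄`, `stabOrdI_cm_iff`, `kmsw_ballLine_iff`); every v1 declaration unchanged.
v1.2 (unit `pub-arthur-down-g8`, APPEND-ONLY, after `Downstream2.lean` v1 = the fifth tranche; one import added): section 9 —
`canon₅`, `canon₅granted`, `canon_implications₅`, `canon_implications₅granted`, the supports of the fifth tranche
(`book_leaf_support₅`, `mok_leaf_support₅`, `kmsw_scope_consumers_iff₅`) and the two readings of the explicit-hypothesis row B7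
(`atobeGan_granted_holds`, `atobeGan_two_readings`); every v1–v1.1 declaration unchanged.
v1.3 (same unit, APPEND-ONLY, after `Downstream2.lean` v2 = the sixth tranche): section 10 — `canon₆`, `canon_implications₆`,
`book_leaf_support₆`, `mok_leaf_support₆`, `hypothesisRows_hold_everywhere`, `sixth_tranche_holds_in_kmsw_models`; every v1–v1.2
declaration unchanged.  v1.4 (unit `pub-arthur-down-g9`, APPEND-ONLY, after `Downstream2.lean` v3 = the seventh tranche): section 11 —
`canon₇`, `canon_implications₇`, `prop952_support` (the Chapter-9 node of rows C99/C17 has support = Shin's nine leaves, two-sided),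
`katsuradaLee_fails_cm`, `book_leaf_support₇`, `prop952_independent_of_fifteen`; every v1–v1.3 declaration unchanged.  v1.5 (unit
`pub-arthur-down-g10`, APPEND-ONLY, after `Downstream2.lean` v4 = the eighth tranche): section 12 — `canon₈`, `canon₈no`,
`canon_implications₈`, `canon_implications₈no`, `innerTwists_is_a_new_leaf` (the Chapter-9 leaf [A28] is not delivered by the three
DAGs), `jz_holds_top`, `jz_book_cm`, `jz_mok_cm`, `jz_kmsw_cm` (supports of row C16); every v1–v1.4 declaration unchanged.  v1.6 (same
unit, APPEND-ONLY, after `Downstream2.lean` v5 = the ninth tranche): section 13 — `canon₉`, `canon_implications₉`, `taibiLine_book_cm`,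
`taibiLine_holds_top`, `ch9_routes_separated` (C167/C46 hold while `InnerTwists` fails: the two Chapter-9 routes separated); every v1–v1.5
declaration unchanged.  v1.7 (unit `pub-arthur-down-g11`, APPEND-ONLY, after `Downstream2.lean` v6 = the tenth tranche): section 14 —
`canon₁₀`, `canon_implications₁₀`, `tenth_holds_top`, `BookLineFail₁₀` / `UnitaryLineFail₁₀` / `PremiseFreeHold₁₀`, `tenth_book_cm`,
`tenth_mok_cm`, `tenth_kmsw_cm` (exact supports of rows D7, D11–D17), `kala_halves_separated`, `mw_regimes_separated`,
`marshall2023_readings_separated`; every v1–v1.6 declaration unchanged.  v1.8 (same unit, APPEND-ONLY, after `Downstream2.lean` v7 = the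
eleventh tranche): section 15 — `canon₁₁`, `canon_implications₁₁`, `eleventh_holds_top`, `eleventh_book_cm`, `eleventh_unitary_independent`
(exact supports of the metaplectic line, rows B11 ×2 / C28); every v1–v1.7 declaration unchanged.  v1.9 (unit
`pub-arthur-down-g12`, APPEND-ONLY, after `Downstream3.lean` v1 = the twelfth tranche; one import added): section 16 — `canon₁₂`,
`canon_implications₁₂`, `liMp_edges_canon`, `twelfth_holds_top`, `twelfth_book_cm`, `twelfth_mok_cm`, `twelfth_kmsw_cm`,
`lls_readings_separated` (exact supports of row B6 in its two readings and of C28 through B6); every v1–v1.8 declaration unchanged.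
v1.10 (unit `pub-arthur-down-g13`, APPEND-ONLY, after `Downstream3.lean` v2 = the thirteenth tranche): section 17 — `canon₁₃`,
`canon_implications₁₃`, `reissued_edges_canon`, `thirteenth_holds_top`, `thirteenth_book_cm`, `thirteenth_mok_cm`, `thirteenth_kmsw_cm`,
`mr_readings_separated` (exact supports of Mœglin–Renard 2018 in its two readings; supports of B6 / C28 / B42 UNCHANGED under the
re-issued edges); every v1–v1.9 declaration unchanged.
v1.11 (same unit, APPEND-ONLY, after `Downstream3.lean` v3 = the fourteenth tranche): section 18 — `canon₁₄`, `canon_implications₁₄`,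
`fourteenth_holds_top`, `moeglinStable_cm_holds`, `moeglinStable_indep_preprint_layer`, `moeglinStable_cm_fails`, `moeglinStable_vs_book`
(exact support of the control E41 = 8 of the 24 book leaves; independence of the seven 2024–2026 preprint leaves); every v1–v1.10
declaration unchanged.
v1.12 (unit `pub-arthur-down-g14`, APPEND-ONLY, after `Downstream3.lean` v4 = the fifteenth tranche): section 19 — `canon₁₅`,
`canon_implications₁₅`, `fifteenth_holds_top`, `fifteenth_book_cm`, `fifteenth_mok_cm`, `fifteenth_kmsw_cm`, `xu_supports_separated` (exact
supports of B. Xu's global L-packets of GSp(2n), GO(2n) = the 24 book leaves, of his similitude LLC = the 24 + Mok's 29, of row A14);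
every v1–v1.11 declaration unchanged.  v1.13 (same unit, APPEND-ONLY, after `Downstream3.lean` v5 = the sixteenth tranche): section 20 —
`canon₁₆`, `canon_implications₁₆`, `sixteenth_holds_top`, `sixteenth_book_cm`, `sixteenth_mok_cm`, `sixteenth_kmsw_cm` (exact support of B. Xu's
p-adic Arthur packets of GSp(2n), GO(2n) = the 24 book leaves + Mok's 29, second order through A15's Thm 8.12); every v1–v1.12
declaration unchanged.
-/
import HarnessLib
import Literature.NumberTheory.Automorphic.Arthur2013.Downstream
import Literature.NumberTheory.Automorphic.Arthur2013.Downstream2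
import Literature.NumberTheory.Automorphic.Arthur2013.Downstream3
import Literature.NumberTheory.Automorphic.Arthur2013.LeafSupport
import Literature.NumberTheory.Automorphic.Mok2015.LeafSupport
import Literature.NumberTheory.Automorphic.KMSW2014.LeafSupport

/-!
# Downstream of Arthur (2013): exact leaf support of the downstream register (countermodel certificates)

**Source reproduced.**  Nothing beyond what `Downstream.lean` transcribes: for each published theorem of the
cell's `DOWNSTREAM.md` that invokes J. Arthur, *The Endoscopic Classification of Representations* (AMS Colloq.
Publ. 61, 2013) [cite: Arthur2013], C. P. Mok (Mem. AMS 1108, 2015) [cite: Mok2012] or Kaletha–Mínguez–Shin–White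
(arXiv:1409.3731) [claim: KalethaMinguezShinWhite2014, under-review], the sentence in which it does so, typed as an
edge hypothesis `E_…`; and the three dependency DAGs with their leaf-support certificates.  The book itself was NOT
held by the auditing cell; every "[Ar, Thm n]" is the downstream author's citation.

**What this file is.**  `Downstream.lean` proves the "if" half of every entry of the "inherits" column of
`DOWNSTREAM.md`: e.g. `taibiInner_of_leaves : Implications → BookInputs ν → c.TaibiInner` says that Taïbi's 2019
multiplicity formula follows, in the register as typed, from the book's derivations and ALL 24 leaves of the book's
DAG.  Whether every one of those 24 leaves is actually load-bearing for Taïbi's theorem — the "only if" half, the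
word EXACTLY in "conditional exactly on" — is not expressible by a composition theorem.  This file settles it, for
the register AS TYPED, by kernel-checked countermodels, re-using the least-model valuations `cm` of the three
leaf-support modules (carver lineage) and ONE canonical consumer assignment:

* `Support.canon`, `canon₂`, `canon₃`, `canonShin` — the LEAST-MODEL reading of the register: every downstream
  statement is interpreted as (a proposition implied by) exactly what its typed edge consumes (`∀ N, ν.Everything N`
  for a consumer of the book, `∀ N, κ.Scope N` for a consumer of KMSW's proved scope, …); `canon_implications`,
  `canon_implications₂`, `canon_implications₃`, `canon_shin` prove that ALL edge hypotheses of `Downstream.lean`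
  (`Implications`, `Implications2`, `Implications3`, `Shin.Implications`) hold for this assignment over ARBITRARY
  node assignments ν, μ, κ.  So any failure of a consumer in a model below is forced by the DAGs, not by a choice.
* `Support.book_leaf_support` — for each of the 24 leaves `l` of the book's DAG there are node assignments in which
  every edge bundle of `DependencyDag`/`FineDag`/`FineDagGlobal` holds (`LeafSupport.Systems`), every OTHER book
  leaf holds, Mok's and KMSW's inputs hold IN FULL (all 29 + 14 leaves, sequels included), every auxiliary input of
  the register is granted (Ishimoto's sequel, Rogawski, Shin's GL_N Galois representations, (H2), (H3)), all four
  implication bundles hold — and yet EVERY one of the 29 downstream statements whose typed derivation passes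
  through the book FAILS (`BookConsumersFail`: rows A3–A8, B1, B2, B4, B58, C1 ×2, C3 ×2, C4–C6, C9–C12, C71, C99,
  C153, C154, C158, D4, D19 Thm 1.2.1 — Taïbi, Ishimoto, Xu, Gee–Taïbi, Chen–Zou, Mœglin–Renard, AMR, Atobe, AHKO,
  Gan–Ichino, Chenevier–Renard, Taïbi's dimension formulas, Chenevier–Lannes, Chenevier–Taïbi, BCGP 2021/2025,
  Kret–Shin ×2, Scholze's totally-real/CM sentence, Clozel–Kret–Taïbi, BLMM, Whitmore, DHKM, EGG, DGG), while the
  twelve statements that consume only the unitary DAGs hold (`UnitaryOnlyHold`).  Hence no book leaf can be dropped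
  from any `…_of_leaves` theorem of a book consumer: in the register as typed, "inherits B-Ar" means ALL 24 leaves —
  15 published, 7 supplied by 2024–2026 preprints, 2 unwritten (the general and the non-standard weighted
  fundamental lemmas) — for every one of these rows, whatever is granted on the unitary side.
* `Support.mok_leaf_support` — for each of the 29 leaves of Mok's DAG: a model in which Mok's section and supply
  edges and every other Mok leaf hold, the book's inputs hold in full, KMSW's chapter/supply/fine edges and every
  KMSW leaf other than the imported `MokMain` hold (so `KMSWInputs μ κ` and the sequels hold), all implications
  hold — and the fifteen statements that consume Mok, directly or THROUGH KMSW ("take on faith the main results of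
  [Mok]", KMSW main.tex l.69: the import edge `E_ImportMok`), fail (`UnitaryConsumersFail`: Chen–Zou, Scholze,
  LTXZZ, Marshall–Shin, Gerbelli-Gauthier, BPLZZ Thm 1.10, Li–Liu, BPCZ, CKT, Dalal–GG ×3, DEP, DHKM, Hsieh–Yamana
  §4.3), the 26 book-only statements holding (`BookOnlyHold`).
* `Support.kmsw_leaf_support` — for each of the 13 KMSW leaves other than `MokMain`: a model in which every KMSW
  edge bundle and every other KMSW leaf hold, the book's and Mok's inputs hold in full, all implications hold, the
  five consumers of the starred statements in full fail (`FullConsumersFail`: D1, D2, D3, D19 Thm 6.5.1, D18), and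
  the six consumers of the PROVED scope (C13 LTXZZ, C14 Thm 1.10, C19, C26, C158, C156 §4.3) fail exactly when the
  leaf is not one of `AubertSS`, `KMS_A`, `KMS_B` (`kmsw_scope_consumers_iff`) — the register-level form of
  `KMSW2014.LeafSupport.leaf_essential_scope`, containing `Downstream.sequels_not_bypassed` (₁,₂,₃) as the cases
  `KMS_A`, `KMS_B`.
* (v1.1) `Support.book_leaf_support₄`, `mok_leaf_support₄`, `kmsw_ballLine_iff` — the same for the fourth tranche of
  `Downstream.lean` v6 (Bergeron–Millson–Mœglin ×2, Bergeron–Clozel ×2, Peng, Lanard–Mínguez, Adrian–Stevens, Barros–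
  He–Kiefer, Barros–Flapan–Zuffetti Cor. 1.7, J. G. Chen, Stover): all 24 book leaves for the nine book-line statements;
  all 29 Mok leaves for the ball-quotient line (BMM Acta ⇒ Stover) and for Bergeron–Clozel 2017 / Peng; and the
  ball-quotient line's KMSW-support is EXACTLY the five premises of `E_StabOrdI` (two-sided by `decide`) — it consumes
  no theorem of KMSW.
* `Support.shin_weakS_of_nine` / `Support.shin_weakS_support` — a consumer that inherits LESS, two-sided: Shin's weak
  transfer in Case S (Essential Number Theory 2024 [cite: Shin2024], Thm 1.1.2) follows from the supply edges, the
  register and NINE of the 24 book leaves (FL, WFL_split, W4_Thm38, STF_Arthur, TwistedTF, MW_Stab, SpecGLN,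
  WFL_general, WFL_nonstandard — a sharper sufficiency theorem than `Shin.weakS_of_leaves`, which takes the whole
  `PublishedLeaves` bundle), and in the 24 book models above `WeakS` fails EXACTLY at those nine leaves
  (`shin_weakS_support : WeakS ↔ l.shinS = false`, by `decide` on the carver's numerals).  Support(WeakS) = these 9
  leaves exactly; the book's derivations, [A24]–[A27], the AGIKMS supplies, LLC for GL_N, the archimedean packet
  inputs are NOT in it — Shin's "(H1) only" sentence (p0006:L5) with its published companions made explicit.

**Method.**  All bookkeeping; no mathematics of automorphic forms.  The node assignments are the valuation
structures `LeafSupport.mkN v` of the three leaf-support modules: the carver's least models `cm l` for the DAG whose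
leaf is removed, and the ALL-ONES valuation (every atom true: `topBook`, `topMok`, `topKMSW`) for the DAGs granted in
full, whose edge systems hold by `systems_of_check _ (by decide)`.  "Holds" facts are obtained from the landed
composition theorems of `Downstream.lean` applied to `canon_implications…` (so they re-check those theorems against
the canonical reading); "fails" facts from `LeafSupport.countermodel` / `not_all_of_noMain` and their Mok / KMSW
analogues.  SCOPE CAVEATS as in the leaf-support modules: (i) relative to the transcription (register edges as typed
— one edge per paper quoting its invocation sentence; a paper that uses less of the book than "everything at all
ranks" would get a smaller support under a finer edge, exactly as Shin's does); (ii) the consumer propositions are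
interpreted canonically — a different interpretation can only make MORE consumers true, never rescue a derivation.

Axioms: every theorem is closed or uses only `propext` (via `decide` / `simp` in the imported certificates); no
`Classical.choice`, no `Lean.ofReduceBool`, no `sorry`, no `opaque`.
-/

set_option autoImplicit false

namespace Literature.NumberTheory.Automorphic.Arthur2013

namespace Downstream

namespace Support



/-! ## 1. The canonical (least-model) consumer assignment -/

section Canon

variable (ν : Nodes) (μ : Mok2015.Nodes) (κ : KMSW2014.Nodes)

/-- The canonical reading of the first-tranche consumers: each statement := (a consequence of) exactly the premises
of its typed edge — book consumers read as `∀ N, ν.Everything N`, joint ones as its conjunction with `∀ N, μ.Everything N`,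
KMSW proved-scope consumers as `∀ N, κ.Scope N`, consumers of the starred statements in full as `∀ N, κ.Full N`; auxiliary stabilisation nodes as their premise conjunctions;
Ishimoto's unwritten sequel GRANTED (so that a failure is never blamed on it). [cite: Arthur2013, downstream register of the cell (canonical model; bookkeeping)] -/
abbrev canon : Consumers where
  StabInner := ν.FL ∧ ν.WFL_split ∧ ν.WFL_general ∧ ν.STF_Arthur
  StabOrdSim := ν.FL ∧ ν.WFL_split ∧ ν.WFL_general ∧ ν.STF_Arthur
  StabTwSim := ν.TWFL ∧ ν.WFL_nonstandard ∧ ν.FL ∧ ν.TwistedTF ∧ ν.MW_Stab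
  NonsplitOddAMFgen := ∀ N, ν.Everything N
  IshimotoSequel := True
  AMR := ∀ N, ν.Everything N
  TaibiInner := ∀ N, ν.Everything N
  IshimotoGeneric := ∀ N, ν.Everything N
  IshimotoFull := ∀ N, ν.Everything N
  XuGSp := ∀ N, ν.Everything N
  GeeTaibi := ∀ N, ν.Everything N
  ChenZou := (∀ N, ν.Everything N) ∧ (∀ N, μ.Everything N)
  GanIchino11 := ∀ N, ν.Everything N
  GanIchino14 := ∀ N, ν.Everything N
  TaibiDim := ∀ N, ν.Everything N
  ChenevierRenardStar := ∀ N, ν.Everything N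
  ChenevierRenardStarStar := ∀ N, ν.Everything N
  ChenevierLannesStar := ∀ N, ν.Everything N
  ChenevierTaibi := ∀ N, ν.Everything N
  KretShinGSp := ∀ N, ν.Everything N
  BCGP := ∀ N, ν.Everything N
  ScholzeTR := (∀ N, ν.Everything N) ∧ (∀ N, μ.Everything N)
  LTXZZ := ∀ N, κ.Scope N
  MarshallShin := ∀ N, κ.Full N
  GerbelliGauthier := (∀ N, μ.Everything N) ∧ (∀ N, κ.Full N)

/-- The canonical reading of the second tranche (BPLZZ Thm 1.8, whose edge has no premise, read as `True`). [cite: Arthur2013, downstream register of the cell, second tranche (canonical model; bookkeeping)] -/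
abbrev canon₂ : Consumers2 where
  MoeglinRenard := ∀ N, ν.Everything N
  XuMoeglinParam := ∀ N, ν.Everything N
  AtobeJacquet := ∀ N, ν.Everything N
  KretShinGSO := ∀ N, ν.Everything N
  BPLZZggp := True
  BPLZZii := (∀ N, μ.Everything N) ∧ (∀ N, κ.Scope N)
  LiLiu := ∀ N, κ.Scope N
  BPCZii := (∀ N, μ.Everything N) ∧ (∀ N, κ.Scope N)
  BLMM := ∀ N, ν.Everything N
  CKT := (∀ N, ν.Everything N) ∧ (∀ N, μ.Everything N)
  DalalGG := (∀ N, μ.Everything N) ∧ (∀ N, κ.Full N)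
  EGG := ∀ N, ν.Everything N

/-- The canonical reading of the third tranche (Rogawski's published input and the Rogawski-routed n = 3 theorem
GRANTED). [cite: Arthur2013, downstream register of the cell, third tranche (canonical model; bookkeeping)] -/
abbrev canon₃ : Consumers3 where
  BCGPmod := ∀ N, ν.Everything N
  Whitmore := ∀ N, ν.Everything N
  DGGroot := (∀ N, ν.Everything N) ∧ (∀ N, μ.Everything N)
  DGGinner := (∀ N, μ.Everything N) ∧ (∀ N, κ.Full N)
  DEPgates := (∀ N, μ.Everything N) ∧ (∀ N, κ.Full N)
  AHKO := ∀ N, ν.Everything N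
  DHKM := (∀ N, ν.Everything N) ∧ (∀ N, μ.Everything N) ∧ (∀ N, κ.Scope N)
  Rogawski := True
  HsiehYamana3 := True
  HsiehYamanaGen := ∀ N, κ.Scope N

/-- The canonical reading of Shin (2024): weak transfer := exactly the premises of `Shin.E_WeakS` / `E_WeakU`; the
published GL_N Galois representations and the hypotheses (H2), (H3) GRANTED. [cite: Shin2024, Thms 1.1.2, 1.2.2 (canonical model; bookkeeping)] -/
abbrev canonShin : Shin where
  WeakS := ν.StabTw ∧ ν.StabOrd ∧ (ν.FL ∧ ν.WFL_split ∧ ν.WFL_general ∧ ν.STF_Arthur) ∧ ν.SpecGLN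
  WeakU := μ.StabTw ∧ μ.StabOrdU ∧ κ.StabOrdI ∧ μ.SpecGLN
  GalRepGLN := True
  H2 := True
  H3 := True
  BuzzardGee := (ν.StabTw ∧ ν.StabOrd ∧ (ν.FL ∧ ν.WFL_split ∧ ν.WFL_general ∧ ν.STF_Arthur) ∧ ν.SpecGLN) ∧ (μ.StabTw ∧ μ.StabOrdU ∧ κ.StabOrdI ∧ μ.SpecGLN)
  BuzzardGeeExistence := (ν.StabTw ∧ ν.StabOrd ∧ (ν.FL ∧ ν.WFL_split ∧ ν.WFL_general ∧ ν.STF_Arthur) ∧ ν.SpecGLN) ∧ (μ.StabTw ∧ μ.StabOrdU ∧ κ.StabOrdI ∧ μ.SpecGLN)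

/-- Every first-tranche edge of the register holds in the canonical reading, for arbitrary ν, μ, κ. [cite: Arthur2013, downstream register of the cell (bookkeeping proved here)] -/
theorem canon_implications : Implications ν μ κ (canon ν μ κ) where
  stabInner := fun a b c d => ⟨a, b, c, d⟩
  stabOrdSim := fun a b c d => ⟨a, b, c, d⟩
  stabTwSim := fun a b c d e => ⟨a, b, c, d, e⟩
  amr := fun h => h
  taibiInner := fun h _ _ => h
  ishimotoGeneric := fun h _ => h
  ishimotoFull := fun h _ => h
  nonsplitOdd := fun h => h
  ganIchino11 := fun h => h
  ganIchino14 := fun h _ => h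
  xu := fun h _ _ => h
  geeTaibi := fun h _ _ _ => h
  chenZou := fun h m => ⟨h, m⟩
  taibiDim := fun h _ => h
  crStar := fun h => h
  crStarStar := fun h _ _ => h
  cl := fun h => h
  ct := fun h _ _ => h
  kretShin := fun h _ => h
  bcgp := fun h => h
  scholze := fun h m => ⟨h, m⟩
  ltxzz := fun h => h
  marshallShin := fun h => h
  gg := fun m f => ⟨m, f⟩

/-- Every second-tranche edge holds in the canonical reading. [cite: Arthur2013, downstream register of the cell, second tranche (bookkeeping proved here)] -/
theorem canon_implications₂ : Implications2 ν μ κ (canon ν μ κ) (canon₂ ν μ κ) where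
  mr := fun h _ => h
  xuM := fun h => h
  atobe := fun h => h
  ksGSO := fun h _ => h
  bplzzGgp := trivial
  bplzzIi := fun m k _ => ⟨m, k⟩
  liLiu := fun k => k
  bpcz := fun m k => ⟨m, k⟩
  blmm := fun h _ => h
  ckt := fun h m => ⟨h, m⟩
  dgg := fun m f _ => ⟨m, f⟩
  egg := fun h _ => h

/-- Every third-tranche edge holds in the canonical reading. [cite: Arthur2013, downstream register of the cell, third tranche (bookkeeping proved here)] -/
theorem canon_implications₃ : Implications3 ν μ κ (canon ν μ κ) (canon₃ ν μ κ) where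
  bcgpMod := fun h _ => h
  whitmore := fun h _ => h
  dggRoot := fun h m => ⟨h, m⟩
  dggInner := fun m f _ => ⟨m, f⟩
  dep := fun m f _ => ⟨m, f⟩
  ahko := fun h => h
  dhkm := fun h m k _ _ => ⟨h, m, k⟩
  hy3 := fun _ => trivial
  hyGen := fun k => k

/-- Shin's four derivations hold in the canonical reading. [cite: Shin2024, Thms 1.1.2, 1.2.2 (bookkeeping proved here)] -/
theorem canon_shin : Shin.Implications ν μ κ (canon ν μ κ) (canonShin ν μ κ) where
  weakS := fun a b c d => ⟨a, b, c, d⟩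
  weakU := fun a b c d => ⟨a, b, c, d⟩
  bg := fun s u _ _ _ => ⟨s, u⟩
  bgExistence := fun s u _ _ => ⟨s, u⟩

end Canon

/-! ## 2. Consumer classes (row lists of the cell's `DOWNSTREAM.md`) -/

/-- Every downstream statement whose typed derivation passes through the book FAILS (29 statements: rows B1, A3, A5
×2, A7, A4, A6, C1 ×2, C4, C3 ×2, C5, C6, C10, C9, C12; A8, B2, B4, C11, C99, C71, D4; C153, C154, D19 Thm 1.2.1, B58,
C158). [cite: Arthur2013, downstream register of the cell (row classes; bookkeeping)] -/
structure BookConsumersFail (c : Consumers) (c₂ : Consumers2) (c₃ : Consumers3) : Prop where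
  amr : ¬ c.AMR
  taibiInner : ¬ c.TaibiInner
  ishimotoGeneric : ¬ c.IshimotoGeneric
  ishimotoFull : ¬ c.IshimotoFull
  xuGSp : ¬ c.XuGSp
  geeTaibi : ¬ c.GeeTaibi
  chenZou : ¬ c.ChenZou
  ganIchino11 : ¬ c.GanIchino11
  ganIchino14 : ¬ c.GanIchino14
  taibiDim : ¬ c.TaibiDim
  chenevierRenardStar : ¬ c.ChenevierRenardStar
  chenevierRenardStarStar : ¬ c.ChenevierRenardStarStar
  chenevierLannesStar : ¬ c.ChenevierLannesStar
  chenevierTaibi : ¬ c.ChenevierTaibi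
  kretShinGSp : ¬ c.KretShinGSp
  bcgp : ¬ c.BCGP
  scholzeTR : ¬ c.ScholzeTR
  moeglinRenard : ¬ c₂.MoeglinRenard
  xuMoeglinParam : ¬ c₂.XuMoeglinParam
  atobeJacquet : ¬ c₂.AtobeJacquet
  kretShinGSO : ¬ c₂.KretShinGSO
  blmm : ¬ c₂.BLMM
  ckt : ¬ c₂.CKT
  egg : ¬ c₂.EGG
  bcgpMod : ¬ c₃.BCGPmod
  whitmore : ¬ c₃.Whitmore
  dggRoot : ¬ c₃.DGGroot
  ahko : ¬ c₃.AHKO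
  dhkm : ¬ c₃.DHKM

/-- The twelve statements whose typed derivations consume only the unitary DAGs (or nothing) HOLD (rows C13, D1, D2,
C14 ×2, C19, C26, D3, D19 Thm 6.5.1, D18, C156 ×2). [cite: Arthur2013, downstream register of the cell (row classes; bookkeeping)] -/
structure UnitaryOnlyHold (c : Consumers) (c₂ : Consumers2) (c₃ : Consumers3) : Prop where
  ltxzz : c.LTXZZ
  marshallShin : c.MarshallShin
  gerbelliGauthier : c.GerbelliGauthier
  bplzzGgp : c₂.BPLZZggp
  bplzzIi : c₂.BPLZZii
  liLiu : c₂.LiLiu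
  bpczIi : c₂.BPCZii
  dalalGG : c₂.DalalGG
  dggInner : c₃.DGGinner
  depGates : c₃.DEPgates
  hsiehYamana3 : c₃.HsiehYamana3
  hsiehYamanaGen : c₃.HsiehYamanaGen

/-- The fifteen statements whose typed derivations consume Mok's memoir — directly or through KMSW's import of it —
FAIL (rows A6, C12, C13, D1, D2, C14 Thm 1.10, C19, C26, C71, D3, D19 ×2, D18, C158, C156 §4.3). [cite: Mok2012, downstream register of the cell (row classes; bookkeeping)] -/
structure UnitaryConsumersFail (c : Consumers) (c₂ : Consumers2) (c₃ : Consumers3) : Prop where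
  chenZou : ¬ c.ChenZou
  scholzeTR : ¬ c.ScholzeTR
  ltxzz : ¬ c.LTXZZ
  marshallShin : ¬ c.MarshallShin
  gerbelliGauthier : ¬ c.GerbelliGauthier
  bplzzIi : ¬ c₂.BPLZZii
  liLiu : ¬ c₂.LiLiu
  bpczIi : ¬ c₂.BPCZii
  ckt : ¬ c₂.CKT
  dalalGG : ¬ c₂.DalalGG
  dggRoot : ¬ c₃.DGGroot
  dggInner : ¬ c₃.DGGinner
  depGates : ¬ c₃.DEPgates
  dhkm : ¬ c₃.DHKM
  hsiehYamanaGen : ¬ c₃.HsiehYamanaGen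

/-- The 26 statements whose typed derivations consume only the book (or nothing) HOLD. [cite: Arthur2013, downstream register of the cell (row classes; bookkeeping)] -/
structure BookOnlyHold (c : Consumers) (c₂ : Consumers2) (c₃ : Consumers3) : Prop where
  amr : c.AMR
  taibiInner : c.TaibiInner
  ishimotoGeneric : c.IshimotoGeneric
  ishimotoFull : c.IshimotoFull
  xuGSp : c.XuGSp
  geeTaibi : c.GeeTaibi
  ganIchino11 : c.GanIchino11
  ganIchino14 : c.GanIchino14
  taibiDim : c.TaibiDim
  chenevierRenardStar : c.ChenevierRenardStar
  chenevierRenardStarStar : c.ChenevierRenardStarStar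
  chenevierLannesStar : c.ChenevierLannesStar
  chenevierTaibi : c.ChenevierTaibi
  kretShinGSp : c.KretShinGSp
  bcgp : c.BCGP
  moeglinRenard : c₂.MoeglinRenard
  xuMoeglinParam : c₂.XuMoeglinParam
  atobeJacquet : c₂.AtobeJacquet
  kretShinGSO : c₂.KretShinGSO
  bplzzGgp : c₂.BPLZZggp
  blmm : c₂.BLMM
  egg : c₂.EGG
  bcgpMod : c₃.BCGPmod
  whitmore : c₃.Whitmore
  ahko : c₃.AHKO
  hsiehYamana3 : c₃.HsiehYamana3

/-- The five consumers of KMSW's starred statements IN FULL fail (rows D1, D2, D3, D19 Thm 6.5.1, D18). [claim: KalethaMinguezShinWhite2014, under-review] (row classes; bookkeeping) -/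
structure FullConsumersFail (c : Consumers) (c₂ : Consumers2) (c₃ : Consumers3) : Prop where
  marshallShin : ¬ c.MarshallShin
  gerbelliGauthier : ¬ c.GerbelliGauthier
  dalalGG : ¬ c₂.DalalGG
  dggInner : ¬ c₃.DGGinner
  depGates : ¬ c₃.DEPgates

/-- The six consumers of KMSW's PROVED scope (rows C13, C14 Thm 1.10, C19, C26, C158, C156 §4.3), as one conjunction. [claim: KalethaMinguezShinWhite2014, under-review] (row classes; bookkeeping) -/
structure ScopeConsumers (c : Consumers) (c₂ : Consumers2) (c₃ : Consumers3) : Prop where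
  ltxzz : c.LTXZZ
  bplzzIi : c₂.BPLZZii
  liLiu : c₂.LiLiu
  bpczIi : c₂.BPCZii
  dhkm : c₃.DHKM
  hsiehYamanaGen : c₃.HsiehYamanaGen

/-- The same six, each negated. [claim: KalethaMinguezShinWhite2014, under-review] (row classes; bookkeeping) -/
structure ScopeConsumersFail (c : Consumers) (c₂ : Consumers2) (c₃ : Consumers3) : Prop where
  ltxzz : ¬ c.LTXZZ
  bplzzIi : ¬ c₂.BPLZZii
  liLiu : ¬ c₂.LiLiu
  bpczIi : ¬ c₂.BPCZii
  dhkm : ¬ c₃.DHKM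
  hsiehYamanaGen : ¬ c₃.HsiehYamanaGen

/-- The statements that consume neither KMSW node: the 26 book-only ones and the four book-and-Mok ones (A6, C12,
C71, D19 Thm 1.2.1) HOLD. [cite: Arthur2013, downstream register of the cell (row classes; bookkeeping)] -/
structure NonKMSWHold (c : Consumers) (c₂ : Consumers2) (c₃ : Consumers3) : Prop where
  bookOnly : BookOnlyHold c c₂ c₃
  chenZou : c.ChenZou
  scholzeTR : c.ScholzeTR
  ckt : c₂.CKT
  dggRoot : c₃.DGGroot

/-! ## 3. The all-ones valuations: a DAG granted in full -/

/-- All 87 atoms of the book's DAG true (`2^87 - 1`). [folklore] (bookkeeping) -/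
def topBook : Nat := 154742504910672534362390527
/-- All 54 atoms of Mok's DAG true (`2^54 - 1`). [folklore] (bookkeeping) -/
def topMok : Nat := 18014398509481983
/-- All 53 atoms of KMSW's DAG true (`2^53 - 1`). [folklore] (bookkeeping) -/
def topKMSW : Nat := 9007199254740991

/-- The book's node assignment with every atom true. [folklore] (bookkeeping) -/
abbrev νtop : Nodes := LeafSupport.mkN topBook
/-- Mok's node assignment with every atom true. [folklore] (bookkeeping) -/
abbrev μtop : Mok2015.Nodes := Mok2015.LeafSupport.mkN topMok
/-- KMSW's node assignment with every atom true. [folklore] (bookkeeping) -/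
abbrev κtop : KMSW2014.Nodes := KMSW2014.LeafSupport.mkN topKMSW

/-- The book's edge system holds in the all-ones assignment. [folklore] (bookkeeping proved here) -/
theorem systems_top : LeafSupport.Systems νtop (LeafSupport.mkW topBook) (LeafSupport.mkG topBook) :=
  LeafSupport.systems_of_check topBook (by decide)

/-- Every book leaf holds in the all-ones assignment. [folklore] (bookkeeping proved here) -/
theorem leaves_top : ∀ l : LeafSupport.Leaf, νtop.leaf l := by
  intro l; cases l <;> exact (LeafSupport.leaf_mk _ _).2 (by decide)

/-- The book's inputs in full, from the all-ones assignment. [cite: Arthur2013, §1.5 (bookkeeping proved here)] -/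
theorem bookInputs_top : BookInputs νtop :=
  have h := (LeafSupport.leaves_iff νtop).2 leaves_top
  ⟨systems_top.book, systems_top.supply, h.1, h.2.1, h.2.2⟩

/-- Mok's edge system holds in the all-ones assignment. [folklore] (bookkeeping proved here) -/
theorem mokSystems_top : Mok2015.LeafSupport.Systems μtop :=
  Mok2015.LeafSupport.systems_of_check topMok (by decide)

/-- Every Mok leaf holds in the all-ones assignment. [folklore] (bookkeeping proved here) -/
theorem mokLeaves_top : ∀ l : Mok2015.LeafSupport.Leaf, μtop.leaf l := by
  intro l; cases l <;> exact (Mok2015.LeafSupport.prop_mk topMok 0 _).2 (by decide)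

/-- Mok's inputs in full, from the all-ones assignment. [cite: Mok2012, §5.3 (bookkeeping proved here)] -/
theorem mokInputs_top : MokInputs μtop :=
  have h := (Mok2015.LeafSupport.leaves_iff μtop).1 mokLeaves_top
  ⟨mokSystems_top.sect, mokSystems_top.supply, h.1, h.2.1, h.2.2⟩

/-- KMSW's edge system holds in the all-ones assignment. [folklore] (bookkeeping proved here) -/
theorem kmswSystems_top : KMSW2014.LeafSupport.Systems κtop (KMSW2014.LeafSupport.mkW topKMSW) :=
  KMSW2014.LeafSupport.systems_of_check topKMSW (by decide)

/-- Every KMSW leaf holds in the all-ones assignment. [folklore] (bookkeeping proved here) -/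
theorem kmswLeaves_top : ∀ l : KMSW2014.LeafSupport.Leaf, κtop.leaf l := by
  intro l; cases l <;> exact (KMSW2014.LeafSupport.leaf_mk _ _).2 (by decide)

/-- KMSW's inputs for the proved scope (with the Mok import edge, whatever μ is) and the two sequels, from the
all-ones assignment. [claim: KalethaMinguezShinWhite2014, under-review] (bookkeeping proved here) -/
theorem kmswInputs_top (μ : Mok2015.Nodes) : KMSWInputs μ κtop ∧ κtop.UnwrittenSequels :=
  have h := (KMSW2014.LeafSupport.leaves_iff κtop).2 kmswLeaves_top
  ⟨⟨fun _ => h.2.1.mok, kmswSystems_top.chapter, kmswSystems_top.supply, h.1, h.2.2.1⟩, h.2.2.2⟩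

/-! ## 4. Book leaves: each of the 24 is load-bearing for every book consumer -/

/-- In the carver's countermodel for book leaf `l`, "everything the book establishes" fails at every rank, hence
the all-ranks premise of every book consumer fails. [cite: Arthur2013, §1.5 (bookkeeping proved here)] -/
theorem not_B_cm (l : LeafSupport.Leaf) : ¬ ∀ N, (LeafSupport.mkN (LeafSupport.cm l)).Everything N :=
  fun h => LeafSupport.not_all_of_noMain ((LeafSupport.countermodel l).2.2.2 0) (h 0).all

/-- BOOK-LEAF SUPPORT OF THE REGISTER.  For every one of the 24 leaves `l` of the book's DAG there are node
assignments ν (with waypoints), μ, κ and consumer assignments c, c₂, c₃, s such that: every edge bundle of the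
book's three DAG modules holds and every OTHER book leaf holds while `l` fails (the carver's certificate); Mok's
inputs, KMSW's inputs and KMSW's sequels hold in full; every auxiliary input of the register is granted; all four
implication bundles of `Downstream.lean` hold; every one of the 29 book-consuming downstream statements FAILS and
the twelve unitary-only ones hold.  Consequently none of the 24 leaf hypotheses packaged in `BookInputs ν` can be
dropped from `taibiInner_of_leaves`, `xu_of_leaves`, `geeTaibi_of_leaves`, `bcgp_of_leaves`, `scholzeTR_of_leaves`,
`ckt_of_leaves`, `dhkm_of_leaves`, … as typed: "inherits B-Ar" is, for each of these rows, ALL 24 leaves. [cite: Arthur2013, §1.5 with AGIKMS2024 l.380-382 (bookkeeping proved here: the "only if" half of the register's book entries)] -/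
theorem book_leaf_support (l : LeafSupport.Leaf) :
    ∃ (ν : Nodes) (ω : Waypoints) (γ : GlobalWaypoints) (μ : Mok2015.Nodes) (κ : KMSW2014.Nodes)
      (c : Consumers) (c₂ : Consumers2) (c₃ : Consumers3) (s : Shin),
      LeafSupport.Systems ν ω γ ∧ (∀ l', l' ≠ l → ν.leaf l') ∧ ¬ ν.leaf l ∧
      MokInputs μ ∧ KMSWInputs μ κ ∧ κ.UnwrittenSequels ∧
      Implications ν μ κ c ∧ Implications2 ν μ κ c c₂ ∧ Implications3 ν μ κ c c₃ ∧ Shin.Implications ν μ κ c s ∧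
      c.IshimotoSequel ∧ c₃.Rogawski ∧ s.GalRepGLN ∧ s.H2 ∧ s.H3 ∧
      BookConsumersFail c c₂ c₃ ∧ UnitaryOnlyHold c c₂ c₃ := by
  have cmod := LeafSupport.countermodel l
  have nb := not_B_cm l
  have KQ := kmswInputs_top μtop
  have I := canon_implications (LeafSupport.mkN (LeafSupport.cm l)) μtop κtop
  have J := canon_implications₂ (LeafSupport.mkN (LeafSupport.cm l)) μtop κtop
  have L := canon_implications₃ (LeafSupport.mkN (LeafSupport.cm l)) μtop κtop
  refine ⟨_, _, _, μtop, κtop, canon _ μtop κtop, canon₂ _ μtop κtop, canon₃ _ μtop κtop, canonShin _ μtop κtop,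
    cmod.1, cmod.2.1, cmod.2.2.1, mokInputs_top, KQ.1, KQ.2, I, J, L, canon_shin _ _ _,
    trivial, trivial, trivial, trivial, trivial, ?_, ?_⟩
  · exact ⟨nb, nb, nb, nb, nb, nb, fun h => nb h.1, nb, nb, nb, nb, nb, nb, nb, nb, nb, fun h => nb h.1,
      nb, nb, nb, nb, nb, fun h => nb h.1, nb, nb, nb, fun h => nb h.1, nb, fun h => nb h.1⟩
  · exact ⟨ltxzz_of_leaves I mokInputs_top KQ.1, marshallShin_of_leaves I mokInputs_top KQ.1 KQ.2,
      gerbelliGauthier_of_leaves I mokInputs_top KQ.1 KQ.2, bplzzGgp_inherits_nothing J,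
      bplzzIi_of_leaves J mokInputs_top KQ.1, liLiu_of_leaves J mokInputs_top KQ.1, bpczIi_of_leaves J mokInputs_top KQ.1,
      dalalGG_of_leaves J mokInputs_top KQ.1 KQ.2, dggInner_of_leaves L mokInputs_top KQ.1 KQ.2,
      depGates_of_leaves L mokInputs_top KQ.1 KQ.2, hsiehYamana3_inherits_nothing L trivial,
      hsiehYamanaGen_of_leaves L mokInputs_top KQ.1⟩

/-- The same, phrased against the hypothesis list of the composition theorems: it is NOT the case that the book's
edge system, the other 23 leaves, Mok's and KMSW's full inputs and the register's implications yield even ONE of the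
book consumers (here: the weakest-looking, AMR's identification of Arthur's packets with Adams–Johnson's, row B1). [cite: ArancibiaMoeglinRenard2015, Théorème 1.1 (bookkeeping proved here)] -/
theorem amr_not_derivable_without (l : LeafSupport.Leaf) :
    ¬ (∀ (ν : Nodes) (ω : Waypoints) (γ : GlobalWaypoints) (μ : Mok2015.Nodes) (κ : KMSW2014.Nodes) (c : Consumers),
        LeafSupport.Systems ν ω γ → (∀ l', l' ≠ l → ν.leaf l') → MokInputs μ → KMSWInputs μ κ →
        Implications ν μ κ c → c.AMR) := by
  intro H
  have cmod := LeafSupport.countermodel l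
  exact not_B_cm l (H _ _ _ μtop κtop (canon _ μtop κtop) cmod.1 cmod.2.1 mokInputs_top (kmswInputs_top μtop).1
    (canon_implications _ _ _))

/-- The two STILL-UNWRITTEN book leaves displayed separately for the downstream register: granting every edge, all
published and all 2024–2026 preprint leaves of the book, the whole unitary side and ONE of the two weighted
fundamental lemmas, every book consumer still fails without the other. [cite: AGIKMS2024, l.380-382 and l.986-990 (bookkeeping proved here)] -/
theorem unwritten_leaves_each_essential_downstream :
    (∃ (ν : Nodes) (ω : Waypoints) (γ : GlobalWaypoints) (μ : Mok2015.Nodes) (κ : KMSW2014.Nodes)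
        (c : Consumers) (c₂ : Consumers2) (c₃ : Consumers3),
        LeafSupport.Systems ν ω γ ∧ ν.PublishedLeaves ∧ ν.PreprintLeaves2026 ∧ ν.WFL_nonstandard ∧ ¬ ν.WFL_general ∧
        MokInputs μ ∧ KMSWInputs μ κ ∧ Implications ν μ κ c ∧ Implications2 ν μ κ c c₂ ∧ Implications3 ν μ κ c c₃ ∧
        BookConsumersFail c c₂ c₃) ∧
    (∃ (ν : Nodes) (ω : Waypoints) (γ : GlobalWaypoints) (μ : Mok2015.Nodes) (κ : KMSW2014.Nodes)
        (c : Consumers) (c₂ : Consumers2) (c₃ : Consumers3),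
        LeafSupport.Systems ν ω γ ∧ ν.PublishedLeaves ∧ ν.PreprintLeaves2026 ∧ ν.WFL_general ∧ ¬ ν.WFL_nonstandard ∧
        MokInputs μ ∧ KMSWInputs μ κ ∧ Implications ν μ κ c ∧ Implications2 ν μ κ c c₂ ∧ Implications3 ν μ κ c c₃ ∧
        BookConsumersFail c c₂ c₃) := by
  constructor
  · obtain ⟨ν, ω, γ, μ, κ, c, c₂, c₃, s, hsys, h, hnot, hM, hK, -, hI, hJ, hL, -, -, -, -, -, -, hfail, -⟩ :=
      book_leaf_support .WFL_general
    exact ⟨ν, ω, γ, μ, κ, c, c₂, c₃, hsys,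
      ⟨h .LLC_GLN (by decide), h .SpecGLN (by decide), h .Transfer (by decide), h .FL (by decide), h .WFL_split (by decide),
        h .W4_Thm38 (by decide), h .STF_Arthur (by decide), h .TwistedTF (by decide), h .MW_Stab (by decide),
        h .MW_Stab_I411 (by decide), h .LocalTF (by decide), h .InvariantTF (by decide), h .ArchInputs_published (by decide),
        h .BanAubert (by decide), h .A11_twisted (by decide)⟩,
      ⟨h .AGIKMS_181 (by decide), h .AGIKMS_191 (by decide), h .AGIKMS_1105 (by decide), h .AGIKMS_D21 (by decide),
        h .AGIKMS_AppE (by decide), h .KM26 (by decide), h .CK26 (by decide)⟩,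
      h .WFL_nonstandard (by decide), hnot, hM, hK, hI, hJ, hL, hfail⟩
  · obtain ⟨ν, ω, γ, μ, κ, c, c₂, c₃, s, hsys, h, hnot, hM, hK, -, hI, hJ, hL, -, -, -, -, -, -, hfail, -⟩ :=
      book_leaf_support .WFL_nonstandard
    exact ⟨ν, ω, γ, μ, κ, c, c₂, c₃, hsys,
      ⟨h .LLC_GLN (by decide), h .SpecGLN (by decide), h .Transfer (by decide), h .FL (by decide), h .WFL_split (by decide),
        h .W4_Thm38 (by decide), h .STF_Arthur (by decide), h .TwistedTF (by decide), h .MW_Stab (by decide),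
        h .MW_Stab_I411 (by decide), h .LocalTF (by decide), h .InvariantTF (by decide), h .ArchInputs_published (by decide),
        h .BanAubert (by decide), h .A11_twisted (by decide)⟩,
      ⟨h .AGIKMS_181 (by decide), h .AGIKMS_191 (by decide), h .AGIKMS_1105 (by decide), h .AGIKMS_D21 (by decide),
        h .AGIKMS_AppE (by decide), h .KM26 (by decide), h .CK26 (by decide)⟩,
      h .WFL_general (by decide), hnot, hM, hK, hI, hJ, hL, hfail⟩

/-! ## 5. A consumer that inherits LESS, two-sided: Shin's weak transfer in Case S -/

/-- SUFFICIENCY, sharpened: Shin's weak transfer in Case S from the supply edges, the register's inner-form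
stabilisation edge and NINE leaves of the book's DAG — the fundamental lemma, the split weighted FL, [W4] Thm 3.8,
Arthur's STF I–III, the twisted trace formula, Mœglin–Waldspurger's stabilisation, the spectral theory of GL_N
(strong multiplicity one) and the two unwritten weighted fundamental lemmas; nothing else of `PublishedLeaves`, no
`BookEdges`, no `PreprintLeaves2026`. [cite: Shin2024, Thm 1.1.2 Case S with (H1) p0006:L5-20 (bookkeeping proved here)] -/
theorem shin_weakS_of_nine {ν : Nodes} {μ : Mok2015.Nodes} {κ : KMSW2014.Nodes} {c : Consumers} {s : Shin}
    (J : Shin.Implications ν μ κ c s) (I : Implications ν μ κ c) (S : ν.SupplyEdges) :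
    ν.FL → ν.WFL_split → ν.W4_Thm38 → ν.STF_Arthur → ν.TwistedTF → ν.MW_Stab → ν.SpecGLN →
      ν.WFL_general → ν.WFL_nonstandard → s.WeakS :=
  fun fl wfls w4 stf ttf mw spec h6 h7 =>
    have twfl : ν.TWFL := S.twfl w4 h6 h7
    J.weakS (S.stabTw twfl h7 fl ttf mw) (S.stabOrd fl wfls h6 stf) (I.stabInner fl wfls h6 stf) spec

/-- The nine book leaves of the preceding theorem, as a Boolean predicate on the carver's leaf type. [cite: Shin2024, (H1) p0006:L5 (bookkeeping)] -/
def _root_.Literature.NumberTheory.Automorphic.Arthur2013.LeafSupport.Leaf.shinS : LeafSupport.Leaf → Bool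
  | .FL => true | .WFL_split => true | .W4_Thm38 => true | .STF_Arthur => true | .TwistedTF => true
  | .MW_Stab => true | .SpecGLN => true | .WFL_general => true | .WFL_nonstandard => true
  | _ => false

/-- Boolean form of the canonical `WeakS` under a valuation structure. [folklore] (bookkeeping) -/
def weakSB (v : Nat) : Bool :=
  LeafSupport.allB v [.StabTw, .StabOrd, .FL, .WFL_split, .WFL_general, .STF_Arthur, .SpecGLN]

/-- The canonical `WeakS` of a valuation structure reads as `weakSB`. [folklore] (bookkeeping proved here) -/
theorem weakS_mk (v : Nat) (μ : Mok2015.Nodes) (κ : KMSW2014.Nodes) :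
    (canonShin (LeafSupport.mkN v) μ κ).WeakS ↔ weakSB v = true := by
  have e := LeafSupport.allP_iff_allB v [.StabTw, .StabOrd, .FL, .WFL_split, .WFL_general, .STF_Arthur, .SpecGLN]
  simp only [LeafSupport.allP] at e
  constructor
  · intro h
    obtain ⟨h1, h2, ⟨h3, h4, h5, h6⟩, h7⟩ := h
    exact e.1 ⟨h1, h2, h3, h4, h5, h6, h7, trivial⟩
  · intro h
    obtain ⟨h1, h2, h3, h4, h5, h6, h7, -⟩ := e.2 h
    exact ⟨h1, h2, ⟨h3, h4, h5, h6⟩, h7⟩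

/-- NECESSITY (and consistency), leaf by leaf: in the 24 book models of `book_leaf_support` (edge system + all leaves
but `l`, unitary side in full, canonical reading), Shin's weak transfer in Case S FAILS exactly when `l` is one of
the nine leaves of `shin_weakS_of_nine` and HOLDS for the other fifteen (LLC for GL_N, transfer, [MW I 4.11], the
local / invariant trace formulas, the archimedean packet inputs, Ban–Aubert, [A11]-twisted, the five AGIKMS supplies,
[KM26], [CK26]).  With `shin_weakS_of_nine`: support(WeakS) = those nine leaves EXACTLY, in the register as typed. [cite: Shin2024, (H1) and p0004:L15-18 (bookkeeping proved here: two-sided support of row E1)] -/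
theorem shin_weakS_support (l : LeafSupport.Leaf) :
    (canonShin (LeafSupport.mkN (LeafSupport.cm l)) μtop κtop).WeakS ↔ l.shinS = false := by
  rw [weakS_mk]
  cases l <;> decide

/-- The nine-leaf models packaged: for each of the nine leaves, a model of every book edge, every other book leaf,
the full unitary side, all implications (Shin's included) and the granted (H2), (H3), GL_N Galois representations,
in which `WeakS` fails. [cite: Shin2024, (H1) p0006:L5-13 (bookkeeping proved here)] -/
theorem shin_weakS_not_derivable_without (l : LeafSupport.Leaf) (h : l.shinS = true) :
    ∃ (ν : Nodes) (ω : Waypoints) (γ : GlobalWaypoints) (μ : Mok2015.Nodes) (κ : KMSW2014.Nodes) (c : Consumers)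
      (s : Shin),
      LeafSupport.Systems ν ω γ ∧ (∀ l', l' ≠ l → ν.leaf l') ∧ ¬ ν.leaf l ∧ MokInputs μ ∧ KMSWInputs μ κ ∧
      Implications ν μ κ c ∧ Shin.Implications ν μ κ c s ∧ s.GalRepGLN ∧ s.H2 ∧ s.H3 ∧ ¬ s.WeakS := by
  have cmod := LeafSupport.countermodel l
  refine ⟨_, _, _, μtop, κtop, canon _ μtop κtop, canonShin _ μtop κtop, cmod.1, cmod.2.1, cmod.2.2.1,
    mokInputs_top, (kmswInputs_top μtop).1, canon_implications _ _ _, canon_shin _ _ _, trivial, trivial, trivial, ?_⟩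
  rw [shin_weakS_support, h]
  decide

/-! ## 6. Mok leaves: each of the 29 is load-bearing for every unitary consumer -/

/-- KMSW's node assignment in which Mok's main results are NOT imported: the carver's least model over all KMSW
leaves but `MokMain`. [claim: KalethaMinguezShinWhite2014, under-review] (bookkeeping) -/
abbrev κnoMok : KMSW2014.Nodes := KMSW2014.LeafSupport.mkN (KMSW2014.LeafSupport.cm .MokMain)

/-- In `κnoMok`, KMSW's edges, published leaves, the general weighted FL and BOTH sequels hold, while neither the
proved scope nor the full statements hold at any rank. [claim: KalethaMinguezShinWhite2014, under-review] (bookkeeping proved here) -/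
theorem κnoMok_facts :
    KMSW2014.LeafSupport.Systems κnoMok (KMSW2014.LeafSupport.mkW (KMSW2014.LeafSupport.cm .MokMain)) ∧
    (∀ l', l' ≠ KMSW2014.LeafSupport.Leaf.MokMain → κnoMok.leaf l') ∧
    κnoMok.PublishedLeaves ∧ κnoMok.UnwrittenLeaves ∧ κnoMok.UnwrittenSequels ∧
    (∀ N, ¬ κnoMok.Scope N) ∧ (∀ N, ¬ κnoMok.Full N) := by
  have cmod := KMSW2014.LeafSupport.countermodel .MokMain
  have h := cmod.2.1
  exact ⟨cmod.1, h,
    ⟨h .GL_inner (by decide), h .Transfer (by decide), h .FL (by decide), h .WFL_split (by decide),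
      h .STF_Arthur (by decide), h .TF_analytic (by decide), h .EPIT_published (by decide), h .Glob_inputs (by decide),
      h .AubertSS (by decide), h .Ar_args (by decide)⟩,
    ⟨h .WFL_general (by decide)⟩, ⟨h .KMS_A (by decide), h .KMS_B (by decide)⟩,
    fun N => KMSW2014.LeafSupport.not_scope_of (KMSW2014.LeafSupport.scope_fails .MokMain (by decide) N),
    fun N => KMSW2014.LeafSupport.not_full_of_noFull (cmod.2.2.2 N)⟩

/-- In the carver's countermodel for Mok leaf `l`, "everything the memoir establishes" fails at every rank. [cite: Mok2012, §5.3 (bookkeeping proved here)] -/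
theorem not_M_cm (l : Mok2015.LeafSupport.Leaf) :
    ¬ ∀ N, (Mok2015.LeafSupport.mkN (Mok2015.LeafSupport.cm l)).Everything N :=
  fun h => Mok2015.LeafSupport.not_all_of_noGlobalMain ((Mok2015.LeafSupport.countermodel l).2.2.2 0)
    (h 0).2.2.2.2.2.2

/-- MOK-LEAF SUPPORT OF THE REGISTER.  For every one of the 29 leaves `l` of Mok's DAG there are assignments in
which Mok's section and supply edges and every other Mok leaf hold while `l` fails (the carver's certificate); the
book's inputs hold IN FULL; KMSW's edge bundles and every KMSW leaf except the imported `MokMain` hold — so KMSW's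
inputs `KMSWInputs μ κ` (whose import edge is discharged vacuously) and both sequels hold; all implication bundles
hold; the auxiliary inputs are granted; and every one of the fifteen Mok-consuming statements FAILS while the 26
book-only statements hold.  Hence no Mok leaf can be dropped from `ltxzz_of_leaves`, `marshallShin_of_leaves`,
`chenZou_of_leaves`, `dhkm_of_leaves`, … as typed — the consumers of KMSW inherit Mok's leaves through KMSW's
"take on faith the main results of [Mok]" (main.tex l.69). [cite: Mok2012, §5.3 l.4278 with KalethaEtAl2014 main.tex l.69 (bookkeeping proved here: the "only if" half of the register's B-Mok entries)] -/
theorem mok_leaf_support (l : Mok2015.LeafSupport.Leaf) :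
    ∃ (ν : Nodes) (μ : Mok2015.Nodes) (κ : KMSW2014.Nodes) (ωκ : KMSW2014.Waypoints)
      (c : Consumers) (c₂ : Consumers2) (c₃ : Consumers3) (s : Shin),
      Mok2015.LeafSupport.Systems μ ∧ (∀ l', l' ≠ l → μ.leaf l') ∧ ¬ μ.leaf l ∧
      BookInputs ν ∧ KMSW2014.LeafSupport.Systems κ ωκ ∧ (∀ l', l' ≠ KMSW2014.LeafSupport.Leaf.MokMain → κ.leaf l') ∧
      KMSWInputs μ κ ∧ κ.UnwrittenSequels ∧
      Implications ν μ κ c ∧ Implications2 ν μ κ c c₂ ∧ Implications3 ν μ κ c c₃ ∧ Shin.Implications ν μ κ c s ∧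
      c.IshimotoSequel ∧ c₃.Rogawski ∧ s.GalRepGLN ∧ s.H2 ∧ s.H3 ∧
      UnitaryConsumersFail c c₂ c₃ ∧ BookOnlyHold c c₂ c₃ := by
  have cmod := Mok2015.LeafSupport.countermodel l
  have nm := not_M_cm l
  have kf := κnoMok_facts
  have nk : ¬ ∀ N, κnoMok.Scope N := fun h => kf.2.2.2.2.2.1 0 (h 0)
  have nf : ¬ ∀ N, κnoMok.Full N := fun h => kf.2.2.2.2.2.2 0 (h 0)
  have KI : KMSWInputs (Mok2015.LeafSupport.mkN (Mok2015.LeafSupport.cm l)) κnoMok :=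
    ⟨fun hM => absurd hM nm, kf.1.chapter, kf.1.supply, kf.2.2.1, kf.2.2.2.1⟩
  have A := bookInputs_top
  have I := canon_implications νtop (Mok2015.LeafSupport.mkN (Mok2015.LeafSupport.cm l)) κnoMok
  have J := canon_implications₂ νtop (Mok2015.LeafSupport.mkN (Mok2015.LeafSupport.cm l)) κnoMok
  have L := canon_implications₃ νtop (Mok2015.LeafSupport.mkN (Mok2015.LeafSupport.cm l)) κnoMok
  refine ⟨νtop, _, κnoMok, _, canon νtop _ κnoMok, canon₂ νtop _ κnoMok, canon₃ νtop _ κnoMok, canonShin νtop _ κnoMok,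
    cmod.1, cmod.2.1, cmod.2.2.1, A, kf.1, kf.2.1, KI, kf.2.2.2.2.1, I, J, L, canon_shin _ _ _,
    trivial, trivial, trivial, trivial, trivial, ?_, ?_⟩
  · exact ⟨fun h => nm h.2, fun h => nm h.2, nk, nf, fun h => nm h.1, fun h => nm h.1, nk, fun h => nm h.1,
      fun h => nm h.2, fun h => nm h.1, fun h => nm h.2, fun h => nm h.1, fun h => nm h.1, fun h => nm h.2.1, nk⟩
  · exact ⟨amr_of_leaves I A, taibiInner_of_leaves I A, ishimotoGeneric_of_leaves I A, ishimotoFull_of_leaves I A trivial,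
      xu_of_leaves I A, geeTaibi_of_leaves I A, ganIchino11_of_leaves I A, ganIchino14_of_leaves I A, taibiDim_of_leaves I A,
      chenevierRenardStar_of_leaves I A, chenevierRenardStarStar_of_leaves I A, chenevierLannes_of_leaves I A,
      chenevierTaibi_of_leaves I A, kretShin_of_leaves I A, bcgp_of_leaves I A, moeglinRenard_of_leaves I J A,
      xuMoeglinParam_of_leaves J A, atobeJacquet_of_leaves J A, kretShinGSO_of_leaves I J A, bplzzGgp_inherits_nothing J,
      blmm_of_leaves I J A, egg_of_leaves I J A, bcgpMod_of_leaves I L A, whitmore_of_leaves I L A, ahko_of_leaves L A,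
      hsiehYamana3_inherits_nothing L trivial⟩

/-! ## 7. KMSW leaves: the 13 leaves other than `MokMain` -/

/-- KMSW-LEAF SUPPORT OF THE REGISTER.  For every leaf `l ≠ MokMain` of KMSW's DAG there are assignments in which
every KMSW edge bundle and every other KMSW leaf hold while `l` fails (the carver's certificate), the import edge
`E_ImportMok` holds, the book's and Mok's inputs hold IN FULL, all implication bundles hold, the auxiliary inputs are
granted, every statement that consumes no KMSW node holds — and the five consumers of the starred statements IN
FULL fail; moreover the six consumers of the PROVED scope fail too unless `l` is one of `AubertSS`, `KMS_A`, `KMS_B`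
(next theorem).  Hence no KMSW leaf other than those three can be dropped from `ltxzz_of_leaves`, `liLiu_of_leaves`,
`bpczIi_of_leaves`, `dhkm_of_leaves`, `hsiehYamanaGen_of_leaves`, and none at all from `marshallShin_of_leaves`,
`gerbelliGauthier_of_leaves`, `dalalGG_of_leaves`, `dggInner_of_leaves`, `depGates_of_leaves`, as typed. [claim: KalethaMinguezShinWhite2014, under-review] (bookkeeping proved here: the "only if" half of the register's B-KMSW / K1 entries) -/
theorem kmsw_leaf_support (l : KMSW2014.LeafSupport.Leaf) (hl : l ≠ .MokMain) :
    ∃ (ν : Nodes) (μ : Mok2015.Nodes) (κ : KMSW2014.Nodes) (ωκ : KMSW2014.Waypoints)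
      (c : Consumers) (c₂ : Consumers2) (c₃ : Consumers3) (s : Shin),
      KMSW2014.LeafSupport.Systems κ ωκ ∧ (∀ l', l' ≠ l → κ.leaf l') ∧ ¬ κ.leaf l ∧ KMSW2014.E_ImportMok μ κ ∧
      BookInputs ν ∧ MokInputs μ ∧
      Implications ν μ κ c ∧ Implications2 ν μ κ c c₂ ∧ Implications3 ν μ κ c c₃ ∧ Shin.Implications ν μ κ c s ∧
      c.IshimotoSequel ∧ c₃.Rogawski ∧ s.GalRepGLN ∧ s.H2 ∧ s.H3 ∧
      NonKMSWHold c c₂ c₃ ∧ FullConsumersFail c c₂ c₃ ∧ (l.onlyFull = false → ScopeConsumersFail c c₂ c₃) := by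
  have cmod := KMSW2014.LeafSupport.countermodel l
  have nf : ¬ ∀ N, (KMSW2014.LeafSupport.mkN (KMSW2014.LeafSupport.cm l)).Full N :=
    fun h => KMSW2014.LeafSupport.not_full_of_noFull (cmod.2.2.2 0) (h 0)
  have A := bookInputs_top
  have Mi := mokInputs_top
  have I := canon_implications νtop μtop (KMSW2014.LeafSupport.mkN (KMSW2014.LeafSupport.cm l))
  have J := canon_implications₂ νtop μtop (KMSW2014.LeafSupport.mkN (KMSW2014.LeafSupport.cm l))
  have L := canon_implications₃ νtop μtop (KMSW2014.LeafSupport.mkN (KMSW2014.LeafSupport.cm l))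
  refine ⟨νtop, μtop, _, _, canon νtop μtop _, canon₂ νtop μtop _, canon₃ νtop μtop _, canonShin νtop μtop _,
    cmod.1, cmod.2.1, cmod.2.2.1, fun _ => cmod.2.1 .MokMain (Ne.symm hl), A, Mi, I, J, L, canon_shin _ _ _,
    trivial, trivial, trivial, trivial, trivial, ?_, ?_, ?_⟩
  · exact ⟨⟨amr_of_leaves I A, taibiInner_of_leaves I A, ishimotoGeneric_of_leaves I A, ishimotoFull_of_leaves I A trivial,
      xu_of_leaves I A, geeTaibi_of_leaves I A, ganIchino11_of_leaves I A, ganIchino14_of_leaves I A, taibiDim_of_leaves I A,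
      chenevierRenardStar_of_leaves I A, chenevierRenardStarStar_of_leaves I A, chenevierLannes_of_leaves I A,
      chenevierTaibi_of_leaves I A, kretShin_of_leaves I A, bcgp_of_leaves I A, moeglinRenard_of_leaves I J A,
      xuMoeglinParam_of_leaves J A, atobeJacquet_of_leaves J A, kretShinGSO_of_leaves I J A, bplzzGgp_inherits_nothing J,
      blmm_of_leaves I J A, egg_of_leaves I J A, bcgpMod_of_leaves I L A, whitmore_of_leaves I L A, ahko_of_leaves L A,
      hsiehYamana3_inherits_nothing L trivial⟩,
      chenZou_of_leaves I A Mi, scholzeTR_of_leaves I A Mi, ckt_of_leaves J A Mi, dggRoot_of_leaves L A Mi⟩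
  · exact ⟨nf, fun h => nf h.2, fun h => nf h.2, fun h => nf h.2, fun h => nf h.2⟩
  · intro h0
    have nk : ¬ ∀ N, (KMSW2014.LeafSupport.mkN (KMSW2014.LeafSupport.cm l)).Scope N :=
      fun h => KMSW2014.LeafSupport.not_scope_of (KMSW2014.LeafSupport.scope_fails l h0 0) (h 0)
    exact ⟨nk, fun h => nk h.2, nk, fun h => nk h.2, fun h => nk h.2.2, nk⟩

/-- In the carver's least model over all KMSW leaves but one of `AubertSS`, `KMS_A`, `KMS_B`, the proved scope
still holds at every rank (those leaves feed only the starred statements in full). [claim: KalethaMinguezShinWhite2014, under-review] (bookkeeping proved here) -/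
theorem scope_of_onlyFull (l : KMSW2014.LeafSupport.Leaf) (h : l.onlyFull = true) :
    ∀ N, (KMSW2014.LeafSupport.mkN (KMSW2014.LeafSupport.cm l)).Scope N := by
  intro N
  cases l <;> first
    | exact absurd h (by decide)
    | exact (show _ ∧ _ ∧ _ from ⟨(KMSW2014.LeafSupport.prop_mk _ N .T161g).2 (by decide),
        (KMSW2014.LeafSupport.prop_mk _ N .LIRg).2 (by decide), (KMSW2014.LeafSupport.prop_mk _ N .T171p).2 (by decide)⟩)

/-- The proved-scope consumers in the thirteen KMSW models of `kmsw_leaf_support` (canonical reading): they HOLD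
exactly when the removed leaf is `AubertSS`, `KMS_A` or `KMS_B`, and fail otherwise — the register-level form of
`KMSW2014.LeafSupport.leaf_essential_scope`; the cases `KMS_A`, `KMS_B` are `Downstream.sequels_not_bypassed`
(₁, ₂, ₃) once more, now with the starred-statement consumers failing in the SAME model. [claim: KalethaMinguezShinWhite2014, under-review] (bookkeeping proved here) -/
theorem kmsw_scope_consumers_iff (l : KMSW2014.LeafSupport.Leaf) :
    ScopeConsumers (canon νtop μtop (KMSW2014.LeafSupport.mkN (KMSW2014.LeafSupport.cm l)))
        (canon₂ νtop μtop (KMSW2014.LeafSupport.mkN (KMSW2014.LeafSupport.cm l)))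
        (canon₃ νtop μtop (KMSW2014.LeafSupport.mkN (KMSW2014.LeafSupport.cm l))) ↔ l.onlyFull = true := by
  constructor
  · intro hs
    cases hb : l.onlyFull
    · exact absurd hs.1 fun hk =>
        KMSW2014.LeafSupport.not_scope_of (KMSW2014.LeafSupport.scope_fails l hb 0) (hk 0)
    · rfl
  · intro h
    have k := scope_of_onlyFull l h
    have m : ∀ N, μtop.Everything N := mokInputs_top.everything
    have b : ∀ N, νtop.Everything N := bookInputs_top.everything
    exact ⟨k, ⟨m, k⟩, k, ⟨m, k⟩, ⟨b, m, k⟩, k⟩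

/-! ## 8. Fourth tranche (v1.1, after `Downstream.lean` v6): exact supports of `Consumers4`

The canonical reading extended to the twelve statements of the fourth tranche (Bergeron–Millson–Mœglin ×2,
Bergeron–Clozel ×2, Peng, Lanard–Mínguez, Adrian–Stevens, Barros–He–Kiefer, Barros–Flapan–Zuffetti Cor. 1.7,
J. G. Chen, Stover, and the auxiliary AMR-unitary input) and the three families of countermodels run once more.  New
feature: the ball-quotient line (BMM Acta ⇒ Stover) consumes KMSW's DAG only through the inner-form stabilisation
node `StabOrdI`, so its KMSW-support is EXACTLY the five premises of `KMSW2014.Nodes.E_StabOrdI` (FL, WFL_split,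
WFL_general, STF_Arthur, Transfer) — `kmsw_ballLine_iff`, two-sided by `decide` — and NOT `MokMain`, the chapters or
the sequels; whereas its Mok-support is all 29 leaves (`mok_leaf_support₄`). -/

section Canon4

variable (ν : Nodes) (μ : Mok2015.Nodes) (κ : KMSW2014.Nodes)

/-- The canonical reading of the fourth tranche: book-line statements := `∀ N, ν.Everything N` (with Mok's
`Everything` where the edge has it), the ball-quotient line := Mok's `Everything` ∧ KMSW's `StabOrdI`. [cite: Arthur2013, downstream register of the cell, fourth tranche (canonical model; bookkeeping)] -/
abbrev canon₄ : Consumers4 where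
  AMRunitary := ∀ N, μ.Everything N
  BMMorth := ∀ N, ν.Everything N
  BMMball := (∀ N, μ.Everything N) ∧ κ.StabOrdI
  BergeronClozel13 := ∀ N, ν.Everything N
  BergeronClozel17 := (∀ N, ν.Everything N) ∧ (∀ N, μ.Everything N) ∧ κ.StabOrdI
  Peng := (∀ N, ν.Everything N) ∧ (∀ N, μ.Everything N)
  LanardMinguez := ∀ N, ν.Everything N
  AdrianStevens := ∀ N, ν.Everything N
  BHK := ∀ N, ν.Everything N
  BFZcor := ∀ N, ν.Everything N
  ChenSinger := ∀ N, ν.Everything N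
  StoverBall := (∀ N, μ.Everything N) ∧ κ.StabOrdI

/-- Every fourth-tranche edge holds in the canonical reading, for arbitrary ν, μ, κ. [cite: Arthur2013, downstream register of the cell, fourth tranche (bookkeeping proved here)] -/
theorem canon_implications₄ :
    Implications4 ν μ κ (canon ν μ κ) (canon₂ ν μ κ) (canon₃ ν μ κ) (canon₄ ν μ κ) where
  amrU := fun m => m
  bmmOrth := fun h _ _ => h
  bmmBall := fun m k _ => ⟨m, k⟩
  bc13 := fun h _ => h
  bc17 := fun h m _ k => ⟨h, m, k⟩
  peng := fun _ cz _ => cz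
  lanardMinguez := fun h => h
  adrianStevens := fun h _ => h
  bhk := fun h => h
  bfz := fun h => h
  chen := fun h => h
  stover := fun h => h

end Canon4

/-- Fourth tranche, book line: the nine statements whose typed derivation passes through the book FAIL (rows C17-IMRN,
D9, D10, A12, B65, B66, C161, C162, C163). [cite: Arthur2013, downstream register of the cell, fourth tranche (row classes; bookkeeping)] -/
structure BookConsumersFail₄ (c₄ : Consumers4) : Prop where
  bmmOrth : ¬ c₄.BMMorth
  bergeronClozel13 : ¬ c₄.BergeronClozel13
  bergeronClozel17 : ¬ c₄.BergeronClozel17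
  peng : ¬ c₄.Peng
  lanardMinguez : ¬ c₄.LanardMinguez
  adrianStevens : ¬ c₄.AdrianStevens
  bhk : ¬ c₄.BHK
  bfzCor : ¬ c₄.BFZcor
  chenSinger : ¬ c₄.ChenSinger

/-- Fourth tranche, the statements with NO Mok/KMSW premise HOLD (C17-IMRN, D9, B65, B66, C161, C162, C163). [cite: Arthur2013, downstream register of the cell, fourth tranche (row classes; bookkeeping)] -/
structure BookOnlyHold₄ (c₄ : Consumers4) : Prop where
  bmmOrth : c₄.BMMorth
  bergeronClozel13 : c₄.BergeronClozel13
  lanardMinguez : c₄.LanardMinguez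
  adrianStevens : c₄.AdrianStevens
  bhk : c₄.BHK
  bfzCor : c₄.BFZcor
  chenSinger : c₄.ChenSinger

/-- Fourth tranche, unitary side: the statements that consume Mok's memoir FAIL (AMR-unitary, C17-Acta, D10, A12,
C164). [cite: Mok2012, downstream register of the cell, fourth tranche (row classes; bookkeeping)] -/
structure UnitaryConsumersFail₄ (c₄ : Consumers4) : Prop where
  amrUnitary : ¬ c₄.AMRunitary
  bmmBall : ¬ c₄.BMMball
  bergeronClozel17 : ¬ c₄.BergeronClozel17
  peng : ¬ c₄.Peng
  stoverBall : ¬ c₄.StoverBall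

/-- Fourth tranche, the ball-quotient line with its Mok inputs granted: AMR-unitary, BMM Acta, Stover HOLD. [cite: BergeronMillsonMoeglin2013, Thm 1 ff. (row classes; bookkeeping)] -/
structure BallLineHold (c₄ : Consumers4) : Prop where
  amrUnitary : c₄.AMRunitary
  bmmBall : c₄.BMMball
  stoverBall : c₄.StoverBall

/-- BOOK-LEAF SUPPORT, fourth tranche.  For each of the 24 book leaves: the model of `book_leaf_support` (book edge
system + every other book leaf; Mok's and KMSW's inputs and sequels in full; canonical reading) satisfies all five
implication bundles, every book-line statement of the tranche fails and the ball-quotient line holds — so "inherits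
B-Ar" is ALL 24 leaves also for Bergeron–Millson–Mœglin (IMRN), Bergeron–Clozel ×2, Peng, Lanard–Mínguez,
Adrian–Stevens, Barros–He–Kiefer, Barros–Flapan–Zuffetti Cor. 1.7 and J. G. Chen, as typed. [cite: Arthur2013, §1.5 with AGIKMS2024 l.380-382 (bookkeeping proved here)] -/
theorem book_leaf_support₄ (l : LeafSupport.Leaf) :
    ∃ (ν : Nodes) (ω : Waypoints) (γ : GlobalWaypoints) (μ : Mok2015.Nodes) (κ : KMSW2014.Nodes)
      (c : Consumers) (c₂ : Consumers2) (c₃ : Consumers3) (c₄ : Consumers4),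
      LeafSupport.Systems ν ω γ ∧ (∀ l', l' ≠ l → ν.leaf l') ∧ ¬ ν.leaf l ∧
      MokInputs μ ∧ KMSWInputs μ κ ∧ κ.UnwrittenSequels ∧
      Implications ν μ κ c ∧ Implications2 ν μ κ c c₂ ∧ Implications3 ν μ κ c c₃ ∧ Implications4 ν μ κ c c₂ c₃ c₄ ∧
      BookConsumersFail c c₂ c₃ ∧ BookConsumersFail₄ c₄ ∧ BallLineHold c₄ := by
  have cmod := LeafSupport.countermodel l
  have nb := not_B_cm l
  have KQ := kmswInputs_top μtop
  have I := canon_implications (LeafSupport.mkN (LeafSupport.cm l)) μtop κtop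
  have J := canon_implications₂ (LeafSupport.mkN (LeafSupport.cm l)) μtop κtop
  have L := canon_implications₃ (LeafSupport.mkN (LeafSupport.cm l)) μtop κtop
  have W := canon_implications₄ (LeafSupport.mkN (LeafSupport.cm l)) μtop κtop
  refine ⟨_, _, _, μtop, κtop, canon _ μtop κtop, canon₂ _ μtop κtop, canon₃ _ μtop κtop, canon₄ _ μtop κtop,
    cmod.1, cmod.2.1, cmod.2.2.1, mokInputs_top, KQ.1, KQ.2, I, J, L, W, ?_, ?_, ?_⟩
  · exact ⟨nb, nb, nb, nb, nb, nb, fun h => nb h.1, nb, nb, nb, nb, nb, nb, nb, nb, nb, fun h => nb h.1,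
      nb, nb, nb, nb, nb, fun h => nb h.1, nb, nb, nb, fun h => nb h.1, nb, fun h => nb h.1⟩
  · exact ⟨nb, nb, fun h => nb h.1, fun h => nb h.1, nb, nb, nb, nb, nb⟩
  · exact ⟨amrUnitary_of_leaves W mokInputs_top, bmmBall_of_inputs W mokInputs_top KQ.1,
      stoverBall_of_leaves W mokInputs_top KQ.1⟩

/-- MOK-LEAF SUPPORT, fourth tranche.  For each of the 29 Mok leaves: the model of `mok_leaf_support` (Mok's edges +
other leaves; book in full; KMSW's edges + every KMSW leaf but `MokMain`; canonical reading) satisfies all five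
implication bundles; AMR-unitary, BMM Acta, Bergeron–Clozel 2017, Peng and Stover FAIL; the seven book-only statements
of the tranche hold.  So the ball-quotient line inherits ALL 29 Mok leaves as typed. [cite: Mok2012, §5.3 l.4278 (bookkeeping proved here)] -/
theorem mok_leaf_support₄ (l : Mok2015.LeafSupport.Leaf) :
    ∃ (ν : Nodes) (μ : Mok2015.Nodes) (κ : KMSW2014.Nodes) (ωκ : KMSW2014.Waypoints)
      (c : Consumers) (c₂ : Consumers2) (c₃ : Consumers3) (c₄ : Consumers4),
      Mok2015.LeafSupport.Systems μ ∧ (∀ l', l' ≠ l → μ.leaf l') ∧ ¬ μ.leaf l ∧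
      BookInputs ν ∧ KMSW2014.LeafSupport.Systems κ ωκ ∧ (∀ l', l' ≠ KMSW2014.LeafSupport.Leaf.MokMain → κ.leaf l') ∧
      KMSWInputs μ κ ∧ κ.UnwrittenSequels ∧
      Implications ν μ κ c ∧ Implications2 ν μ κ c c₂ ∧ Implications3 ν μ κ c c₃ ∧ Implications4 ν μ κ c c₂ c₃ c₄ ∧
      UnitaryConsumersFail c c₂ c₃ ∧ UnitaryConsumersFail₄ c₄ ∧ BookOnlyHold₄ c₄ := by
  have cmod := Mok2015.LeafSupport.countermodel l
  have nm := not_M_cm l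
  have kf := κnoMok_facts
  have nk : ¬ ∀ N, κnoMok.Scope N := fun h => kf.2.2.2.2.2.1 0 (h 0)
  have nf : ¬ ∀ N, κnoMok.Full N := fun h => kf.2.2.2.2.2.2 0 (h 0)
  have KI : KMSWInputs (Mok2015.LeafSupport.mkN (Mok2015.LeafSupport.cm l)) κnoMok :=
    ⟨fun hM => absurd hM nm, kf.1.chapter, kf.1.supply, kf.2.2.1, kf.2.2.2.1⟩
  have A := bookInputs_top
  have I := canon_implications νtop (Mok2015.LeafSupport.mkN (Mok2015.LeafSupport.cm l)) κnoMok
  have J := canon_implications₂ νtop (Mok2015.LeafSupport.mkN (Mok2015.LeafSupport.cm l)) κnoMok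
  have L := canon_implications₃ νtop (Mok2015.LeafSupport.mkN (Mok2015.LeafSupport.cm l)) κnoMok
  have W := canon_implications₄ νtop (Mok2015.LeafSupport.mkN (Mok2015.LeafSupport.cm l)) κnoMok
  refine ⟨νtop, _, κnoMok, _, canon νtop _ κnoMok, canon₂ νtop _ κnoMok, canon₃ νtop _ κnoMok, canon₄ νtop _ κnoMok,
    cmod.1, cmod.2.1, cmod.2.2.1, A, kf.1, kf.2.1, KI, kf.2.2.2.2.1, I, J, L, W, ?_, ?_, ?_⟩
  · exact ⟨fun h => nm h.2, fun h => nm h.2, nk, nf, fun h => nm h.1, fun h => nm h.1, nk, fun h => nm h.1,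
      fun h => nm h.2, fun h => nm h.1, fun h => nm h.2, fun h => nm h.1, fun h => nm h.1, fun h => nm h.2.1, nk⟩
  · exact ⟨nm, fun h => nm h.1, fun h => nm h.2.1, fun h => nm h.2, fun h => nm h.1⟩
  · exact ⟨bmmOrth_of_leaves I W A, bergeronClozel13_of_leaves I W A, lanardMinguez_of_leaves W A,
      adrianStevens_of_leaves L W A, bhk_of_leaves I J W A, bfzCor_of_leaves I J W A, chenSinger_of_leaves I W A⟩

/-- The five KMSW leaves that are premises of the inner-form stabilisation edge `KMSW2014.Nodes.E_StabOrdI` (FL, split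
weighted FL, general weighted FL, Arthur's STF I–III, transfer), as a Boolean predicate on the carver's leaf type. [cite: Arthur2002, STF I–III (premise list of the KMSW module's stabilisation edge; bookkeeping)] -/
def _root_.Literature.NumberTheory.Automorphic.KMSW2014.LeafSupport.Leaf.stabOrdI : KMSW2014.LeafSupport.Leaf → Bool
  | .FL => true | .WFL_split => true | .WFL_general => true | .STF_Arthur => true | .Transfer => true
  | _ => false

/-- In the carver's least model over all KMSW leaves but `l`, the inner-form stabilisation node holds exactly when `l`
is not one of its five premises. [claim: KalethaMinguezShinWhite2014, under-review] (bookkeeping proved here) -/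
theorem stabOrdI_cm_iff (l : KMSW2014.LeafSupport.Leaf) :
    (KMSW2014.LeafSupport.mkN (KMSW2014.LeafSupport.cm l)).StabOrdI ↔ l.stabOrdI = false := by
  rw [show (KMSW2014.LeafSupport.mkN (KMSW2014.LeafSupport.cm l)).StabOrdI ↔
      LeafSupportKit.bit KMSW2014.LeafSupport.Atom.idx (KMSW2014.LeafSupport.cm l) .StabOrdI from
    KMSW2014.LeafSupport.prop_mk _ 0 .StabOrdI]
  cases l <;> decide

/-- KMSW-LEAF SUPPORT, fourth tranche, two-sided.  In the fourteen KMSW models (every KMSW edge bundle, all KMSW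
leaves but `l`, book and Mok in full, canonical reading) all five implication bundles hold, the book line of the
tranche holds, and the ball-quotient line (AMR-unitary granted by Mok; BMM Acta; Stover) together with Bergeron–Clozel
2017 holds EXACTLY when the removed leaf is not one of the five stabilisation premises — in particular it holds when
`MokMain`, `KMS_A`, `KMS_B`, `AubertSS`, `GL_inner`, `EPIT_published`, `TF_analytic`, `Glob_inputs` or `Ar_args` is
removed: these rows consume no theorem of KMSW, only the published stabilisation its module records. [claim: KalethaMinguezShinWhite2014, under-review] (bookkeeping proved here: exact KMSW-support of rows C17-Acta, C164, D10) -/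
theorem kmsw_ballLine_iff (l : KMSW2014.LeafSupport.Leaf) :
    ∃ (ν : Nodes) (μ : Mok2015.Nodes) (κ : KMSW2014.Nodes) (ωκ : KMSW2014.Waypoints)
      (c : Consumers) (c₂ : Consumers2) (c₃ : Consumers3) (c₄ : Consumers4),
      KMSW2014.LeafSupport.Systems κ ωκ ∧ (∀ l', l' ≠ l → κ.leaf l') ∧ ¬ κ.leaf l ∧ BookInputs ν ∧ MokInputs μ ∧
      Implications ν μ κ c ∧ Implications2 ν μ κ c c₂ ∧ Implications3 ν μ κ c c₃ ∧ Implications4 ν μ κ c c₂ c₃ c₄ ∧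
      BookOnlyHold₄ c₄ ∧ c₄.AMRunitary ∧
      ((c₄.BMMball ∧ c₄.StoverBall ∧ c₄.BergeronClozel17) ↔ l.stabOrdI = false) := by
  have cmod := KMSW2014.LeafSupport.countermodel l
  have A := bookInputs_top
  have Mi := mokInputs_top
  have m : ∀ N, μtop.Everything N := Mi.everything
  have b : ∀ N, νtop.Everything N := A.everything
  have I := canon_implications νtop μtop (KMSW2014.LeafSupport.mkN (KMSW2014.LeafSupport.cm l))
  have J := canon_implications₂ νtop μtop (KMSW2014.LeafSupport.mkN (KMSW2014.LeafSupport.cm l))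
  have L := canon_implications₃ νtop μtop (KMSW2014.LeafSupport.mkN (KMSW2014.LeafSupport.cm l))
  have W := canon_implications₄ νtop μtop (KMSW2014.LeafSupport.mkN (KMSW2014.LeafSupport.cm l))
  refine ⟨νtop, μtop, _, _, canon νtop μtop _, canon₂ νtop μtop _, canon₃ νtop μtop _, canon₄ νtop μtop _,
    cmod.1, cmod.2.1, cmod.2.2.1, A, Mi, I, J, L, W, ?_, m, ?_⟩
  · exact ⟨bmmOrth_of_leaves I W A, bergeronClozel13_of_leaves I W A, lanardMinguez_of_leaves W A,
      adrianStevens_of_leaves L W A, bhk_of_leaves I J W A, bfzCor_of_leaves I J W A, chenSinger_of_leaves I W A⟩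
  · rw [← stabOrdI_cm_iff]
    exact ⟨fun h => h.1.2, fun k => ⟨⟨m, k⟩, ⟨m, k⟩, ⟨b, m, k⟩⟩⟩

/-! ## 9. Fifth tranche (v1.2, after `Downstream2.lean` v1): exact supports of `Consumers5`

The canonical reading extended to the fifth tranche of the register (`Downstream2.lean`: Atobe–Mínguez, Atobe's
local A-packets, Gan–Ichino Mp₄, *Harder's Conj. I / II*, Kim–Wakatsuki–Yamauchi, Disegni–Liu, Beuzart-Plessis–
Chaudouard II, Atobe–Gan 2017 with its hypothesis node `LLCdes`) and the three families of countermodels run once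
more: all 24 book leaves are load-bearing for the six book-line statements (`book_leaf_support₅`), all 29 Mok leaves
for Disegni–Liu and Beuzart-Plessis–Chaudouard (`mok_leaf_support₅`), and their KMSW-support is exactly the
proved-scope support (`kmsw_scope_consumers_iff₅`: they hold in the KMSW model for leaf `l` iff `l` is one of
`AubertSS`, `KMS_A`, `KMS_B`).  New feature — the EXPLICIT-HYPOTHESIS form, two-sided: the node `LLCdes`
(Atobe–Gan's Desideratum 8.1) is read in TWO ways.  Canonically (:= exactly the premises of its supplier edge
`E_LLCdes`, the authors' attribution sentence: book ∧ Mok ∧ KMSW-scope) Atobe–Gan's theorems have the support of a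
joint consumer of all three DAGs and fail in every countermodel; GRANTED (:= `True`, the paper's own logical form:
"we assume the local Langlands correspondence") every fifth-tranche edge still holds — the supplier edge vacuously —
and the theorems hold in every node assignment whatsoever (`atobeGan_granted_holds`, `atobeGan_two_readings`).  The
kernel thus separates what row B7 states from what its attribution sentence makes it inherit. -/

section Canon5

variable (ν : Nodes) (μ : Mok2015.Nodes) (κ : KMSW2014.Nodes)

/-- The canonical reading of the fifth tranche: book-line statements := `∀ N, ν.Everything N`; Disegni–Liu and
Beuzart-Plessis–Chaudouard := Mok's `Everything` ∧ KMSW's `Scope`; the desideratum and Atobe–Gan's theorems :=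
exactly the premises of the supplier edge `E_LLCdes`. [cite: Arthur2013, downstream register of the cell, fifth tranche (canonical model; bookkeeping)] -/
abbrev canon₅ : Consumers5 where
  LLCdes := (∀ N, ν.Everything N) ∧ (∀ N, μ.Everything N) ∧ (∀ N, κ.Scope N)
  AtobeMinguez := ∀ N, ν.Everything N
  AtobeApackets := ∀ N, ν.Everything N
  GanIchinoMp4 := ∀ N, ν.Everything N
  HarderI := ∀ N, ν.Everything N
  HarderII := ∀ N, ν.Everything N
  KWY := ∀ N, ν.Everything N
  DisegniLiu := (∀ N, μ.Everything N) ∧ (∀ N, κ.Scope N)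
  BPCii := (∀ N, μ.Everything N) ∧ (∀ N, κ.Scope N)
  AtobeGanTheta := (∀ N, ν.Everything N) ∧ (∀ N, μ.Everything N) ∧ (∀ N, κ.Scope N)

/-- The HYPOTHESIS-GRANTED reading of the fifth tranche: as `canon₅` except that Atobe–Gan's desideratum — a
hypothesis of their theorems, "In this paper, we assume the local Langlands correspondence for classical groups"
(arXiv:1602.01299 p0027:L5) — is granted, and their theorems with it. [cite: AtobeGan2017, App. A p0027:L5-6 (hypothesis-granted model; bookkeeping)] -/
abbrev canon₅granted : Consumers5 where
  LLCdes := True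
  AtobeMinguez := ∀ N, ν.Everything N
  AtobeApackets := ∀ N, ν.Everything N
  GanIchinoMp4 := ∀ N, ν.Everything N
  HarderI := ∀ N, ν.Everything N
  HarderII := ∀ N, ν.Everything N
  KWY := ∀ N, ν.Everything N
  DisegniLiu := (∀ N, μ.Everything N) ∧ (∀ N, κ.Scope N)
  BPCii := (∀ N, μ.Everything N) ∧ (∀ N, κ.Scope N)
  AtobeGanTheta := True

/-- Every fifth-tranche edge holds in the canonical reading, for arbitrary ν, μ, κ. [cite: Arthur2013, downstream register of the cell, fifth tranche (bookkeeping proved here)] -/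
theorem canon_implications₅ :
    Implications5 ν μ κ (canon ν μ κ) (canon₂ ν μ κ) (canon₅ ν μ κ) where
  atobeMinguez := fun h => h
  atobeApackets := fun h _ _ => h
  ganIchinoMp4 := fun h _ _ => h
  harderI := fun h _ _ _ => h
  harderII := fun h _ _ => h
  kwy := fun h => h
  disegniLiu := fun m k _ => ⟨m, k⟩
  bpc := fun m k => ⟨m, k⟩
  llcdes := fun h m k => ⟨h, m, k⟩
  atobeGan := fun h => h

/-- Every fifth-tranche edge ALSO holds in the hypothesis-granted reading, for arbitrary ν, μ, κ — the supplier
edge `E_LLCdes` vacuously, the edge `E_AtobeGanTheta` because its only premise is the desideratum. [cite: AtobeGan2017, App. A (bookkeeping proved here)] -/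
theorem canon_implications₅granted :
    Implications5 ν μ κ (canon ν μ κ) (canon₂ ν μ κ) (canon₅granted ν μ κ) where
  atobeMinguez := fun h => h
  atobeApackets := fun h _ _ => h
  ganIchinoMp4 := fun h _ _ => h
  harderI := fun h _ _ _ => h
  harderII := fun h _ _ => h
  kwy := fun h => h
  disegniLiu := fun m k _ => ⟨m, k⟩
  bpc := fun m k => ⟨m, k⟩
  llcdes := fun _ _ _ => trivial
  atobeGan := fun _ => trivial

end Canon5

/-- Fifth tranche, book line and joint statements: everything whose canonical reading contains the book FAILS (rows
B42, B5, C2, C7 ×2, C8, and — through the supplier edge — B7's desideratum and theorems). [cite: Arthur2013, downstream register of the cell, fifth tranche (row classes; bookkeeping)] -/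
structure BookConsumersFail₅ (c₅ : Consumers5) : Prop where
  atobeMinguez : ¬ c₅.AtobeMinguez
  atobeApackets : ¬ c₅.AtobeApackets
  ganIchinoMp4 : ¬ c₅.GanIchinoMp4
  harderI : ¬ c₅.HarderI
  harderII : ¬ c₅.HarderII
  kwy : ¬ c₅.KWY
  llcdes : ¬ c₅.LLCdes
  atobeGanTheta : ¬ c₅.AtobeGanTheta

/-- Fifth tranche, the six statements with NO Mok/KMSW premise HOLD (rows B42, B5, C2, C7 ×2, C8). [cite: Arthur2013, downstream register of the cell, fifth tranche (row classes; bookkeeping)] -/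
structure BookOnlyHold₅ (c₅ : Consumers5) : Prop where
  atobeMinguez : c₅.AtobeMinguez
  atobeApackets : c₅.AtobeApackets
  ganIchinoMp4 : c₅.GanIchinoMp4
  harderI : c₅.HarderI
  harderII : c₅.HarderII
  kwy : c₅.KWY

/-- Fifth tranche, unitary side: the statements whose canonical reading contains Mok's memoir FAIL (rows C20, C27, and B7's desideratum and theorems). [cite: Mok2012, downstream register of the cell, fifth tranche (row classes; bookkeeping)] -/
structure UnitaryConsumersFail₅ (c₅ : Consumers5) : Prop where
  disegniLiu : ¬ c₅.DisegniLiu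
  bpcIi : ¬ c₅.BPCii
  llcdes : ¬ c₅.LLCdes
  atobeGanTheta : ¬ c₅.AtobeGanTheta

/-- Fifth tranche, the consumers of KMSW's PROVED scope (rows C20, C27, B7 with its desideratum), as one conjunction. [claim: KalethaMinguezShinWhite2014, under-review] (row classes; bookkeeping) -/
structure ScopeConsumers₅ (c₅ : Consumers5) : Prop where
  disegniLiu : c₅.DisegniLiu
  bpcIi : c₅.BPCii
  llcdes : c₅.LLCdes
  atobeGanTheta : c₅.AtobeGanTheta

/-- BOOK-LEAF SUPPORT, fifth tranche.  For each of the 24 book leaves: the model of `book_leaf_support` (book edge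
system + every other book leaf; Mok's and KMSW's inputs and sequels in full; canonical reading) satisfies all six
implication bundles (`Implications`, `Implications2`, `Implications3`, `Implications4`, `Implications5` and Shin's),
every book-line and joint statement of the fifth tranche fails while Disegni–Liu and Beuzart-Plessis–Chaudouard hold
— so "inherits B-Ar" is ALL 24 leaves also for Atobe–Mínguez, Atobe's local A-packets, Gan–Ichino Mp₄, both Harder
papers, Kim–Wakatsuki–Yamauchi and (through the supplier edge) Atobe–Gan, as typed. [cite: Arthur2013, §1.5 with AGIKMS2024 l.380-382 (bookkeeping proved here)] -/
theorem book_leaf_support₅ (l : LeafSupport.Leaf) :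
    ∃ (ν : Nodes) (ω : Waypoints) (γ : GlobalWaypoints) (μ : Mok2015.Nodes) (κ : KMSW2014.Nodes)
      (c : Consumers) (c₂ : Consumers2) (c₃ : Consumers3) (c₄ : Consumers4) (c₅ : Consumers5) (s : Shin),
      LeafSupport.Systems ν ω γ ∧ (∀ l', l' ≠ l → ν.leaf l') ∧ ¬ ν.leaf l ∧
      MokInputs μ ∧ KMSWInputs μ κ ∧ κ.UnwrittenSequels ∧
      Implications ν μ κ c ∧ Implications2 ν μ κ c c₂ ∧ Implications3 ν μ κ c c₃ ∧ Implications4 ν μ κ c c₂ c₃ c₄ ∧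
      Implications5 ν μ κ c c₂ c₅ ∧ Shin.Implications ν μ κ c s ∧
      BookConsumersFail c c₂ c₃ ∧ BookConsumersFail₄ c₄ ∧ BookConsumersFail₅ c₅ ∧ c₅.DisegniLiu ∧ c₅.BPCii := by
  have cmod := LeafSupport.countermodel l
  have nb := not_B_cm l
  have KQ := kmswInputs_top μtop
  have I := canon_implications (LeafSupport.mkN (LeafSupport.cm l)) μtop κtop
  have J := canon_implications₂ (LeafSupport.mkN (LeafSupport.cm l)) μtop κtop
  have L := canon_implications₃ (LeafSupport.mkN (LeafSupport.cm l)) μtop κtop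
  have W := canon_implications₄ (LeafSupport.mkN (LeafSupport.cm l)) μtop κtop
  have V := canon_implications₅ (LeafSupport.mkN (LeafSupport.cm l)) μtop κtop
  refine ⟨_, _, _, μtop, κtop, canon _ μtop κtop, canon₂ _ μtop κtop, canon₃ _ μtop κtop, canon₄ _ μtop κtop,
    canon₅ _ μtop κtop, canonShin _ μtop κtop,
    cmod.1, cmod.2.1, cmod.2.2.1, mokInputs_top, KQ.1, KQ.2, I, J, L, W, V, canon_shin _ _ _, ?_, ?_, ?_,
    disegniLiu_of_leaves J V mokInputs_top KQ.1, bpcIi_of_leaves V mokInputs_top KQ.1⟩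
  · exact ⟨nb, nb, nb, nb, nb, nb, fun h => nb h.1, nb, nb, nb, nb, nb, nb, nb, nb, nb, fun h => nb h.1,
      nb, nb, nb, nb, nb, fun h => nb h.1, nb, nb, nb, fun h => nb h.1, nb, fun h => nb h.1⟩
  · exact ⟨nb, nb, fun h => nb h.1, fun h => nb h.1, nb, nb, nb, nb, nb⟩
  · exact ⟨nb, nb, nb, nb, nb, nb, fun h => nb h.1, fun h => nb h.1⟩

/-- MOK-LEAF SUPPORT, fifth tranche.  For each of the 29 Mok leaves: the model of `mok_leaf_support` (Mok's edges +
other leaves; book in full; KMSW's edges + every KMSW leaf but `MokMain`; canonical reading) satisfies all six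
implication bundles; Disegni–Liu, Beuzart-Plessis–Chaudouard and (through the supplier edge) Atobe–Gan FAIL; the six
book-only statements of the tranche hold.  So rows C20 and C27 inherit ALL 29 Mok leaves as typed — Disegni–Liu also
through Li–Liu (row C19) and through KMSW's import of Mok. [cite: Mok2012, §5.3 l.4278 (bookkeeping proved here)] -/
theorem mok_leaf_support₅ (l : Mok2015.LeafSupport.Leaf) :
    ∃ (ν : Nodes) (μ : Mok2015.Nodes) (κ : KMSW2014.Nodes) (ωκ : KMSW2014.Waypoints)
      (c : Consumers) (c₂ : Consumers2) (c₃ : Consumers3) (c₄ : Consumers4) (c₅ : Consumers5) (s : Shin),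
      Mok2015.LeafSupport.Systems μ ∧ (∀ l', l' ≠ l → μ.leaf l') ∧ ¬ μ.leaf l ∧
      BookInputs ν ∧ KMSW2014.LeafSupport.Systems κ ωκ ∧ (∀ l', l' ≠ KMSW2014.LeafSupport.Leaf.MokMain → κ.leaf l') ∧
      KMSWInputs μ κ ∧ κ.UnwrittenSequels ∧
      Implications ν μ κ c ∧ Implications2 ν μ κ c c₂ ∧ Implications3 ν μ κ c c₃ ∧ Implications4 ν μ κ c c₂ c₃ c₄ ∧
      Implications5 ν μ κ c c₂ c₅ ∧ Shin.Implications ν μ κ c s ∧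
      UnitaryConsumersFail c c₂ c₃ ∧ UnitaryConsumersFail₄ c₄ ∧ UnitaryConsumersFail₅ c₅ ∧ BookOnlyHold₅ c₅ := by
  have cmod := Mok2015.LeafSupport.countermodel l
  have nm := not_M_cm l
  have kf := κnoMok_facts
  have nk : ¬ ∀ N, κnoMok.Scope N := fun h => kf.2.2.2.2.2.1 0 (h 0)
  have nf : ¬ ∀ N, κnoMok.Full N := fun h => kf.2.2.2.2.2.2 0 (h 0)
  have KI : KMSWInputs (Mok2015.LeafSupport.mkN (Mok2015.LeafSupport.cm l)) κnoMok :=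
    ⟨fun hM => absurd hM nm, kf.1.chapter, kf.1.supply, kf.2.2.1, kf.2.2.2.1⟩
  have A := bookInputs_top
  have I := canon_implications νtop (Mok2015.LeafSupport.mkN (Mok2015.LeafSupport.cm l)) κnoMok
  have J := canon_implications₂ νtop (Mok2015.LeafSupport.mkN (Mok2015.LeafSupport.cm l)) κnoMok
  have L := canon_implications₃ νtop (Mok2015.LeafSupport.mkN (Mok2015.LeafSupport.cm l)) κnoMok
  have W := canon_implications₄ νtop (Mok2015.LeafSupport.mkN (Mok2015.LeafSupport.cm l)) κnoMok
  have V := canon_implications₅ νtop (Mok2015.LeafSupport.mkN (Mok2015.LeafSupport.cm l)) κnoMok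
  refine ⟨νtop, _, κnoMok, _, canon νtop _ κnoMok, canon₂ νtop _ κnoMok, canon₃ νtop _ κnoMok, canon₄ νtop _ κnoMok,
    canon₅ νtop _ κnoMok, canonShin νtop _ κnoMok,
    cmod.1, cmod.2.1, cmod.2.2.1, A, kf.1, kf.2.1, KI, kf.2.2.2.2.1, I, J, L, W, V, canon_shin _ _ _, ?_, ?_, ?_, ?_⟩
  · exact ⟨fun h => nm h.2, fun h => nm h.2, nk, nf, fun h => nm h.1, fun h => nm h.1, nk, fun h => nm h.1,
      fun h => nm h.2, fun h => nm h.1, fun h => nm h.2, fun h => nm h.1, fun h => nm h.1, fun h => nm h.2.1, nk⟩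
  · exact ⟨nm, fun h => nm h.1, fun h => nm h.2.1, fun h => nm h.2, fun h => nm h.1⟩
  · exact ⟨fun h => nm h.1, fun h => nm h.1, fun h => nm h.2.1, fun h => nm h.2.1⟩
  · exact ⟨atobeMinguez_of_leaves V A, atobeApackets_of_leaves J V A, ganIchinoMp4_of_leaves I V A,
      harderI_of_leaves I V A, harderII_of_leaves I V A, kwy_of_leaves V A⟩

/-- KMSW-LEAF SUPPORT, fifth tranche, two-sided.  In the KMSW models of `kmsw_leaf_support` (every KMSW edge bundle,
all KMSW leaves but `l`, book and Mok in full, canonical reading — in which all six implication bundles hold, the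
fifth by `canon_implications₅`), Disegni–Liu, Beuzart-Plessis–Chaudouard and Atobe–Gan with its desideratum HOLD
exactly when the removed leaf is `AubertSS`, `KMS_A` or `KMS_B`, and fail for the ten leaves of the proved scope:
these rows consume KMSW's PROVED scope and no sequel — the fifth-tranche form of `kmsw_scope_consumers_iff`. [claim: KalethaMinguezShinWhite2014, under-review] (bookkeeping proved here: exact KMSW-support of rows C20, C27, B7) -/
theorem kmsw_scope_consumers_iff₅ (l : KMSW2014.LeafSupport.Leaf) :
    ScopeConsumers₅ (canon₅ νtop μtop (KMSW2014.LeafSupport.mkN (KMSW2014.LeafSupport.cm l))) ↔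
      l.onlyFull = true := by
  constructor
  · intro hs
    cases hb : l.onlyFull
    · exact absurd hs.disegniLiu.2 fun hk =>
        KMSW2014.LeafSupport.not_scope_of (KMSW2014.LeafSupport.scope_fails l hb 0) (hk 0)
    · rfl
  · intro h
    have k := scope_of_onlyFull l h
    have m : ∀ N, μtop.Everything N := mokInputs_top.everything
    have b : ∀ N, νtop.Everything N := bookInputs_top.everything
    exact ⟨⟨m, k⟩, ⟨m, k⟩, ⟨b, m, k⟩, ⟨b, m, k⟩⟩

/-- THE EXPLICIT-HYPOTHESIS FORM, first half: in the hypothesis-granted reading, for EVERY node assignment — in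
particular in every countermodel of the three leaf-support modules — all fifth-tranche edges hold and Atobe–Gan's
theorems hold: as the paper states them (under Desideratum 8.1), they consume no leaf of any DAG. [cite: AtobeGan2017, Thms 4.1, 4.3, 4.5 under App. A (bookkeeping proved here)] -/
theorem atobeGan_granted_holds (ν : Nodes) (μ : Mok2015.Nodes) (κ : KMSW2014.Nodes) :
    Implications5 ν μ κ (canon ν μ κ) (canon₂ ν μ κ) (canon₅granted ν μ κ) ∧
      (canon₅granted ν μ κ).LLCdes ∧ (canon₅granted ν μ κ).AtobeGanTheta :=
  ⟨canon_implications₅granted ν μ κ, trivial, trivial⟩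

/-- THE EXPLICIT-HYPOTHESIS FORM, two-sided, on the 24 book models: for each book leaf `l`, in the carver's least
model over all book leaves but `l` (Mok and KMSW in full), the fifth-tranche edges hold under BOTH readings; under the
canonical reading (desideratum := what the authors' attribution sentence supplies) Atobe–Gan's theorems FAIL — the
leaf is load-bearing through "it is known by Arthur [Ar], Mok [Mo], and Kaletha--Mínguez--Shin--White [KMSW]"
(p0027:L9-10) — and under the hypothesis-granted reading they HOLD.  Row B7's stated theorem and its inherited
support are thereby separated in the kernel; the same holds leaf by leaf on the Mok side (`mok_leaf_support₅` with
`atobeGan_granted_holds`) and on KMSW's proved scope (`kmsw_scope_consumers_iff₅`). [cite: AtobeGan2017, App. A p0027:L5-16 (bookkeeping proved here: two readings of row B7)] -/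
theorem atobeGan_two_readings (l : LeafSupport.Leaf) :
    (Implications5 (LeafSupport.mkN (LeafSupport.cm l)) μtop κtop
        (canon (LeafSupport.mkN (LeafSupport.cm l)) μtop κtop) (canon₂ (LeafSupport.mkN (LeafSupport.cm l)) μtop κtop)
        (canon₅ (LeafSupport.mkN (LeafSupport.cm l)) μtop κtop) ∧
      ¬ (canon₅ (LeafSupport.mkN (LeafSupport.cm l)) μtop κtop).AtobeGanTheta) ∧
    (Implications5 (LeafSupport.mkN (LeafSupport.cm l)) μtop κtop
        (canon (LeafSupport.mkN (LeafSupport.cm l)) μtop κtop) (canon₂ (LeafSupport.mkN (LeafSupport.cm l)) μtop κtop)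
        (canon₅granted (LeafSupport.mkN (LeafSupport.cm l)) μtop κtop) ∧
      (canon₅granted (LeafSupport.mkN (LeafSupport.cm l)) μtop κtop).AtobeGanTheta) :=
  ⟨⟨canon_implications₅ _ _ _, fun h => not_B_cm l h.1⟩, ⟨canon_implications₅granted _ _ _, trivial⟩⟩

/-! ## 10. Sixth tranche (v1.3, after `Downstream2.lean` v2): exact supports of `Consumers6`

The canonical reading extended to the sixth tranche (Oi's comparison theorem, Graham's p-adic L-function through
Chen–Zou, Atobe–Gan's even-orthogonal theorems with their hypothesis node and their printed "unconditionally" clauses,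
Beuzart-Plessis 2015 with its admitted hypotheses).  Hypothesis nodes WITHOUT a supplier edge (`AGevenHyp`, `BPhyp`)
are GRANTED in the canonical reading — as `IshimotoSequel`, `Rogawski`, Shin's (H2)/(H3) were — so that a failure is
never blamed on them; consequently the two theorems-as-stated (`AtobeGanEven`, `BPggp15`) hold in EVERY node
assignment (`hypothesisRows_hold_everywhere`), while Oi's comparison and Atobe–Gan's quasi-split clauses fail in each
of the 24 book countermodels and Graham's theorems fail in each of the 24 book AND each of the 29 Mok countermodels
(`book_leaf_support₆`, `mok_leaf_support₆`); none of the four rows consumes a KMSW node (`sixth_tranche_holds_in_kmsw_models`).  `canon₆` depends on ν and μ only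
(no sixth-tranche statement reads a KMSW node), so it is applied as `canon₆ ν μ`. -/

section Canon6

variable (ν : Nodes) (μ : Mok2015.Nodes) (κ : KMSW2014.Nodes)

/-- The canonical reading of the sixth tranche: Oi's comparison and Atobe–Gan's quasi-split clauses := `∀ N,
ν.Everything N`; Graham := book ∧ Mok (exactly what `E_Graham` receives from `canon.ChenZou`); the two hypothesis
nodes without supplier edge and the two theorems-as-stated GRANTED. [cite: Arthur2013, downstream register of the cell, sixth tranche (canonical model; bookkeeping)] -/
abbrev canon₆ : Consumers6 where
  OiToral := ∀ N, ν.Everything N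
  Graham := (∀ N, ν.Everything N) ∧ (∀ N, μ.Everything N)
  AGevenHyp := True
  AtobeGanEven := True
  AtobeGanEvenQS := ∀ N, ν.Everything N
  BPhyp := True
  BPggp15 := True

/-- Every sixth-tranche edge holds in the canonical reading, for arbitrary ν, μ, κ. [cite: Arthur2013, downstream register of the cell, sixth tranche (bookkeeping proved here)] -/
theorem canon_implications₆ : Implications6 ν (canon ν μ κ) (canon₆ ν μ) where
  oi := fun h => h
  graham := fun cz => cz
  agEven := fun _ => trivial
  agEvenQS := fun h => h
  bp15 := fun _ => trivial

end Canon6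

/-- Sixth tranche: the statements whose canonical reading contains the book FAIL (rows B67, C165, B3's quasi-split clauses). [cite: Arthur2013, downstream register of the cell, sixth tranche (row classes; bookkeeping)] -/
structure BookConsumersFail₆ (c₆ : Consumers6) : Prop where
  oiToral : ¬ c₆.OiToral
  graham : ¬ c₆.Graham
  atobeGanEvenQS : ¬ c₆.AtobeGanEvenQS

/-- Sixth tranche: the two hypothesis nodes and the two theorems-as-stated (rows B3, C15) HOLD. [cite: AtobeGan2017RT, Thms 4.6/4.9/5.7 as stated; Beuzartplessis2015 théorème 1 (row classes; bookkeeping)] -/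
structure HypothesisRowsHold₆ (c₆ : Consumers6) : Prop where
  agEvenHyp : c₆.AGevenHyp
  atobeGanEven : c₆.AtobeGanEven
  bpHyp : c₆.BPhyp
  bpggp15 : c₆.BPggp15

/-- Sixth tranche: the two statements with NO Mok/KMSW premise (B67, B3 quasi-split clauses) HOLD. [cite: Arthur2013, downstream register of the cell, sixth tranche (row classes; bookkeeping)] -/
structure BookOnlyHold₆ (c₆ : Consumers6) : Prop where
  oiToral : c₆.OiToral
  atobeGanEvenQS : c₆.AtobeGanEvenQS

/-- THE EXPLICIT-HYPOTHESIS ROWS of the sixth tranche hold in EVERY node assignment (in particular in every countermodel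
of the three leaf-support modules), together with all sixth-tranche edges: as stated, Atobe–Gan's Theorems 4.6/4.9/5.7
and Beuzart-Plessis's théorème 1 consume no leaf of any DAG. [cite: AtobeGan2017RT, p0003:L53-55; Beuzartplessis2015 p0031:L41 (bookkeeping proved here)] -/
theorem hypothesisRows_hold_everywhere (ν : Nodes) (μ : Mok2015.Nodes) (κ : KMSW2014.Nodes) :
    Implications6 ν (canon ν μ κ) (canon₆ ν μ) ∧ HypothesisRowsHold₆ (canon₆ ν μ) :=
  ⟨canon_implications₆ ν μ κ, trivial, trivial, trivial, trivial⟩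

/-- BOOK-LEAF SUPPORT, sixth tranche.  For each of the 24 book leaves: the model of `book_leaf_support` (book edge system
+ every other book leaf; Mok's and KMSW's inputs and sequels in full; canonical reading) satisfies all seven implication
bundles; Oi's comparison theorem, Graham's theorems and Atobe–Gan's quasi-split clauses FAIL, the hypothesis rows hold
— so "inherits B-Ar" is ALL 24 leaves for rows B67, C165 (through Chen–Zou) and B3's "unconditionally" clauses, as
typed. [cite: Arthur2013, §1.5 with AGIKMS2024 l.380-382 (bookkeeping proved here)] -/
theorem book_leaf_support₆ (l : LeafSupport.Leaf) :
    ∃ (ν : Nodes) (ω : Waypoints) (γ : GlobalWaypoints) (μ : Mok2015.Nodes) (κ : KMSW2014.Nodes)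
      (c : Consumers) (c₂ : Consumers2) (c₃ : Consumers3) (c₄ : Consumers4) (c₅ : Consumers5) (c₆ : Consumers6)
      (s : Shin),
      LeafSupport.Systems ν ω γ ∧ (∀ l', l' ≠ l → ν.leaf l') ∧ ¬ ν.leaf l ∧
      MokInputs μ ∧ KMSWInputs μ κ ∧ κ.UnwrittenSequels ∧
      Implications ν μ κ c ∧ Implications2 ν μ κ c c₂ ∧ Implications3 ν μ κ c c₃ ∧ Implications4 ν μ κ c c₂ c₃ c₄ ∧
      Implications5 ν μ κ c c₂ c₅ ∧ Implications6 ν c c₆ ∧ Shin.Implications ν μ κ c s ∧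
      BookConsumersFail c c₂ c₃ ∧ BookConsumersFail₅ c₅ ∧ BookConsumersFail₆ c₆ ∧ HypothesisRowsHold₆ c₆ := by
  have cmod := LeafSupport.countermodel l
  have nb := not_B_cm l
  have KQ := kmswInputs_top μtop
  have I := canon_implications (LeafSupport.mkN (LeafSupport.cm l)) μtop κtop
  have J := canon_implications₂ (LeafSupport.mkN (LeafSupport.cm l)) μtop κtop
  have L := canon_implications₃ (LeafSupport.mkN (LeafSupport.cm l)) μtop κtop
  have W := canon_implications₄ (LeafSupport.mkN (LeafSupport.cm l)) μtop κtop
  have V := canon_implications₅ (LeafSupport.mkN (LeafSupport.cm l)) μtop κtop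
  have Y := canon_implications₆ (LeafSupport.mkN (LeafSupport.cm l)) μtop κtop
  refine ⟨_, _, _, μtop, κtop, canon _ μtop κtop, canon₂ _ μtop κtop, canon₃ _ μtop κtop, canon₄ _ μtop κtop,
    canon₅ _ μtop κtop, canon₆ (LeafSupport.mkN (LeafSupport.cm l)) μtop, canonShin _ μtop κtop,
    cmod.1, cmod.2.1, cmod.2.2.1, mokInputs_top, KQ.1, KQ.2, I, J, L, W, V, Y, canon_shin _ _ _, ?_, ?_, ?_,
    trivial, trivial, trivial, trivial⟩
  · exact ⟨nb, nb, nb, nb, nb, nb, fun h => nb h.1, nb, nb, nb, nb, nb, nb, nb, nb, nb, fun h => nb h.1,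
      nb, nb, nb, nb, nb, fun h => nb h.1, nb, nb, nb, fun h => nb h.1, nb, fun h => nb h.1⟩
  · exact ⟨nb, nb, nb, nb, nb, nb, fun h => nb h.1, fun h => nb h.1⟩
  · exact ⟨nb, fun h => nb h.1, nb⟩

/-- MOK-LEAF SUPPORT, sixth tranche.  For each of the 29 Mok leaves: the model of `mok_leaf_support` (Mok's edges + other
leaves; book in full; KMSW's edges + every KMSW leaf but `MokMain`; canonical reading) satisfies all seven implication
bundles; Graham's theorems FAIL (through Chen–Zou's use of Mok's memoir), while Oi's comparison, Atobe–Gan's quasi-split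
clauses and the hypothesis rows hold.  So row C165 inherits ALL 29 Mok leaves as typed. [cite: Mok2012, §5.3 l.4278 (bookkeeping proved here)] -/
theorem mok_leaf_support₆ (l : Mok2015.LeafSupport.Leaf) :
    ∃ (ν : Nodes) (μ : Mok2015.Nodes) (κ : KMSW2014.Nodes) (ωκ : KMSW2014.Waypoints)
      (c : Consumers) (c₂ : Consumers2) (c₃ : Consumers3) (c₄ : Consumers4) (c₅ : Consumers5) (c₆ : Consumers6)
      (s : Shin),
      Mok2015.LeafSupport.Systems μ ∧ (∀ l', l' ≠ l → μ.leaf l') ∧ ¬ μ.leaf l ∧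
      BookInputs ν ∧ KMSW2014.LeafSupport.Systems κ ωκ ∧ (∀ l', l' ≠ KMSW2014.LeafSupport.Leaf.MokMain → κ.leaf l') ∧
      KMSWInputs μ κ ∧ κ.UnwrittenSequels ∧
      Implications ν μ κ c ∧ Implications2 ν μ κ c c₂ ∧ Implications3 ν μ κ c c₃ ∧ Implications4 ν μ κ c c₂ c₃ c₄ ∧
      Implications5 ν μ κ c c₂ c₅ ∧ Implications6 ν c c₆ ∧ Shin.Implications ν μ κ c s ∧
      UnitaryConsumersFail c c₂ c₃ ∧ UnitaryConsumersFail₅ c₅ ∧ ¬ c₆.Graham ∧ BookOnlyHold₆ c₆ ∧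
      HypothesisRowsHold₆ c₆ := by
  have cmod := Mok2015.LeafSupport.countermodel l
  have nm := not_M_cm l
  have kf := κnoMok_facts
  have nk : ¬ ∀ N, κnoMok.Scope N := fun h => kf.2.2.2.2.2.1 0 (h 0)
  have nf : ¬ ∀ N, κnoMok.Full N := fun h => kf.2.2.2.2.2.2 0 (h 0)
  have KI : KMSWInputs (Mok2015.LeafSupport.mkN (Mok2015.LeafSupport.cm l)) κnoMok :=
    ⟨fun hM => absurd hM nm, kf.1.chapter, kf.1.supply, kf.2.2.1, kf.2.2.2.1⟩
  have A := bookInputs_top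
  have I := canon_implications νtop (Mok2015.LeafSupport.mkN (Mok2015.LeafSupport.cm l)) κnoMok
  have J := canon_implications₂ νtop (Mok2015.LeafSupport.mkN (Mok2015.LeafSupport.cm l)) κnoMok
  have L := canon_implications₃ νtop (Mok2015.LeafSupport.mkN (Mok2015.LeafSupport.cm l)) κnoMok
  have W := canon_implications₄ νtop (Mok2015.LeafSupport.mkN (Mok2015.LeafSupport.cm l)) κnoMok
  have V := canon_implications₅ νtop (Mok2015.LeafSupport.mkN (Mok2015.LeafSupport.cm l)) κnoMok
  have Y := canon_implications₆ νtop (Mok2015.LeafSupport.mkN (Mok2015.LeafSupport.cm l)) κnoMok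
  refine ⟨νtop, _, κnoMok, _, canon νtop _ κnoMok, canon₂ νtop _ κnoMok, canon₃ νtop _ κnoMok, canon₄ νtop _ κnoMok,
    canon₅ νtop _ κnoMok, canon₆ νtop (Mok2015.LeafSupport.mkN (Mok2015.LeafSupport.cm l)), canonShin νtop _ κnoMok,
    cmod.1, cmod.2.1, cmod.2.2.1, A, kf.1, kf.2.1, KI, kf.2.2.2.2.1, I, J, L, W, V, Y, canon_shin _ _ _, ?_, ?_,
    fun h => nm h.2, ?_, trivial, trivial, trivial, trivial⟩
  · exact ⟨fun h => nm h.2, fun h => nm h.2, nk, nf, fun h => nm h.1, fun h => nm h.1, nk, fun h => nm h.1,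
      fun h => nm h.2, fun h => nm h.1, fun h => nm h.2, fun h => nm h.1, fun h => nm h.1, fun h => nm h.2.1, nk⟩
  · exact ⟨fun h => nm h.1, fun h => nm h.1, fun h => nm h.2.1, fun h => nm h.2.1⟩
  · exact ⟨oiToral_of_leaves Y A, atobeGanEvenQS_of_leaves Y A⟩

/-- Sixth tranche, KMSW side: in every one of the fourteen KMSW models of `kmsw_leaf_support` (all KMSW leaves but `l`,
book and Mok in full, canonical reading) ALL sixth-tranche statements hold — none of them consumes a KMSW node
(Graham's multiplicity-one sentence goes through Chen–Zou, whose inputs are the book and Mok's memoir). [claim: KalethaMinguezShinWhite2014, under-review] (bookkeeping proved here: rows B67, C165, B3, C15 have empty KMSW-support) -/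
theorem sixth_tranche_holds_in_kmsw_models (l : KMSW2014.LeafSupport.Leaf) :
    Implications6 νtop (canon νtop μtop (KMSW2014.LeafSupport.mkN (KMSW2014.LeafSupport.cm l)))
        (canon₆ νtop μtop) ∧
      (canon₆ νtop μtop).OiToral ∧
      (canon₆ νtop μtop).Graham ∧
      (canon₆ νtop μtop).AtobeGanEvenQS ∧
      HypothesisRowsHold₆ (canon₆ νtop μtop) :=
  have b : ∀ N, νtop.Everything N := bookInputs_top.everything
  have m : ∀ N, μtop.Everything N := mokInputs_top.everything
  ⟨canon_implications₆ _ _ _, b, ⟨b, m⟩, b, trivial, trivial, trivial, trivial⟩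

/-! ## 11. Seventh tranche (v1.4, after `Downstream2.lean` v3): exact supports of `Consumers7`

The canonical reading extended to the seventh tranche: Katsurada–Lee (row C166) := `∀ N, ν.Everything N`; the Chapter-9
hypothesis node `Prop952` := exactly what its supplier edge `E_Prop952` receives from `canonShin.WeakS` and
`canon.StabInner`.  Consequences certified here: (i) the two LITERAL-CITATION edges `E_BLMMlit`, `E_BMMorthLit` hold in the
canonical reading over arbitrary node assignments (`canon_implications₇`), so every countermodel of the earlier sections
survives the new edges — in particular BLMM (C99) and BMM-orth (C17) still fail in each of the 24 book countermodels
WITH the Chapter-9 route present (`book_leaf_support₇`); (ii) the support of the Chapter-9 node itself is, two-sided,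
the NINE leaves of Shin's weak transfer (`prop952_support : Prop952 ↔ l.shinS = false` in the 24 book models, by
`shin_weakS_support`) — no leaf of the book's own derivations, none of the 2024–2026 preprint supplies; (iii)
Katsurada–Lee fails in each of the 24 book countermodels (all 24 leaves load-bearing, through Harder I / Taïbi /
Chenevier–Taïbi).  `canon₇` depends on ν only. -/

section Canon7

variable (ν : Nodes) (μ : Mok2015.Nodes) (κ : KMSW2014.Nodes)

/-- The canonical reading of the seventh tranche: Katsurada–Lee := `∀ N, ν.Everything N`; `Prop952` := the canonical
`WeakS` (the conjunction received by `Shin.E_WeakS`) ∧ the canonical `StabInner`. [cite: Arthur2013, downstream register of the cell, seventh tranche (canonical model; bookkeeping)] -/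
abbrev canon₇ : Consumers7 where
  KatsuradaLee := ∀ N, ν.Everything N
  Prop952 := (ν.StabTw ∧ ν.StabOrd ∧ (ν.FL ∧ ν.WFL_split ∧ ν.WFL_general ∧ ν.STF_Arthur) ∧ ν.SpecGLN) ∧
    (ν.FL ∧ ν.WFL_split ∧ ν.WFL_general ∧ ν.STF_Arthur)

/-- Every seventh-tranche edge — the two literal-citation edges into `Consumers2.BLMM` / `Consumers4.BMMorth` included —
holds in the canonical reading, for arbitrary ν, μ, κ. [cite: Arthur2013, downstream register of the cell, seventh tranche (bookkeeping proved here)] -/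
theorem canon_implications₇ :
    Implications7 ν (canon ν μ κ) (canon₂ ν μ κ) (canon₅ ν μ κ) (canon₄ ν μ κ) (canonShin ν μ κ) (canon₇ ν) where
  katsuradaLee := fun h _ _ _ => h
  prop952 := fun w st => ⟨w, st⟩
  blmmLit := fun h _ => h
  bmmOrthLit := fun h _ _ => h

end Canon7

/-- SUPPORT OF THE CHAPTER-9 NODE, two-sided, in the 24 book models of `book_leaf_support` (canonical reading): `Prop952`
FAILS exactly when the removed leaf is one of the nine leaves of Shin's weak transfer (FL, WFL_split, W4_Thm38,
STF_Arthur, TwistedTF, MW_Stab, SpecGLN, WFL_general, WFL_nonstandard) and HOLDS for the other fifteen — LLC for GL_N,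
transfer, [MW I 4.11], the local / invariant trace formulas, the archimedean inputs, Ban–Aubert, [A11]-twisted, the five
AGIKMS supplies, [KM26], [CK26].  With `prop952_of_leaves`: what rows C99/C17 cite from [Ar, Prop. 9.5.2] has, in the
register as typed, support = those nine leaves EXACTLY. [cite: Shin2024, (H1) p0006:L5 with p0004:L5-9 (bookkeeping proved here)] -/
theorem prop952_support (l : LeafSupport.Leaf) :
    (canon₇ (LeafSupport.mkN (LeafSupport.cm l))).Prop952 ↔ l.shinS = false := by
  have h := shin_weakS_support l
  constructor
  · exact fun hp => h.1 hp.1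
  · intro hl
    have w := h.2 hl
    exact ⟨w, w.2.2.1⟩

/-- Katsurada–Lee FAILS in each of the 24 book countermodels (canonical reading). [cite: KatsuradaLee2026, Thms 7.1, 7.3 (bookkeeping proved here)] -/
theorem katsuradaLee_fails_cm (l : LeafSupport.Leaf) :
    ¬ (canon₇ (LeafSupport.mkN (LeafSupport.cm l))).KatsuradaLee :=
  not_B_cm l

/-- BOOK-LEAF SUPPORT, seventh tranche.  For each of the 24 book leaves: the model of `book_leaf_support` (book edge
system + every other book leaf; Mok's and KMSW's inputs and sequels in full; canonical reading) satisfies the implication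
bundles 1–5 and 7 and Shin's — the literal-citation edges of rows C99/C17 INCLUDED —; Katsurada–Lee fails; every
book-line statement of tranches 1–4 still fails (`BookConsumersFail`, `BookConsumersFail₄`: among them BLMM and
BMM-orth, now reachable by two edges each); and the Chapter-9 node holds iff the removed leaf is outside Shin's nine.
So: "inherits B-Ar" = ALL 24 leaves for C166 and (unchanged) for C99, C17; the Chapter-9 locator contributes nothing
beyond Shin's nine published-or-unwritten leaves. [cite: Arthur2013, §1.5 with AGIKMS2024 l.380-382; Shin2024 Thm 1.1.2 (bookkeeping proved here)] -/
theorem book_leaf_support₇ (l : LeafSupport.Leaf) :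
    ∃ (ν : Nodes) (ω : Waypoints) (γ : GlobalWaypoints) (μ : Mok2015.Nodes) (κ : KMSW2014.Nodes)
      (c : Consumers) (c₂ : Consumers2) (c₃ : Consumers3) (c₄ : Consumers4) (c₅ : Consumers5) (s : Shin)
      (c₇ : Consumers7),
      LeafSupport.Systems ν ω γ ∧ (∀ l', l' ≠ l → ν.leaf l') ∧ ¬ ν.leaf l ∧
      MokInputs μ ∧ KMSWInputs μ κ ∧ κ.UnwrittenSequels ∧
      Implications ν μ κ c ∧ Implications2 ν μ κ c c₂ ∧ Implications3 ν μ κ c c₃ ∧ Implications4 ν μ κ c c₂ c₃ c₄ ∧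
      Implications5 ν μ κ c c₂ c₅ ∧ Shin.Implications ν μ κ c s ∧ Implications7 ν c c₂ c₅ c₄ s c₇ ∧
      ¬ c₇.KatsuradaLee ∧ BookConsumersFail c c₂ c₃ ∧ BookConsumersFail₄ c₄ ∧ (c₇.Prop952 ↔ l.shinS = false) := by
  have cmod := LeafSupport.countermodel l
  have nb := not_B_cm l
  have KQ := kmswInputs_top μtop
  have I := canon_implications (LeafSupport.mkN (LeafSupport.cm l)) μtop κtop
  have J := canon_implications₂ (LeafSupport.mkN (LeafSupport.cm l)) μtop κtop
  have L := canon_implications₃ (LeafSupport.mkN (LeafSupport.cm l)) μtop κtop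
  have W := canon_implications₄ (LeafSupport.mkN (LeafSupport.cm l)) μtop κtop
  have V := canon_implications₅ (LeafSupport.mkN (LeafSupport.cm l)) μtop κtop
  have Z := canon_implications₇ (LeafSupport.mkN (LeafSupport.cm l)) μtop κtop
  refine ⟨_, _, _, μtop, κtop, canon _ μtop κtop, canon₂ _ μtop κtop, canon₃ _ μtop κtop, canon₄ _ μtop κtop,
    canon₅ _ μtop κtop, canonShin _ μtop κtop, canon₇ (LeafSupport.mkN (LeafSupport.cm l)),
    cmod.1, cmod.2.1, cmod.2.2.1, mokInputs_top, KQ.1, KQ.2, I, J, L, W, V, canon_shin _ _ _, Z, nb, ?_, ?_,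
    prop952_support l⟩
  · exact ⟨nb, nb, nb, nb, nb, nb, fun h => nb h.1, nb, nb, nb, nb, nb, nb, nb, nb, nb, fun h => nb h.1,
      nb, nb, nb, nb, nb, fun h => nb h.1, nb, nb, nb, fun h => nb h.1, nb, fun h => nb h.1⟩
  · exact ⟨nb, nb, fun h => nb h.1, fun h => nb h.1, nb, nb, nb, nb, nb⟩

/-- The Chapter-9 node packaged as a NINE-LEAF statement: for each of Shin's nine leaves a model of every book edge,
every other book leaf, the full unitary side, all implications (the seventh tranche's included) in which `Prop952`
fails — and for each of the other fifteen book leaves the same kind of model in which it HOLDS while the book's main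
theorems fail (`not_B_cm`).  The cited Chapter-9 content is thus independent, in the register as typed, of the fifteen
leaves that distinguish the book's classification from Shin's weak transfer (among them all five AGIKMS supplies). [cite: Shin2024, p0004:L15-18 (bookkeeping proved here)] -/
theorem prop952_independent_of_fifteen (l : LeafSupport.Leaf) (h : l.shinS = false) :
    ∃ (ν : Nodes) (ω : Waypoints) (γ : GlobalWaypoints) (μ : Mok2015.Nodes) (κ : KMSW2014.Nodes) (c : Consumers)
      (c₂ : Consumers2) (c₄ : Consumers4) (c₅ : Consumers5) (s : Shin) (c₇ : Consumers7),
      LeafSupport.Systems ν ω γ ∧ (∀ l', l' ≠ l → ν.leaf l') ∧ ¬ ν.leaf l ∧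
      Implications ν μ κ c ∧ Shin.Implications ν μ κ c s ∧ Implications7 ν c c₂ c₅ c₄ s c₇ ∧
      c₇.Prop952 ∧ ¬ (∀ N, ν.Everything N) := by
  have cmod := LeafSupport.countermodel l
  refine ⟨_, _, _, μtop, κtop, canon _ μtop κtop, canon₂ _ μtop κtop, canon₄ _ μtop κtop, canon₅ _ μtop κtop,
    canonShin _ μtop κtop, canon₇ (LeafSupport.mkN (LeafSupport.cm l)), cmod.1, cmod.2.1, cmod.2.2.1,
    canon_implications _ _ _, canon_shin _ _ _, canon_implications₇ _ μtop κtop, ?_, not_B_cm l⟩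
  exact (prop952_support l).2 h

/-! ## 12. Eighth tranche (v1.5, after `Downstream2.lean` v4): the Chapter-9 leaf is NEW; supports of row C16

The eighth tranche adds the LEAF node `Consumers8.InnerTwists` — the theorems stated in §§9.4–9.5 of the published
volume, whose proofs its Foreword (AMS 2013, p. xvii) and bibliography ([A28] "in preparation", p. 572) defer — with no
supplier edge, and row C16 (Jiang–Zhang 2020) as `JZclass` (their Theorem 2.1 as printed ⇐ book, Mok, KMSW in full,
`InnerTwists`), `JZmain` (their theorems ⇐ book, Mok, KMSW proved scope, `InnerTwists`) and `JZmainQS` (quasi-split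
case ⇐ book, Mok).  Certified here: (i) `InnerTwists` is a NEW leaf of the register — in the all-ones assignment of
all three DAGs (every book, Mok and KMSW leaf and both KMSW sequels true, every edge system valid) there is a reading
satisfying every eighth-tranche edge with `InnerTwists`, `JZclass`, `JZmain` false and `JZmainQS` true
(`innerTwists_is_a_new_leaf`): nothing the three DAGs deliver yields [Ar, §§9.4–9.5]; (ii) with the leaf GRANTED,
the three C16 statements hold in the all-ones assignment (`jz_holds_top`) and fail in each of the 24 book
countermodels (`jz_book_cm`) and in each of Mok's 29 countermodels (`jz_mok_cm`); in KMSW's 13 countermodels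
(`l ≠ MokMain`) `JZclass` always fails, `JZmain` fails exactly when the removed leaf is outside {AubertSS, KMS_A,
KMS_B}, and `JZmainQS` holds (`jz_kmsw_cm`).  So, as typed: support(JZclass) = all 24 + 29 + 13 leaves, both KMSW
sequels and [A28]; support(JZmain) = the same less {AubertSS, KMS_A, KMS_B}; support(JZmainQS) = the 24 + 29 leaves. -/

section Canon8

variable (ν : Nodes) (μ : Mok2015.Nodes) (κ : KMSW2014.Nodes)

/-- The canonical reading of the eighth tranche with the Chapter-9 leaf GRANTED (`InnerTwists := True`): each C16
statement := the conjunction of DAG outputs its edge receives. [cite: Arthur2013, downstream register of the cell, eighth tranche (canonical model; bookkeeping)] -/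
abbrev canon₈ : Consumers8 where
  InnerTwists := True
  JZclass := (∀ N, ν.Everything N) ∧ (∀ N, μ.Everything N) ∧ (∀ N, κ.Full N)
  JZmain := (∀ N, ν.Everything N) ∧ (∀ N, μ.Everything N) ∧ (∀ N, κ.Scope N)
  JZmainQS := (∀ N, ν.Everything N) ∧ (∀ N, μ.Everything N)

/-- The reading with the Chapter-9 leaf DENIED: `InnerTwists`, `JZclass`, `JZmain` false, `JZmainQS` as in `canon₈`. [cite: Arthur2013, Foreword p. xvii and [A28] p. 572 of the 2013 volume (paper:url-cbc9eee6eb25 p0018:L38-39, p0022:L20) (separating model; bookkeeping)] -/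
abbrev canon₈no : Consumers8 where
  InnerTwists := False
  JZclass := False
  JZmain := False
  JZmainQS := (∀ N, ν.Everything N) ∧ (∀ N, μ.Everything N)

/-- Every eighth-tranche edge holds in the canonical reading. [cite: JiangZhang2020, Thms 2.1, 5.3, 5.7, 7.1 (bookkeeping proved here)] -/
theorem canon_implications₈ : Implications8 ν μ κ (canon₈ ν μ κ) where
  jzClass := fun a m k _ => ⟨a, m, k⟩
  jzMain := fun a m k _ => ⟨a, m, k⟩
  jzMainQS := fun a m => ⟨a, m⟩

/-- Every eighth-tranche edge holds in the leaf-denied reading (the two general C16 edges vacuously). [cite: JiangZhang2020, Thms 2.1, 5.7 (bookkeeping proved here)] -/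
theorem canon_implications₈no : Implications8 ν μ κ (canon₈no ν μ) where
  jzClass := fun _ _ _ h => h.elim
  jzMain := fun _ _ _ h => h.elim
  jzMainQS := fun a m => ⟨a, m⟩

end Canon8

/-- [A28] IS A NEW LEAF OF THE REGISTER.  In the all-ones assignment of the three DAGs — every one of the 24 book
leaves, the 29 Mok leaves and the 13 KMSW leaves true, both KMSW sequels true, every edge system valid, so that
`BookInputs`, `MokInputs`, `KMSWInputs` hold in full — there is a consumer assignment satisfying every
eighth-tranche edge in which `InnerTwists`, `JZclass` and `JZmain` are FALSE while the quasi-split statement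
`JZmainQS` HOLDS.  Nothing delivered by the book's, Mok's or KMSW's DAG implies the theorems of [Ar, §§9.4–9.5]
in the register as typed; the Foreword's "They will be proved elsewhere" is a leaf of its own. [cite: Arthur2013, Foreword p. xvii (AMS 2013; paper:url-cbc9eee6eb25 p0018:L38-39) (bookkeeping proved here)] -/
theorem innerTwists_is_a_new_leaf :
    ∃ c₈ : Consumers8, BookInputs νtop ∧ MokInputs μtop ∧ KMSWInputs μtop κtop ∧ κtop.UnwrittenSequels ∧
      (∀ l : LeafSupport.Leaf, νtop.leaf l) ∧ (∀ l : Mok2015.LeafSupport.Leaf, μtop.leaf l) ∧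
      (∀ l : KMSW2014.LeafSupport.Leaf, κtop.leaf l) ∧ Implications8 νtop μtop κtop c₈ ∧
      ¬ c₈.InnerTwists ∧ ¬ c₈.JZclass ∧ ¬ c₈.JZmain ∧ c₈.JZmainQS :=
  have KQ := kmswInputs_top μtop
  ⟨canon₈no νtop μtop, bookInputs_top, mokInputs_top, KQ.1, KQ.2, leaves_top, mokLeaves_top, kmswLeaves_top,
    canon_implications₈no _ _ κtop, id, id, id, ⟨bookInputs_top.everything, mokInputs_top.everything⟩⟩

/-- With the Chapter-9 leaf granted and every input of the three DAGs, the three C16 statements hold (canonical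
reading, all-ones assignment) — the "if" half of the supports below, through the tranche's own bookkeeping theorems. [cite: JiangZhang2020, Thms 2.1, 5.7 (bookkeeping proved here)] -/
theorem jz_holds_top :
    (canon₈ νtop μtop κtop).JZclass ∧ (canon₈ νtop μtop κtop).JZmain ∧ (canon₈ νtop μtop κtop).JZmainQS :=
  have KQ := kmswInputs_top μtop
  have X := canon_implications₈ νtop μtop κtop
  ⟨jzclass_of_leaves_and_ch9 X bookInputs_top mokInputs_top KQ.1 KQ.2 trivial,
    jzmain_of_leaves_and_ch9 X bookInputs_top mokInputs_top KQ.1 trivial,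
    jzmainQS_of_leaves X bookInputs_top mokInputs_top⟩

/-- BOOK side: in each of the 24 book countermodels of `book_leaf_support` (book edge systems and every other book
leaf hold, the removed leaf fails; Mok and KMSW at the all-ones assignment; Chapter-9 leaf granted; canonical
reading, in which every eighth-tranche edge holds by `canon_implications₈`) all three C16 statements FAIL — every
one of the 24 book leaves is load-bearing for row C16, the quasi-split case included. [cite: JiangZhang2020, Thm 5.7 with Arthur2013 §1.5 (bookkeeping proved here)] -/
theorem jz_book_cm (l : LeafSupport.Leaf) :
    LeafSupport.Systems (LeafSupport.mkN (LeafSupport.cm l)) (LeafSupport.mkW (LeafSupport.cm l))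
        (LeafSupport.mkG (LeafSupport.cm l)) ∧
      (∀ l', l' ≠ l → (LeafSupport.mkN (LeafSupport.cm l)).leaf l') ∧ ¬ (LeafSupport.mkN (LeafSupport.cm l)).leaf l ∧
      ¬ (canon₈ (LeafSupport.mkN (LeafSupport.cm l)) μtop κtop).JZclass ∧
      ¬ (canon₈ (LeafSupport.mkN (LeafSupport.cm l)) μtop κtop).JZmain ∧
      ¬ (canon₈ (LeafSupport.mkN (LeafSupport.cm l)) μtop κtop).JZmainQS :=
  have cmod := LeafSupport.countermodel l
  have nb := not_B_cm l
  ⟨cmod.1, cmod.2.1, cmod.2.2.1, fun h => nb h.1, fun h => nb h.1, fun h => nb h.1⟩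

/-- MOK side: in each of the 29 Mok countermodels (Mok's section and supply edges and every other Mok leaf hold, the
removed leaf fails; book and KMSW at the all-ones assignment; leaf granted; canonical reading) all three C16
statements FAIL — row C16 treats unitary groups through Mok's memoir, so every Mok leaf is load-bearing, in the
quasi-split case too. [cite: JiangZhang2020, Thm 2.1 with Mok2012 §5.3 (bookkeeping proved here)] -/
theorem jz_mok_cm (l : Mok2015.LeafSupport.Leaf) :
    Mok2015.LeafSupport.Systems (Mok2015.LeafSupport.mkN (Mok2015.LeafSupport.cm l)) ∧
      (∀ l', l' ≠ l → (Mok2015.LeafSupport.mkN (Mok2015.LeafSupport.cm l)).leaf l') ∧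
      ¬ (Mok2015.LeafSupport.mkN (Mok2015.LeafSupport.cm l)).leaf l ∧
      ¬ (canon₈ νtop (Mok2015.LeafSupport.mkN (Mok2015.LeafSupport.cm l)) κtop).JZclass ∧
      ¬ (canon₈ νtop (Mok2015.LeafSupport.mkN (Mok2015.LeafSupport.cm l)) κtop).JZmain ∧
      ¬ (canon₈ νtop (Mok2015.LeafSupport.mkN (Mok2015.LeafSupport.cm l)) κtop).JZmainQS :=
  have cmod := Mok2015.LeafSupport.countermodel l
  have nm := not_M_cm l
  ⟨cmod.1, cmod.2.1, cmod.2.2.1, fun h => nm h.2.1, fun h => nm h.2.1, fun h => nm h.2⟩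

/-- KMSW side: in each of KMSW's countermodels for a leaf `l ≠ MokMain` (KMSW's edges and every other KMSW leaf
hold, `l` fails; book and Mok at the all-ones assignment; leaf granted; canonical reading): `JZclass` (which takes
KMSW's statements in full) FAILS for every such `l`; `JZmain` (proved scope) fails exactly when `l` is NOT one of
`AubertSS`, `KMS_A`, `KMS_B`, and holds when it is; `JZmainQS` holds throughout. [claim: KalethaMinguezShinWhite2014, under-review] (bookkeeping proved here) -/
theorem jz_kmsw_cm (l : KMSW2014.LeafSupport.Leaf) (hl : l ≠ .MokMain) :
    (∃ ωκ, KMSW2014.LeafSupport.Systems (KMSW2014.LeafSupport.mkN (KMSW2014.LeafSupport.cm l)) ωκ) ∧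
      (∀ l', l' ≠ l → (KMSW2014.LeafSupport.mkN (KMSW2014.LeafSupport.cm l)).leaf l') ∧
      ¬ (KMSW2014.LeafSupport.mkN (KMSW2014.LeafSupport.cm l)).leaf l ∧
      KMSW2014.E_ImportMok μtop (KMSW2014.LeafSupport.mkN (KMSW2014.LeafSupport.cm l)) ∧
      ¬ (canon₈ νtop μtop (KMSW2014.LeafSupport.mkN (KMSW2014.LeafSupport.cm l))).JZclass ∧
      ((canon₈ νtop μtop (KMSW2014.LeafSupport.mkN (KMSW2014.LeafSupport.cm l))).JZmain ↔ l.onlyFull = true) ∧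
      (canon₈ νtop μtop (KMSW2014.LeafSupport.mkN (KMSW2014.LeafSupport.cm l))).JZmainQS := by
  have cmod := KMSW2014.LeafSupport.countermodel l
  have nf : ¬ ∀ N, (KMSW2014.LeafSupport.mkN (KMSW2014.LeafSupport.cm l)).Full N :=
    fun h => KMSW2014.LeafSupport.not_full_of_noFull (cmod.2.2.2 0) (h 0)
  have b : ∀ N, νtop.Everything N := bookInputs_top.everything
  have m : ∀ N, μtop.Everything N := mokInputs_top.everything
  refine ⟨⟨_, cmod.1⟩, cmod.2.1, cmod.2.2.1, fun _ => cmod.2.1 .MokMain (Ne.symm hl), fun h => nf h.2.2, ?_, ⟨b, m⟩⟩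
  constructor
  · intro hs
    cases hb : l.onlyFull
    · exact absurd hs.2.2 fun hk =>
        KMSW2014.LeafSupport.not_scope_of (KMSW2014.LeafSupport.scope_fails l hb 0) (hk 0)
    · rfl
  · intro h
    exact ⟨b, m, scope_of_onlyFull l h⟩

/-! ## 13. Ninth tranche (v1.6, after `Downstream2.lean` v5): supports of the complex-conjugation line (C167, C46)

Canonical reading: `TaibiAssump` := the canonical `TaibiInner` (= `∀ N, ν.Everything N`), `TaibiEigen` := the same,
`CaraianiLeHung` := `∀ N, ν.Everything N`.  Certified: every ninth-tranche edge holds in that reading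
(`canon_implications₉`); the three statements FAIL in each of the 24 book countermodels (`taibiLine_book_cm` — all 24
book leaves load-bearing, through row A3) and HOLD in the all-ones assignment (`taibiLine_holds_top`); and the two
Chapter-9 routes are SEPARATED in one model: all DAG inputs true, `Implications8` and `Implications9` valid, the
complex-conjugation line true while `InnerTwists`, `JZclass`, `JZmain` are false (`ch9_routes_separated`) — C167/C46
do not inherit [A28] in the register as typed.  `canon₉` depends on ν only. -/

section Canon9

variable (ν : Nodes) (μ : Mok2015.Nodes) (κ : KMSW2014.Nodes)

/-- The canonical reading of the ninth tranche. [cite: Arthur2013, downstream register of the cell, ninth tranche (canonical model; bookkeeping)] -/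
abbrev canon₉ : Consumers9 where
  TaibiAssump := ∀ N, ν.Everything N
  TaibiEigen := ∀ N, ν.Everything N
  CaraianiLeHung := ∀ N, ν.Everything N

/-- Every ninth-tranche edge holds in the canonical reading (with the first-tranche canonical consumers, whose
`TaibiInner` is `∀ N, ν.Everything N`). [cite: Taibi2016, Thm 1; CaraianiLehung2016, Thm 1 (bookkeeping proved here)] -/
theorem canon_implications₉ : Implications9 ν (canon ν μ κ) (canon₉ ν) where
  taibiEigen := fun h => h
  taibiAssump := fun h => h
  caraianiLeHung := fun h _ => h

end Canon9

/-- BOOK side: in each of the 24 book countermodels (canonical reading) the hypothesis node and both statements of the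
complex-conjugation line FAIL — every book leaf is load-bearing for C167 and C46 (through Taïbi 2019, row A3). [cite: Taibi2016, Thm 1 with Taibi2018 Thm 4.0.1 (bookkeeping proved here)] -/
theorem taibiLine_book_cm (l : LeafSupport.Leaf) :
    ¬ (canon₉ (LeafSupport.mkN (LeafSupport.cm l))).TaibiAssump ∧
      ¬ (canon₉ (LeafSupport.mkN (LeafSupport.cm l))).TaibiEigen ∧
      ¬ (canon₉ (LeafSupport.mkN (LeafSupport.cm l))).CaraianiLeHung :=
  ⟨not_B_cm l, not_B_cm l, not_B_cm l⟩

/-- With every input of the book, the line holds (canonical reading, all-ones assignment) — via the tranche's own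
bookkeeping theorems. [cite: CaraianiLehung2016, Thm 1 (bookkeeping proved here)] -/
theorem taibiLine_holds_top :
    (canon₉ νtop).TaibiAssump ∧ (canon₉ νtop).TaibiEigen ∧ (canon₉ νtop).CaraianiLeHung :=
  have I := canon_implications νtop μtop κtop
  have W := canon_implications₉ νtop μtop κtop
  ⟨taibiAssump_of_leaves I W bookInputs_top, taibiEigen_of_leaves I W bookInputs_top,
    caraianiLeHung_of_leaves I W bookInputs_top⟩

/-- THE TWO CHAPTER-9 ROUTES SEPARATED.  One model — the all-ones assignment of the three DAGs (all 66 leaves and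
both KMSW sequels true; `BookInputs`, `MokInputs`, `KMSWInputs` in full), the canonical first-tranche consumers, the
leaf-denied eighth-tranche reading `canon₈no` and the canonical ninth-tranche reading — satisfies `Implications`,
`Implications8`, `Implications9`, has the complex-conjugation line (C167's assumptions and theorems, C46) TRUE and
`InnerTwists`, `JZclass`, `JZmain` FALSE.  Hence, as typed, C167/C46 do not depend on [A28], while C16's general
statements do. [cite: Taibi2018, cpctmult.tex l.174 with Arthur2013 Foreword p. xvii (bookkeeping proved here)] -/
theorem ch9_routes_separated :
    ∃ (c : Consumers) (c₈ : Consumers8) (c₉ : Consumers9),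
      BookInputs νtop ∧ MokInputs μtop ∧ KMSWInputs μtop κtop ∧ κtop.UnwrittenSequels ∧
      Implications νtop μtop κtop c ∧ Implications8 νtop μtop κtop c₈ ∧ Implications9 νtop c c₉ ∧
      c₉.TaibiAssump ∧ c₉.TaibiEigen ∧ c₉.CaraianiLeHung ∧ ¬ c₈.InnerTwists ∧ ¬ c₈.JZclass ∧ ¬ c₈.JZmain :=
  have KQ := kmswInputs_top μtop
  have T := taibiLine_holds_top
  ⟨canon νtop μtop κtop, canon₈no νtop μtop, canon₉ νtop, bookInputs_top, mokInputs_top, KQ.1, KQ.2,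
    canon_implications _ _ _, canon_implications₈no _ _ κtop, canon_implications₉ _ _ _, T.1, T.2.1, T.2.2,
    id, id, id⟩

/-! ## 14. Tenth tranche (v1.7, after `Downstream2.lean` v6): exact supports of the limit-multiplicity / Ramanujan
class (rows D7, D11–D17)

Canonical reading: every statement := exactly what its typed edge consumes — D7, (ECU) and the starred Martin–
Wakatsuki theorems := Mok's `Everything` ∧ KMSW's `Full`; D11, Kala's lower bound and Theorem 1, Assing, the node
"Arthur's classification for GSp₄" and Kim–Wakatsuki–Yamauchi's theorem := `∀ N, ν.Everything N`; Marshall's U(4)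
theorem := Mok's `Everything`; Marshall's (C4) := Mok's `Everything` ∧ KMSW's `Scope`; the statements whose edges
have NO DAG premise — Kala's upper bound, Martin–Wakatsuki's Theorem B, Marshall's family theorem — and the two
auxiliary inputs outside the DAGs (Rogawski via `canon₃`, the local-global assumption `JorzaC1`) GRANTED (`True`), so
that no failure is ever blamed on them; the n = 3 congruences := `True` accordingly.  Certified: (i) every
tenth-tranche edge holds in this reading for arbitrary ν, μ, κ (`canon_implications₁₀`); (ii) all sixteen fields hold
in the all-ones assignment of the three DAGs (`tenth_holds_top`, through `sectionD_rows_of_inputs`); (iii) BOOK side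
— in each of the 24 book countermodels the six book-line statements (D11, Kala's lower bound and Theorem 1, D16, the
GSp₄ node, D17) FAIL while Kala's UPPER bound holds (`tenth_book_cm`): support(KalaUpper) = ∅ and support(KalaDensity)
= all 24 leaves — THE TWO HALVES OF ONE THEOREM SEPARATED leaf by leaf; (iv) MOK side — in each of the 29 Mok
countermodels (KMSW's edges and all KMSW leaves but `MokMain`, so the sequels hold) D7, (ECU), the starred
congruences, Marshall's U(4) theorem and Marshall's (C4) FAIL while Theorem B, the n = 3 congruences and the family
theorem hold (`tenth_mok_cm`) — Martin–Wakatsuki's THREE REGIMES and Marshall's TWO READINGS separated leaf by leaf;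
(v) KMSW side — in each of KMSW's countermodels for `l ≠ MokMain`, D7, (ECU) and the starred congruences fail for
EVERY such `l` (they take the starred statements in full: both sequels load-bearing), Marshall's (C4) holds exactly
when `l ∈ {AubertSS, KMS_A, KMS_B}` (proved scope, no sequel), Marshall's U(4) theorem holds throughout
(`tenth_kmsw_cm`). -/

section Canon10

variable (ν : Nodes) (μ : Mok2015.Nodes) (κ : KMSW2014.Nodes)

/-- The canonical reading of the tenth tranche (hypothesis nodes := the premises of their supplier edges; premise-free
statements and the local-global assumption of row D17 GRANTED). [cite: Arthur2013, downstream register of the cell, tenth tranche (canonical model; bookkeeping)] -/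
abbrev canon₁₀ : Consumers10 where
  DMZramanujan := (∀ N, μ.Everything N) ∧ (∀ N, κ.Full N)
  JiangLiuCusp := ∀ N, ν.Everything N
  KalaUpper := True
  KalaLower := ∀ N, ν.Everything N
  KalaDensity := ∀ N, ν.Everything N
  ECU := (∀ N, μ.Everything N) ∧ (∀ N, κ.Full N)
  MWcongruence := (∀ N, μ.Everything N) ∧ (∀ N, κ.Full N)
  MWcongruence3 := True
  MWthmB := True
  MarshallU4 := ∀ N, μ.Everything N
  MarshallC4 := (∀ N, μ.Everything N) ∧ (∀ N, κ.Scope N)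
  MarshallSubconvex := True
  AssingDensity := ∀ N, ν.Everything N
  JorzaC1 := True
  ArthurGSp4 := ∀ N, ν.Everything N
  KWYfields := ∀ N, ν.Everything N

/-- Every tenth-tranche edge holds in the canonical reading, for arbitrary ν, μ, κ (with the first- and third-tranche
canonical consumers: `GeeTaibi` = `∀ N, ν.Everything N`, `Rogawski` = `True`). [cite: Arthur2013, downstream register of the cell, tenth tranche (bookkeeping proved here)] -/
theorem canon_implications₁₀ : Implications10 ν μ κ (canon ν μ κ) (canon₃ ν μ κ) (canon₁₀ ν μ κ) where
  dmz := fun m f => ⟨m, f⟩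
  jiangLiu := fun h => h
  kalaUpper := trivial
  kalaLower := fun h => h
  kalaDensity := fun _ h => h
  ecu := fun m f => ⟨m, f⟩
  mwCongruence := fun h => h
  mwCongruence3 := fun _ => trivial
  mwThmB := trivial
  marshallU4 := fun m => m
  marshallSubconvex := trivial
  marshallC4 := fun m k => ⟨m, k⟩
  assing := fun h _ => h
  kwy := fun _ h => h
  arthurGSp4 := fun h => h

end Canon10

/-- With every input of the three DAGs (both KMSW sequels included), Rogawski and the local-global assumption granted,
all sixteen fields of the tenth tranche hold (canonical reading, all-ones assignment) — the "if" half, re-checked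
through the tranche's own `sectionD_rows_of_inputs`. [cite: Arthur2013, downstream register, §D of the cell's DOWNSTREAM.md (bookkeeping proved here)] -/
theorem tenth_holds_top :
    (canon₁₀ νtop μtop κtop).DMZramanujan ∧ (canon₁₀ νtop μtop κtop).JiangLiuCusp ∧
      (canon₁₀ νtop μtop κtop).KalaDensity ∧ (canon₁₀ νtop μtop κtop).MWcongruence ∧
      (canon₁₀ νtop μtop κtop).MWcongruence3 ∧ (canon₁₀ νtop μtop κtop).MarshallU4 ∧
      ((canon₁₀ νtop μtop κtop).MarshallSubconvex ∧ (canon₁₀ νtop μtop κtop).MarshallC4) ∧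
      (canon₁₀ νtop μtop κtop).AssingDensity ∧ (canon₁₀ νtop μtop κtop).KWYfields :=
  have KQ := kmswInputs_top μtop
  sectionD_rows_of_inputs (canon_implications νtop μtop κtop) (canon_implications₁₀ νtop μtop κtop) bookInputs_top
    mokInputs_top KQ.1 KQ.2 trivial trivial

/-- Tenth tranche, BOOK line: the statements whose canonical reading contains the book FAIL (rows D11, D12 lower
bound and Theorem 1, D16, D17 with its GSp₄ node). [cite: Arthur2013, downstream register of the cell, tenth tranche (row classes; bookkeeping)] -/
structure BookLineFail₁₀ (c₁₀ : Consumers10) : Prop where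
  jiangLiu : ¬ c₁₀.JiangLiuCusp
  kalaLower : ¬ c₁₀.KalaLower
  kalaDensity : ¬ c₁₀.KalaDensity
  assing : ¬ c₁₀.AssingDensity
  arthurGSp4 : ¬ c₁₀.ArthurGSp4
  kwy : ¬ c₁₀.KWYfields

/-- Tenth tranche, UNITARY line: the statements whose canonical reading contains Mok's memoir FAIL (rows D7, D13's
(ECU) and starred theorems, D14, D15's (C4)). [cite: Mok2012, downstream register of the cell, tenth tranche (row classes; bookkeeping)] -/
structure UnitaryLineFail₁₀ (c₁₀ : Consumers10) : Prop where
  dmz : ¬ c₁₀.DMZramanujan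
  ecu : ¬ c₁₀.ECU
  mwCongruence : ¬ c₁₀.MWcongruence
  marshallU4 : ¬ c₁₀.MarshallU4
  marshallC4 : ¬ c₁₀.MarshallC4

/-- Tenth tranche, the statements with NO DAG premise (or only granted auxiliary inputs) HOLD: Kala's upper bound,
Martin–Wakatsuki's Theorem B and n = 3 case, Marshall's family theorem. [cite: Arthur2013, downstream register of the cell, tenth tranche (row classes; bookkeeping)] -/
structure PremiseFreeHold₁₀ (c₁₀ : Consumers10) : Prop where
  kalaUpper : c₁₀.KalaUpper
  mwThmB : c₁₀.MWthmB
  mwCongruence3 : c₁₀.MWcongruence3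
  marshallSubconvex : c₁₀.MarshallSubconvex

/-- BOOK side.  In each of the 24 book countermodels of `book_leaf_support` (book edge systems and every other book
leaf hold, the removed leaf fails; Mok and KMSW at the all-ones assignment; canonical reading, in which every
tenth-tranche edge holds by `canon_implications₁₀`): the six book-line statements FAIL, the five unitary-line
statements HOLD, the premise-free statements hold — in particular Kala's UPPER bound holds while his LOWER bound and
Theorem 1 fail: every one of the 24 book leaves is load-bearing for rows D11, D12 (Thm 1), D16, D17, and none for
D12's upper bound. [cite: Kala2014, p0004:L29-30 with Arthur2013 §1.5 (bookkeeping proved here)] -/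
theorem tenth_book_cm (l : LeafSupport.Leaf) :
    LeafSupport.Systems (LeafSupport.mkN (LeafSupport.cm l)) (LeafSupport.mkW (LeafSupport.cm l))
        (LeafSupport.mkG (LeafSupport.cm l)) ∧
      (∀ l', l' ≠ l → (LeafSupport.mkN (LeafSupport.cm l)).leaf l') ∧ ¬ (LeafSupport.mkN (LeafSupport.cm l)).leaf l ∧
      Implications10 (LeafSupport.mkN (LeafSupport.cm l)) μtop κtop (canon (LeafSupport.mkN (LeafSupport.cm l)) μtop κtop)
        (canon₃ (LeafSupport.mkN (LeafSupport.cm l)) μtop κtop) (canon₁₀ (LeafSupport.mkN (LeafSupport.cm l)) μtop κtop) ∧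
      BookLineFail₁₀ (canon₁₀ (LeafSupport.mkN (LeafSupport.cm l)) μtop κtop) ∧
      ¬ UnitaryLineFail₁₀ (canon₁₀ (LeafSupport.mkN (LeafSupport.cm l)) μtop κtop) ∧
      (canon₁₀ (LeafSupport.mkN (LeafSupport.cm l)) μtop κtop).DMZramanujan ∧
      (canon₁₀ (LeafSupport.mkN (LeafSupport.cm l)) μtop κtop).MWcongruence ∧
      (canon₁₀ (LeafSupport.mkN (LeafSupport.cm l)) μtop κtop).MarshallU4 ∧
      (canon₁₀ (LeafSupport.mkN (LeafSupport.cm l)) μtop κtop).MarshallC4 ∧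
      PremiseFreeHold₁₀ (canon₁₀ (LeafSupport.mkN (LeafSupport.cm l)) μtop κtop) := by
  have cmod := LeafSupport.countermodel l
  have nb := not_B_cm l
  have KQ := kmswInputs_top μtop
  have m : ∀ N, μtop.Everything N := mokInputs_top.everything
  have f : ∀ N, κtop.Full N := KQ.1.full mokInputs_top KQ.2
  have k : ∀ N, κtop.Scope N := KQ.1.scope mokInputs_top
  refine ⟨cmod.1, cmod.2.1, cmod.2.2.1, canon_implications₁₀ _ _ _, ⟨nb, nb, nb, nb, nb, nb⟩, ?_,
    ⟨m, f⟩, ⟨m, f⟩, m, ⟨m, k⟩, ⟨trivial, trivial, trivial, trivial⟩⟩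
  exact fun h => h.dmz ⟨m, f⟩

/-- MOK side.  In each of the 29 Mok countermodels of `mok_leaf_support` (Mok's section and supply edges and every
other Mok leaf hold, the removed leaf fails; book at the all-ones assignment; KMSW = `κnoMok`, the least model over
all KMSW leaves but `MokMain`, in which KMSW's edges, published leaves, general weighted FL and BOTH sequels hold;
canonical reading): D7, (ECU), the starred congruences, Marshall's U(4) theorem and Marshall's (C4) FAIL; the six
book-line statements and the premise-free statements HOLD.  Every one of Mok's 29 leaves is load-bearing for rows
D7, D13 (starred), D14 and for D15's condition (C4) — and for none of Theorem B, the n = 3 congruences, the family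
theorem. [cite: Mok2012, §5.3 l.4278 (bookkeeping proved here)] -/
theorem tenth_mok_cm (l : Mok2015.LeafSupport.Leaf) :
    Mok2015.LeafSupport.Systems (Mok2015.LeafSupport.mkN (Mok2015.LeafSupport.cm l)) ∧
      (∀ l', l' ≠ l → (Mok2015.LeafSupport.mkN (Mok2015.LeafSupport.cm l)).leaf l') ∧
      ¬ (Mok2015.LeafSupport.mkN (Mok2015.LeafSupport.cm l)).leaf l ∧
      KMSWInputs (Mok2015.LeafSupport.mkN (Mok2015.LeafSupport.cm l)) κnoMok ∧ κnoMok.UnwrittenSequels ∧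
      Implications10 νtop (Mok2015.LeafSupport.mkN (Mok2015.LeafSupport.cm l)) κnoMok
        (canon νtop (Mok2015.LeafSupport.mkN (Mok2015.LeafSupport.cm l)) κnoMok)
        (canon₃ νtop (Mok2015.LeafSupport.mkN (Mok2015.LeafSupport.cm l)) κnoMok)
        (canon₁₀ νtop (Mok2015.LeafSupport.mkN (Mok2015.LeafSupport.cm l)) κnoMok) ∧
      UnitaryLineFail₁₀ (canon₁₀ νtop (Mok2015.LeafSupport.mkN (Mok2015.LeafSupport.cm l)) κnoMok) ∧
      ¬ BookLineFail₁₀ (canon₁₀ νtop (Mok2015.LeafSupport.mkN (Mok2015.LeafSupport.cm l)) κnoMok) ∧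
      (canon₁₀ νtop (Mok2015.LeafSupport.mkN (Mok2015.LeafSupport.cm l)) κnoMok).JiangLiuCusp ∧
      (canon₁₀ νtop (Mok2015.LeafSupport.mkN (Mok2015.LeafSupport.cm l)) κnoMok).KalaDensity ∧
      (canon₁₀ νtop (Mok2015.LeafSupport.mkN (Mok2015.LeafSupport.cm l)) κnoMok).AssingDensity ∧
      (canon₁₀ νtop (Mok2015.LeafSupport.mkN (Mok2015.LeafSupport.cm l)) κnoMok).KWYfields ∧
      PremiseFreeHold₁₀ (canon₁₀ νtop (Mok2015.LeafSupport.mkN (Mok2015.LeafSupport.cm l)) κnoMok) := by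
  have cmod := Mok2015.LeafSupport.countermodel l
  have nm := not_M_cm l
  have kf := κnoMok_facts
  have KI : KMSWInputs (Mok2015.LeafSupport.mkN (Mok2015.LeafSupport.cm l)) κnoMok :=
    ⟨fun hM => absurd hM nm, kf.1.chapter, kf.1.supply, kf.2.2.1, kf.2.2.2.1⟩
  have b : ∀ N, νtop.Everything N := bookInputs_top.everything
  refine ⟨cmod.1, cmod.2.1, cmod.2.2.1, KI, kf.2.2.2.2.1, canon_implications₁₀ _ _ _,
    ⟨fun h => nm h.1, fun h => nm h.1, fun h => nm h.1, nm, fun h => nm h.1⟩, fun h => h.jiangLiu b,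
    b, b, b, b, ⟨trivial, trivial, trivial, trivial⟩⟩

/-- KMSW side.  In each of KMSW's countermodels for a leaf `l ≠ MokMain` (KMSW's edges and every other KMSW leaf
hold, `l` fails; book and Mok at the all-ones assignment, the import edge discharged; canonical reading): D7, (ECU)
and the starred Martin–Wakatsuki theorems — consumers of the starred statements IN FULL — FAIL for every such `l`
(the thirteen leaves, BOTH SEQUELS INCLUDED, are load-bearing); Marshall's (C4) holds EXACTLY when the removed leaf is
`AubertSS`, `KMS_A` or `KMS_B` (it consumes the PROVED scope, no sequel); Marshall's U(4) theorem (Mok only), the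
book-line and the premise-free statements hold throughout. [claim: KalethaMinguezShinWhite2014, under-review] (bookkeeping proved here: exact KMSW-support of rows D7, D13, D15) -/
theorem tenth_kmsw_cm (l : KMSW2014.LeafSupport.Leaf) (hl : l ≠ .MokMain) :
    (∃ ωκ, KMSW2014.LeafSupport.Systems (KMSW2014.LeafSupport.mkN (KMSW2014.LeafSupport.cm l)) ωκ) ∧
      (∀ l', l' ≠ l → (KMSW2014.LeafSupport.mkN (KMSW2014.LeafSupport.cm l)).leaf l') ∧
      ¬ (KMSW2014.LeafSupport.mkN (KMSW2014.LeafSupport.cm l)).leaf l ∧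
      KMSW2014.E_ImportMok μtop (KMSW2014.LeafSupport.mkN (KMSW2014.LeafSupport.cm l)) ∧
      Implications10 νtop μtop (KMSW2014.LeafSupport.mkN (KMSW2014.LeafSupport.cm l))
        (canon νtop μtop (KMSW2014.LeafSupport.mkN (KMSW2014.LeafSupport.cm l)))
        (canon₃ νtop μtop (KMSW2014.LeafSupport.mkN (KMSW2014.LeafSupport.cm l)))
        (canon₁₀ νtop μtop (KMSW2014.LeafSupport.mkN (KMSW2014.LeafSupport.cm l))) ∧
      ¬ (canon₁₀ νtop μtop (KMSW2014.LeafSupport.mkN (KMSW2014.LeafSupport.cm l))).DMZramanujan ∧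
      ¬ (canon₁₀ νtop μtop (KMSW2014.LeafSupport.mkN (KMSW2014.LeafSupport.cm l))).ECU ∧
      ¬ (canon₁₀ νtop μtop (KMSW2014.LeafSupport.mkN (KMSW2014.LeafSupport.cm l))).MWcongruence ∧
      ((canon₁₀ νtop μtop (KMSW2014.LeafSupport.mkN (KMSW2014.LeafSupport.cm l))).MarshallC4 ↔ l.onlyFull = true) ∧
      (canon₁₀ νtop μtop (KMSW2014.LeafSupport.mkN (KMSW2014.LeafSupport.cm l))).MarshallU4 ∧
      ¬ BookLineFail₁₀ (canon₁₀ νtop μtop (KMSW2014.LeafSupport.mkN (KMSW2014.LeafSupport.cm l))) ∧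
      PremiseFreeHold₁₀ (canon₁₀ νtop μtop (KMSW2014.LeafSupport.mkN (KMSW2014.LeafSupport.cm l))) := by
  have cmod := KMSW2014.LeafSupport.countermodel l
  have nf : ¬ ∀ N, (KMSW2014.LeafSupport.mkN (KMSW2014.LeafSupport.cm l)).Full N :=
    fun h => KMSW2014.LeafSupport.not_full_of_noFull (cmod.2.2.2 0) (h 0)
  have b : ∀ N, νtop.Everything N := bookInputs_top.everything
  have m : ∀ N, μtop.Everything N := mokInputs_top.everything
  refine ⟨⟨_, cmod.1⟩, cmod.2.1, cmod.2.2.1, fun _ => cmod.2.1 .MokMain (Ne.symm hl), canon_implications₁₀ _ _ _,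
    fun h => nf h.2, fun h => nf h.2, fun h => nf h.2, ?_, m, fun h => h.jiangLiu b, ⟨trivial, trivial, trivial, trivial⟩⟩
  constructor
  · intro hs
    cases hb : l.onlyFull
    · exact absurd hs.2 fun hk =>
        KMSW2014.LeafSupport.not_scope_of (KMSW2014.LeafSupport.scope_fails l hb 0) (hk 0)
    · rfl
  · intro h
    exact ⟨m, scope_of_onlyFull l h⟩

/-- KALA'S TWO HALVES SEPARATED (row D12), as one statement over the 24 book leaves: in every book countermodel the
upper bound holds and the two-sided Theorem 1 fails; in the all-ones assignment both hold.  As typed,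
support(upper bound) = ∅ and support(Theorem 1) = support(lower bound) = all 24 book leaves — the author's sentence
"In the proof of the lower bound, we are relying on Arthur's results [arthur] … To prove the upper bound, it suffices
to consider only functoriality for generic representations, which is available by [cps] unconditionally." (arXiv:1406.0385 p0004:L29-30) made exact. [cite: Kala2014, p0004:L29-30 (bookkeeping proved here)] -/
theorem kala_halves_separated :
    (∀ l : LeafSupport.Leaf,
        (canon₁₀ (LeafSupport.mkN (LeafSupport.cm l)) μtop κtop).KalaUpper ∧
          ¬ (canon₁₀ (LeafSupport.mkN (LeafSupport.cm l)) μtop κtop).KalaDensity) ∧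
      ((canon₁₀ νtop μtop κtop).KalaUpper ∧ (canon₁₀ νtop μtop κtop).KalaDensity) :=
  ⟨fun l => ⟨trivial, not_B_cm l⟩, ⟨trivial, tenth_holds_top.2.2.1⟩⟩

/-- MARTIN–WAKATSUKI'S THREE REGIMES SEPARATED (row D13): in every Mok countermodel and in every KMSW countermodel
(`l ≠ MokMain`) Theorem B and the n = 3 congruences hold while the starred (n > 3) congruences fail; in the all-ones
assignment all three hold.  As typed: support(Thm B) = ∅, support(n = 3) = Rogawski only (granted), support(n > 3) =
Mok's 29 leaves + KMSW's 13 incl. both sequels — the asterisk of "Theorem A*" made exact. [cite: MartinWakatsuki2024, p.4 (arXiv:1907.03417 p0004:L24-30) (bookkeeping proved here)] -/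
theorem mw_regimes_separated :
    (∀ l : Mok2015.LeafSupport.Leaf,
        (canon₁₀ νtop (Mok2015.LeafSupport.mkN (Mok2015.LeafSupport.cm l)) κnoMok).MWthmB ∧
          (canon₁₀ νtop (Mok2015.LeafSupport.mkN (Mok2015.LeafSupport.cm l)) κnoMok).MWcongruence3 ∧
          ¬ (canon₁₀ νtop (Mok2015.LeafSupport.mkN (Mok2015.LeafSupport.cm l)) κnoMok).MWcongruence) ∧
      (∀ l : KMSW2014.LeafSupport.Leaf, l ≠ .MokMain →
        (canon₁₀ νtop μtop (KMSW2014.LeafSupport.mkN (KMSW2014.LeafSupport.cm l))).MWthmB ∧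
          (canon₁₀ νtop μtop (KMSW2014.LeafSupport.mkN (KMSW2014.LeafSupport.cm l))).MWcongruence3 ∧
          ¬ (canon₁₀ νtop μtop (KMSW2014.LeafSupport.mkN (KMSW2014.LeafSupport.cm l))).MWcongruence) ∧
      ((canon₁₀ νtop μtop κtop).MWthmB ∧ (canon₁₀ νtop μtop κtop).MWcongruence3 ∧
        (canon₁₀ νtop μtop κtop).MWcongruence) :=
  ⟨fun l => ⟨trivial, trivial, (tenth_mok_cm l).2.2.2.2.2.2.1.mwCongruence⟩,
    fun l hl => ⟨trivial, trivial, (tenth_kmsw_cm l hl).2.2.2.2.2.2.2.1⟩,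
    ⟨trivial, trivial, tenth_holds_top.2.2.2.1⟩⟩

/-- MARSHALL 2023, THE TWO READINGS SEPARATED (row D15): the family theorem holds in every Mok countermodel and every
KMSW countermodel, where the verification of (C4) fails (Mok side: always; KMSW side: exactly outside {AubertSS, KMS_A,
KMS_B}); both hold in the all-ones assignment.  As typed: support(Thm 1.6) = ∅; support((C4) supplied) = Mok's 29
leaves + the ten KMSW proved-scope leaves, no sequel — "although this is currently conditional" made exact. [cite: Marshall2023, Thm 1.6 and Remark 2 (bookkeeping proved here)] -/
theorem marshall2023_readings_separated :
    (∀ l : Mok2015.LeafSupport.Leaf,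
        (canon₁₀ νtop (Mok2015.LeafSupport.mkN (Mok2015.LeafSupport.cm l)) κnoMok).MarshallSubconvex ∧
          ¬ (canon₁₀ νtop (Mok2015.LeafSupport.mkN (Mok2015.LeafSupport.cm l)) κnoMok).MarshallC4) ∧
      (∀ l : KMSW2014.LeafSupport.Leaf, l ≠ .MokMain →
        (canon₁₀ νtop μtop (KMSW2014.LeafSupport.mkN (KMSW2014.LeafSupport.cm l))).MarshallSubconvex ∧
          ((canon₁₀ νtop μtop (KMSW2014.LeafSupport.mkN (KMSW2014.LeafSupport.cm l))).MarshallC4 ↔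
            l.onlyFull = true)) ∧
      ((canon₁₀ νtop μtop κtop).MarshallSubconvex ∧ (canon₁₀ νtop μtop κtop).MarshallC4) :=
  ⟨fun l => ⟨trivial, (tenth_mok_cm l).2.2.2.2.2.2.1.marshallC4⟩,
    fun l hl => ⟨trivial, (tenth_kmsw_cm l hl).2.2.2.2.2.2.2.2.1⟩,
    ⟨trivial, tenth_holds_top.2.2.2.2.2.2.1.2⟩⟩

/-! ## 15. Eleventh tranche (v1.8, after `Downstream2.lean` v7): exact supports of the metaplectic line (B11 ×2, C28)

Canonical reading: all three statements := `∀ N, ν.Everything N` (C28's further premises — Gan–Ichino ×2, the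
non-split generic counterparts, Xu, Luo — are themselves read as the book's output in `canon` / `canon₂`).  Certified:
every eleventh-tranche edge holds in that reading for arbitrary ν, μ, κ (`canon_implications₁₁`); the three statements
hold in the all-ones assignment (`eleventh_holds_top`, through `metaplectic_line_of_book`); they FAIL in each of the 24
book countermodels (`eleventh_book_cm` — every book leaf load-bearing for B11 and C28, C28 also through C1 / A5 / B2);
and they HOLD in every Mok countermodel and every KMSW countermodel (`eleventh_unitary_independent` — no unitary leaf is
in their support).  `canon₁₁` depends on ν only. -/

section Canon11

variable (ν : Nodes) (μ : Mok2015.Nodes) (κ : KMSW2014.Nodes)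

/-- The canonical reading of the eleventh tranche. [cite: Arthur2013, downstream register of the cell, eleventh tranche (canonical model; bookkeeping)] -/
abbrev canon₁₁ : Consumers11 where
  LiSpectralTransfer := ∀ N, ν.Everything N
  LuoECR := ∀ N, ν.Everything N
  LiMpApackets := ∀ N, ν.Everything N

/-- Every eleventh-tranche edge holds in the canonical reading (with the first- and second-tranche canonical
consumers). [cite: LiWenWei2024Metaplectic, Thms 1–4; Luo2020Metaplectic; LiWenWei2019SpectralTransfer (bookkeeping proved here)] -/
theorem canon_implications₁₁ : Implications11 ν (canon ν μ κ) (canon₂ ν μ κ) (canon₁₁ ν) where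
  liSpectral := fun h => h
  luo := fun h => h
  liMp := fun h _ _ _ _ _ => h

end Canon11

/-- With every input of the book, the metaplectic line holds (canonical reading, all-ones assignment) — via the
tranche's own `metaplectic_line_of_book`. [cite: LiWenWei2024Metaplectic, Thms 1–4 (bookkeeping proved here)] -/
theorem eleventh_holds_top :
    (canon₁₁ νtop).LiSpectralTransfer ∧ (canon₁₁ νtop).LuoECR ∧ (canon₁₁ νtop).LiMpApackets :=
  (metaplectic_line_of_book (canon_implications νtop μtop κtop) (canon_implications₂ νtop μtop κtop)
    (canon_implications₅ νtop μtop κtop) (canon_implications₁₁ νtop μtop κtop) bookInputs_top).2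

/-- BOOK side: in each of the 24 book countermodels (canonical reading, in which every eleventh-tranche edge holds)
all three statements FAIL — every book leaf is load-bearing for W.-W. Li 2019, Luo 2020 and W.-W. Li 2024. [cite: LiWenWei2024Metaplectic, Remark 4 with Arthur2013 §1.5 (bookkeeping proved here)] -/
theorem eleventh_book_cm (l : LeafSupport.Leaf) :
    Implications11 (LeafSupport.mkN (LeafSupport.cm l)) (canon (LeafSupport.mkN (LeafSupport.cm l)) μtop κtop)
        (canon₂ (LeafSupport.mkN (LeafSupport.cm l)) μtop κtop) (canon₁₁ (LeafSupport.mkN (LeafSupport.cm l))) ∧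
      ¬ (canon₁₁ (LeafSupport.mkN (LeafSupport.cm l))).LiSpectralTransfer ∧
      ¬ (canon₁₁ (LeafSupport.mkN (LeafSupport.cm l))).LuoECR ∧
      ¬ (canon₁₁ (LeafSupport.mkN (LeafSupport.cm l))).LiMpApackets :=
  ⟨canon_implications₁₁ _ μtop κtop, not_B_cm l, not_B_cm l, not_B_cm l⟩

/-- UNITARY side: in every Mok countermodel and every KMSW countermodel (book at the all-ones assignment) all three
statements HOLD — the metaplectic line has no Mok or KMSW leaf in its support. [cite: LiWenWei2024Metaplectic, Thms 1–4 (bookkeeping proved here)] -/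
theorem eleventh_unitary_independent :
    (∀ l : Mok2015.LeafSupport.Leaf,
        Implications11 νtop (canon νtop (Mok2015.LeafSupport.mkN (Mok2015.LeafSupport.cm l)) κnoMok)
          (canon₂ νtop (Mok2015.LeafSupport.mkN (Mok2015.LeafSupport.cm l)) κnoMok) (canon₁₁ νtop) ∧
        (canon₁₁ νtop).LiSpectralTransfer ∧ (canon₁₁ νtop).LuoECR ∧ (canon₁₁ νtop).LiMpApackets) ∧
    (∀ l : KMSW2014.LeafSupport.Leaf,
        Implications11 νtop (canon νtop μtop (KMSW2014.LeafSupport.mkN (KMSW2014.LeafSupport.cm l)))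
          (canon₂ νtop μtop (KMSW2014.LeafSupport.mkN (KMSW2014.LeafSupport.cm l))) (canon₁₁ νtop) ∧
        (canon₁₁ νtop).LiSpectralTransfer ∧ (canon₁₁ νtop).LuoECR ∧ (canon₁₁ νtop).LiMpApackets) :=
  have T := eleventh_holds_top
  ⟨fun _ => ⟨canon_implications₁₁ _ _ _, T⟩, fun _ => ⟨canon_implications₁₁ _ _ _, T⟩⟩

/-! ## 16. Twelfth tranche (v1.9, after `Downstream3.lean` v1): exact supports of row B6 and of C28 through B6

Canonical reading: `LLSoddOrth` := `∀ N, ν.Everything N` (its further premises — Ishimoto's generic theorem,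
Atobe–Mínguez — are themselves read as the book's output in `canon` / `canon₅`); `LLSantiTempered` := the conjunction
of the book's and Mok's `Everything` with KMSW's `Scope`.  Certified: every twelfth-tranche edge holds in that reading
for arbitrary ν, μ, κ (`canon_implications₁₂`); both B6 fields and C28 hold in the all-ones assignment
(`twelfth_holds_top`, through the tranche's own `lls_both_of_inputs` / `liMpApacketsB6_of_leaves`); BOOK side: both B6
fields and C28 FAIL in each of the 24 book countermodels (`twelfth_book_cm`); MOK side: in each of the 29 Mok
countermodels B6 as printed FAILS while its odd-orthogonal case and C28 HOLD (`twelfth_mok_cm`) — B6 as printed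
inherits every Mok leaf, the metaplectic line through B6 inherits none; KMSW side: for every KMSW leaf other than the
imported `MokMain`, B6 as printed holds in the countermodel exactly when the leaf is one of `AubertSS`, `KMS_A`,
`KMS_B` (proved-scope pattern), the odd-orthogonal case and C28 hold throughout (`twelfth_kmsw_cm`); and ONE model
separates B6's two fields with every input of the book granted (`lls_readings_separated`).  The landed eleventh-tranche
edge `E_LiMpApackets` and the repaired `E_LiMpApacketsB6` both hold in the canonical reading (`liMp_edges_canon`). -/

section Canon12

variable (ν : Nodes) (μ : Mok2015.Nodes) (κ : KMSW2014.Nodes)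

/-- The canonical reading of the twelfth tranche. [cite: Arthur2013, downstream register of the cell, twelfth tranche (canonical model; bookkeeping)] -/
abbrev canon₁₂ : Consumers12 where
  LLSantiTempered := (∀ N, ν.Everything N) ∧ (∀ N, μ.Everything N) ∧ (∀ N, κ.Scope N)
  LLSoddOrth := ∀ N, ν.Everything N

/-- Every twelfth-tranche edge holds in the canonical reading (with the first-, second-, fifth- and eleventh-tranche
canonical consumers), for arbitrary ν, μ, κ. [claim: LiuLoShahidi2024, under-review] (bookkeeping proved here) -/
theorem canon_implications₁₂ :
    Implications12 ν μ κ (canon ν μ κ) (canon₂ ν μ κ) (canon₅ ν μ κ) (canon₁₁ ν) (canon₁₂ ν μ κ) where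
  llsPrinted := fun a m k _ _ => ⟨a, m, k⟩
  llsOdd := fun a _ _ => a
  llsCase := fun h => h.1
  liMpB6 := fun h _ _ _ _ _ _ => h

/-- Both readings of C28's edge — the landed `E_LiMpApackets` (eleventh tranche) and the repaired `E_LiMpApacketsB6` —
hold in the canonical reading; the second also as a consequence of the first (`liMp_landed_implies_B6`). [cite: LiWenWei2024Metaplectic, Remark 4 (bookkeeping proved here)] -/
theorem liMp_edges_canon :
    E_LiMpApackets ν (canon ν μ κ) (canon₂ ν μ κ) (canon₁₁ ν) ∧
      E_LiMpApacketsB6 ν (canon ν μ κ) (canon₂ ν μ κ) (canon₁₁ ν) (canon₁₂ ν μ κ) :=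
  have h := (canon_implications₁₁ ν μ κ).liMp
  ⟨h, liMp_landed_implies_B6 h⟩

end Canon12

/-- With every input of the three DAGs (all-ones assignments), B6 as printed, its odd-orthogonal case and C28 through
B6 all hold — via the tranche's own composition theorems. [claim: LiuLoShahidi2024, under-review] (bookkeeping proved here) -/
theorem twelfth_holds_top :
    (canon₁₂ νtop μtop κtop).LLSantiTempered ∧ (canon₁₂ νtop μtop κtop).LLSoddOrth ∧ (canon₁₁ νtop).LiMpApackets :=
  have B := lls_both_of_inputs (canon_implications νtop μtop κtop) (canon_implications₅ νtop μtop κtop)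
    (canon_implications₁₂ νtop μtop κtop) bookInputs_top mokInputs_top (kmswInputs_top μtop).1
  ⟨B.1, B.2,
    liMpApacketsB6_of_leaves (canon_implications νtop μtop κtop) (canon_implications₂ νtop μtop κtop)
      (canon_implications₅ νtop μtop κtop) (canon_implications₁₁ νtop μtop κtop) (canon_implications₁₂ νtop μtop κtop)
      bookInputs_top⟩

/-- BOOK side: in each of the 24 book countermodels (canonical reading, in which every twelfth-tranche edge holds; Mok
and KMSW at the all-ones assignment) B6 as printed, its odd-orthogonal case and C28 all FAIL — every book leaf is
load-bearing for Liu–Lo–Shahidi in both readings and for W.-W. Li 2024 through them. [claim: LiuLoShahidi2024, under-review] (bookkeeping proved here) -/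
theorem twelfth_book_cm (l : LeafSupport.Leaf) :
    Implications12 (LeafSupport.mkN (LeafSupport.cm l)) μtop κtop (canon (LeafSupport.mkN (LeafSupport.cm l)) μtop κtop)
        (canon₂ (LeafSupport.mkN (LeafSupport.cm l)) μtop κtop) (canon₅ (LeafSupport.mkN (LeafSupport.cm l)) μtop κtop)
        (canon₁₁ (LeafSupport.mkN (LeafSupport.cm l))) (canon₁₂ (LeafSupport.mkN (LeafSupport.cm l)) μtop κtop) ∧
      ¬ (canon₁₂ (LeafSupport.mkN (LeafSupport.cm l)) μtop κtop).LLSantiTempered ∧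
      ¬ (canon₁₂ (LeafSupport.mkN (LeafSupport.cm l)) μtop κtop).LLSoddOrth ∧
      ¬ (canon₁₁ (LeafSupport.mkN (LeafSupport.cm l))).LiMpApackets :=
  ⟨canon_implications₁₂ _ μtop κtop, fun h => not_B_cm l h.1, not_B_cm l, not_B_cm l⟩

/-- MOK side: in each of the 29 Mok countermodels (Mok's section and supply edges and every other Mok leaf hold, the
removed leaf fails; book and KMSW at the all-ones assignment; canonical reading, every twelfth-tranche edge valid) B6
AS PRINTED FAILS — it treats unitary groups through Mok's memoir, so every Mok leaf is load-bearing — while its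
odd-orthogonal case and C28 HOLD: the metaplectic line does not inherit a unitary leaf through B6. [claim: LiuLoShahidi2024, under-review] (bookkeeping proved here) -/
theorem twelfth_mok_cm (l : Mok2015.LeafSupport.Leaf) :
    Mok2015.LeafSupport.Systems (Mok2015.LeafSupport.mkN (Mok2015.LeafSupport.cm l)) ∧
      (∀ l', l' ≠ l → (Mok2015.LeafSupport.mkN (Mok2015.LeafSupport.cm l)).leaf l') ∧
      ¬ (Mok2015.LeafSupport.mkN (Mok2015.LeafSupport.cm l)).leaf l ∧
      Implications12 νtop (Mok2015.LeafSupport.mkN (Mok2015.LeafSupport.cm l)) κtop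
        (canon νtop (Mok2015.LeafSupport.mkN (Mok2015.LeafSupport.cm l)) κtop)
        (canon₂ νtop (Mok2015.LeafSupport.mkN (Mok2015.LeafSupport.cm l)) κtop)
        (canon₅ νtop (Mok2015.LeafSupport.mkN (Mok2015.LeafSupport.cm l)) κtop) (canon₁₁ νtop)
        (canon₁₂ νtop (Mok2015.LeafSupport.mkN (Mok2015.LeafSupport.cm l)) κtop) ∧
      ¬ (canon₁₂ νtop (Mok2015.LeafSupport.mkN (Mok2015.LeafSupport.cm l)) κtop).LLSantiTempered ∧
      (canon₁₂ νtop (Mok2015.LeafSupport.mkN (Mok2015.LeafSupport.cm l)) κtop).LLSoddOrth ∧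
      (canon₁₁ νtop).LiMpApackets :=
  have cmod := Mok2015.LeafSupport.countermodel l
  have nm := not_M_cm l
  have b : ∀ N, νtop.Everything N := bookInputs_top.everything
  ⟨cmod.1, cmod.2.1, cmod.2.2.1, canon_implications₁₂ _ _ _, fun h => nm h.2.1, b, b⟩

/-- KMSW side: in each of KMSW's countermodels for a leaf `l ≠ MokMain` (KMSW's edges and every other KMSW leaf hold,
`l` fails; book and Mok at the all-ones assignment; canonical reading, every twelfth-tranche edge valid): B6 AS PRINTED
(which takes KMSW's proved scope) holds exactly when `l` is one of `AubertSS`, `KMS_A`, `KMS_B`, and fails otherwise —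
neither sequel is in its support —, while its odd-orthogonal case and C28 hold throughout. [claim: KalethaMinguezShinWhite2014, under-review] (bookkeeping proved here) -/
theorem twelfth_kmsw_cm (l : KMSW2014.LeafSupport.Leaf) (hl : l ≠ .MokMain) :
    (∃ ωκ, KMSW2014.LeafSupport.Systems (KMSW2014.LeafSupport.mkN (KMSW2014.LeafSupport.cm l)) ωκ) ∧
      (∀ l', l' ≠ l → (KMSW2014.LeafSupport.mkN (KMSW2014.LeafSupport.cm l)).leaf l') ∧
      ¬ (KMSW2014.LeafSupport.mkN (KMSW2014.LeafSupport.cm l)).leaf l ∧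
      KMSW2014.E_ImportMok μtop (KMSW2014.LeafSupport.mkN (KMSW2014.LeafSupport.cm l)) ∧
      Implications12 νtop μtop (KMSW2014.LeafSupport.mkN (KMSW2014.LeafSupport.cm l))
        (canon νtop μtop (KMSW2014.LeafSupport.mkN (KMSW2014.LeafSupport.cm l)))
        (canon₂ νtop μtop (KMSW2014.LeafSupport.mkN (KMSW2014.LeafSupport.cm l)))
        (canon₅ νtop μtop (KMSW2014.LeafSupport.mkN (KMSW2014.LeafSupport.cm l))) (canon₁₁ νtop)
        (canon₁₂ νtop μtop (KMSW2014.LeafSupport.mkN (KMSW2014.LeafSupport.cm l))) ∧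
      ((canon₁₂ νtop μtop (KMSW2014.LeafSupport.mkN (KMSW2014.LeafSupport.cm l))).LLSantiTempered ↔
          l.onlyFull = true) ∧
      (canon₁₂ νtop μtop (KMSW2014.LeafSupport.mkN (KMSW2014.LeafSupport.cm l))).LLSoddOrth ∧
      (canon₁₁ νtop).LiMpApackets := by
  have cmod := KMSW2014.LeafSupport.countermodel l
  have b : ∀ N, νtop.Everything N := bookInputs_top.everything
  have m : ∀ N, μtop.Everything N := mokInputs_top.everything
  refine ⟨⟨_, cmod.1⟩, cmod.2.1, cmod.2.2.1, fun _ => cmod.2.1 .MokMain (Ne.symm hl), canon_implications₁₂ _ _ _,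
    ?_, b, b⟩
  constructor
  · intro hs
    cases hb : l.onlyFull
    · exact absurd hs.2.2 fun hk =>
        KMSW2014.LeafSupport.not_scope_of (KMSW2014.LeafSupport.scope_fails l hb 0) (hk 0)
    · rfl
  · intro h
    exact ⟨b, m, scope_of_onlyFull l h⟩

/-- B6's TWO READINGS SEPARATED in one model: every input of the book granted (all-ones), KMSW at the all-ones
assignment, Mok at the carver's countermodel for its general weighted fundamental lemma; every twelfth-tranche edge
valid; the odd-orthogonal case and C28 hold, the printed theorem fails.  So typing C28's premise as B6-as-printed
would have put Mok's 29 leaves into the metaplectic line's displayed support; the case field keeps it at the book's 24. [claim: LiuLoShahidi2024, under-review] (bookkeeping proved here) -/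
theorem lls_readings_separated :
    ∃ μ : Mok2015.Nodes,
      Implications12 νtop μ κtop (canon νtop μ κtop) (canon₂ νtop μ κtop) (canon₅ νtop μ κtop) (canon₁₁ νtop)
          (canon₁₂ νtop μ κtop) ∧
        (canon₁₂ νtop μ κtop).LLSoddOrth ∧ (canon₁₁ νtop).LiMpApackets ∧ ¬ (canon₁₂ νtop μ κtop).LLSantiTempered :=
  have T := twelfth_mok_cm .WFL_general
  ⟨_, T.2.2.2.1, T.2.2.2.2.2.1, T.2.2.2.2.2.2, T.2.2.2.2.1⟩

/-! ## 17. Thirteenth tranche (v1.10, after `Downstream3.lean` v2): exact supports of Mœglin–Renard 2018; B6 / C28 / B42 unchanged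

Canonical reading: `MRpadicOrth` := the book's `Everything` together with the premise conjunction of the inner-form
stabilisation (`canon.StabInner`; Taïbi's Thm 4.0.1 is itself read as the book's output in `canon`); `MRpadic` := the
same with KMSW's `Scope`.  Certified: every thirteenth-tranche edge — [MR18]'s three and the three RE-ISSUED edges of
B6 / B42 — holds in that reading for arbitrary ν, μ, κ (`canon_implications₁₃`), next to the landed edges they re-issue
(`reissued_edges_canon`); all six statements of the tranche's display hold in the all-ones assignment
(`thirteenth_holds_top`); BOOK side: both [MR18] readings (and B42) FAIL in each of the 24 book countermodels
(`thirteenth_book_cm`); MOK side: in each of the 29 Mok countermodels, with KMSW read WITHOUT its import of Mok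
(`κnoMok`, KMSW's inputs then holding vacuously), [MR18] AS PRINTED FAILS — its unitary groups are KMSW's, whose scope
imports Mok — while its orthogonal case, B6's odd-orthogonal case and C28 HOLD and B6 as printed fails
(`thirteenth_mok_cm`): the supports certified in §16 are unchanged by the re-issue; KMSW side: for every KMSW leaf other
than `MokMain`, [MR18] as printed holds in the countermodel exactly when the leaf is one of `AubertSS`, `KMS_A`, `KMS_B`
(proved-scope pattern; neither sequel in its support), its orthogonal case throughout (`thirteenth_kmsw_cm`); and ONE
model separates [MR18]'s two readings with every input of the book granted (`mr_readings_separated`). -/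

section Canon13

variable (ν : Nodes) (μ : Mok2015.Nodes) (κ : KMSW2014.Nodes)

/-- The canonical reading of the thirteenth tranche. [cite: MoeglinRenard2018, §3.1 (canonical model; bookkeeping)] -/
abbrev canon₁₃ : Consumers13 where
  MRpadic := (∀ N, ν.Everything N) ∧ (ν.FL ∧ ν.WFL_split ∧ ν.WFL_general ∧ ν.STF_Arthur) ∧ (∀ N, κ.Scope N)
  MRpadicOrth := (∀ N, ν.Everything N) ∧ (ν.FL ∧ ν.WFL_split ∧ ν.WFL_general ∧ ν.STF_Arthur)

/-- Every thirteenth-tranche edge holds in the canonical reading (with the first-, second-, fifth- and twelfth-tranche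
canonical consumers), for arbitrary ν, μ, κ. [cite: MoeglinRenard2018, §3.1; AtobeMinguez2023; LiuLoShahidi2024 (bookkeeping proved here)] -/
theorem canon_implications₁₃ :
    Implications13 ν μ κ (canon ν μ κ) (canon₂ ν μ κ) (canon₅ ν μ κ) (canon₁₂ ν μ κ) (canon₁₃ ν κ) where
  mr := fun a s _ k => ⟨a, s, k⟩
  mrOrth := fun a s _ => ⟨a, s⟩
  mrCase := fun h => ⟨h.1, h.2.1⟩
  llsPrintedMR := fun a m k _ _ _ => ⟨a, m, k⟩
  llsOddMR := fun a _ _ _ => a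
  amB2 := fun a _ => a

/-- The landed edges and their re-issues side by side in the canonical reading: v1's `E_LLSantiTempered` /
`E_LLSoddOrth` (twelfth tranche) and the fifth tranche's `E_AtobeMinguez`, each followed by its thirteenth-tranche
re-issue obtained from it (`llsPrinted_landed_implies_MR`, `llsOdd_landed_implies_MR`, `atobeMinguez_landed_implies_B2`). [cite: Arthur2013, downstream register, rows B6, B42 (bookkeeping proved here)] -/
theorem reissued_edges_canon :
    (E_LLSantiTempered ν μ κ (canon ν μ κ) (canon₅ ν μ κ) (canon₁₂ ν μ κ) ∧
        E_LLSantiTemperedMR ν μ κ (canon ν μ κ) (canon₅ ν μ κ) (canon₁₂ ν μ κ) (canon₁₃ ν κ)) ∧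
      (E_LLSoddOrth ν (canon ν μ κ) (canon₅ ν μ κ) (canon₁₂ ν μ κ) ∧
        E_LLSoddOrthMR ν (canon ν μ κ) (canon₅ ν μ κ) (canon₁₂ ν μ κ) (canon₁₃ ν κ)) ∧
      (E_AtobeMinguez ν (canon₅ ν μ κ) ∧ E_AtobeMinguezB2 ν (canon₂ ν μ κ) (canon₅ ν μ κ)) :=
  have P := (canon_implications₁₂ ν μ κ).llsPrinted
  have O := (canon_implications₁₂ ν μ κ).llsOdd
  have B := (canon_implications₅ ν μ κ).atobeMinguez
  ⟨⟨P, llsPrinted_landed_implies_MR P⟩, ⟨O, llsOdd_landed_implies_MR O⟩, ⟨B, atobeMinguez_landed_implies_B2 B⟩⟩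

end Canon13

/-- With every input of the three DAGs (all-ones assignments): [MR18] in both readings, B6 in both readings reached
through [MR18], B42 through B2 and C28 through all of them hold — via the tranche's own composition theorems. [cite: MoeglinRenard2018, §3.1 (bookkeeping proved here)] -/
theorem thirteenth_holds_top :
    ((canon₁₃ νtop κtop).MRpadic ∧ (canon₁₃ νtop κtop).MRpadicOrth) ∧
      (canon₁₂ νtop μtop κtop).LLSantiTempered ∧
      ((canon₁₃ νtop κtop).MRpadicOrth ∧ (canon₅ νtop μtop κtop).AtobeMinguez ∧
        (canon₁₂ νtop μtop κtop).LLSoddOrth ∧ (canon₁₁ νtop).LiMpApackets) :=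
  have I := canon_implications νtop μtop κtop
  have G := canon_implications₁₃ νtop μtop κtop
  ⟨mrpadic_both_of_inputs I G bookInputs_top mokInputs_top (kmswInputs_top μtop).1,
    llsAntiTemperedMR_of_leaves I (canon_implications₅ νtop μtop κtop) G bookInputs_top mokInputs_top
      (kmswInputs_top μtop).1,
    thirteenth_book_line I (canon_implications₂ νtop μtop κtop) (canon_implications₅ νtop μtop κtop)
      (canon_implications₁₁ νtop μtop κtop) (canon_implications₁₂ νtop μtop κtop) G bookInputs_top⟩

/-- BOOK side: in each of the 24 book countermodels (canonical reading, every thirteenth-tranche edge valid; Mok and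
KMSW at the all-ones assignment) [MR18] FAILS in both readings, and so does B42 — every book leaf is load-bearing for
Mœglin–Renard 2018 and (unchanged from §9) for Atobe–Mínguez. [cite: MoeglinRenard2018, §3.1 (bookkeeping proved here)] -/
theorem thirteenth_book_cm (l : LeafSupport.Leaf) :
    Implications13 (LeafSupport.mkN (LeafSupport.cm l)) μtop κtop (canon (LeafSupport.mkN (LeafSupport.cm l)) μtop κtop)
        (canon₂ (LeafSupport.mkN (LeafSupport.cm l)) μtop κtop) (canon₅ (LeafSupport.mkN (LeafSupport.cm l)) μtop κtop)
        (canon₁₂ (LeafSupport.mkN (LeafSupport.cm l)) μtop κtop) (canon₁₃ (LeafSupport.mkN (LeafSupport.cm l)) κtop) ∧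
      ¬ (canon₁₃ (LeafSupport.mkN (LeafSupport.cm l)) κtop).MRpadic ∧
      ¬ (canon₁₃ (LeafSupport.mkN (LeafSupport.cm l)) κtop).MRpadicOrth ∧
      ¬ (canon₅ (LeafSupport.mkN (LeafSupport.cm l)) μtop κtop).AtobeMinguez :=
  ⟨canon_implications₁₃ _ μtop κtop, fun h => not_B_cm l h.1, fun h => not_B_cm l h.1, not_B_cm l⟩

/-- MOK side: in each of the 29 Mok countermodels (Mok's section and supply edges and every other Mok leaf hold, the
removed leaf fails), with the book at the all-ones assignment and KMSW read WITHOUT its import of Mok (`κnoMok`: every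
KMSW leaf but `MokMain`, so that KMSW's inputs `KMSWInputs μ κ` hold — the import edge vacuously — and both sequels
too), canonical reading, every thirteenth-tranche edge valid: [MR18] AS PRINTED FAILS — its unitary groups are taken
from KMSW, whose proved scope imports Mok's main theorems, so every Mok leaf is load-bearing — while its ORTHOGONAL
case HOLDS; and, unchanged from §16 under the re-issued edges, B6's odd-orthogonal case and C28 hold while B6 as
printed fails. [cite: MoeglinRenard2018, p0008:L38 with KalethaMinguezShinWhite2014 main.tex l.69 (bookkeeping proved here)] -/
theorem thirteenth_mok_cm (l : Mok2015.LeafSupport.Leaf) :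
    Mok2015.LeafSupport.Systems (Mok2015.LeafSupport.mkN (Mok2015.LeafSupport.cm l)) ∧
      (∀ l', l' ≠ l → (Mok2015.LeafSupport.mkN (Mok2015.LeafSupport.cm l)).leaf l') ∧
      ¬ (Mok2015.LeafSupport.mkN (Mok2015.LeafSupport.cm l)).leaf l ∧
      (KMSWInputs (Mok2015.LeafSupport.mkN (Mok2015.LeafSupport.cm l)) κnoMok ∧ κnoMok.UnwrittenSequels) ∧
      Implications13 νtop (Mok2015.LeafSupport.mkN (Mok2015.LeafSupport.cm l)) κnoMok
        (canon νtop (Mok2015.LeafSupport.mkN (Mok2015.LeafSupport.cm l)) κnoMok)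
        (canon₂ νtop (Mok2015.LeafSupport.mkN (Mok2015.LeafSupport.cm l)) κnoMok)
        (canon₅ νtop (Mok2015.LeafSupport.mkN (Mok2015.LeafSupport.cm l)) κnoMok)
        (canon₁₂ νtop (Mok2015.LeafSupport.mkN (Mok2015.LeafSupport.cm l)) κnoMok) (canon₁₃ νtop κnoMok) ∧
      (¬ (canon₁₃ νtop κnoMok).MRpadic ∧ (canon₁₃ νtop κnoMok).MRpadicOrth) ∧
      (¬ (canon₁₂ νtop (Mok2015.LeafSupport.mkN (Mok2015.LeafSupport.cm l)) κnoMok).LLSantiTempered ∧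
        (canon₁₂ νtop (Mok2015.LeafSupport.mkN (Mok2015.LeafSupport.cm l)) κnoMok).LLSoddOrth ∧
        (canon₁₁ νtop).LiMpApackets) :=
  have cmod := Mok2015.LeafSupport.countermodel l
  have nm := not_M_cm l
  have kf := κnoMok_facts
  have nk : ¬ ∀ N, κnoMok.Scope N := fun h => kf.2.2.2.2.2.1 0 (h 0)
  have KI : KMSWInputs (Mok2015.LeafSupport.mkN (Mok2015.LeafSupport.cm l)) κnoMok :=
    ⟨fun hM => absurd hM nm, kf.1.chapter, kf.1.supply, kf.2.2.1, kf.2.2.2.1⟩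
  have b : ∀ N, νtop.Everything N := bookInputs_top.everything
  have S : (canon νtop (Mok2015.LeafSupport.mkN (Mok2015.LeafSupport.cm l)) κnoMok).StabInner :=
    stabInner_of_leaves (canon_implications νtop _ κnoMok) bookInputs_top.published bookInputs_top.unwritten
  ⟨cmod.1, cmod.2.1, cmod.2.2.1, ⟨KI, kf.2.2.2.2.1⟩, canon_implications₁₃ _ _ _, ⟨fun h => nk h.2.2, ⟨b, S⟩⟩,
    ⟨fun h => nm h.2.1, b, b⟩⟩

/-- KMSW side: in each of KMSW's countermodels for a leaf `l ≠ MokMain` (KMSW's edges and every other KMSW leaf hold,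
`l` fails; book and Mok at the all-ones assignment; canonical reading, every thirteenth-tranche edge valid): [MR18] AS
PRINTED (which takes KMSW's proved scope for its unitary groups) holds exactly when `l` is one of `AubertSS`, `KMS_A`,
`KMS_B`, and fails otherwise — neither sequel is in its support —, while its orthogonal case holds throughout. [claim: KalethaMinguezShinWhite2014, under-review] (bookkeeping proved here) -/
theorem thirteenth_kmsw_cm (l : KMSW2014.LeafSupport.Leaf) (hl : l ≠ .MokMain) :
    (∃ ωκ, KMSW2014.LeafSupport.Systems (KMSW2014.LeafSupport.mkN (KMSW2014.LeafSupport.cm l)) ωκ) ∧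
      (∀ l', l' ≠ l → (KMSW2014.LeafSupport.mkN (KMSW2014.LeafSupport.cm l)).leaf l') ∧
      ¬ (KMSW2014.LeafSupport.mkN (KMSW2014.LeafSupport.cm l)).leaf l ∧
      KMSW2014.E_ImportMok μtop (KMSW2014.LeafSupport.mkN (KMSW2014.LeafSupport.cm l)) ∧
      Implications13 νtop μtop (KMSW2014.LeafSupport.mkN (KMSW2014.LeafSupport.cm l))
        (canon νtop μtop (KMSW2014.LeafSupport.mkN (KMSW2014.LeafSupport.cm l)))
        (canon₂ νtop μtop (KMSW2014.LeafSupport.mkN (KMSW2014.LeafSupport.cm l)))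
        (canon₅ νtop μtop (KMSW2014.LeafSupport.mkN (KMSW2014.LeafSupport.cm l)))
        (canon₁₂ νtop μtop (KMSW2014.LeafSupport.mkN (KMSW2014.LeafSupport.cm l)))
        (canon₁₃ νtop (KMSW2014.LeafSupport.mkN (KMSW2014.LeafSupport.cm l))) ∧
      ((canon₁₃ νtop (KMSW2014.LeafSupport.mkN (KMSW2014.LeafSupport.cm l))).MRpadic ↔ l.onlyFull = true) ∧
      (canon₁₃ νtop (KMSW2014.LeafSupport.mkN (KMSW2014.LeafSupport.cm l))).MRpadicOrth := by
  have cmod := KMSW2014.LeafSupport.countermodel l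
  have b : ∀ N, νtop.Everything N := bookInputs_top.everything
  have S : (canon νtop μtop (KMSW2014.LeafSupport.mkN (KMSW2014.LeafSupport.cm l))).StabInner :=
    stabInner_of_leaves (canon_implications νtop μtop _) bookInputs_top.published bookInputs_top.unwritten
  refine ⟨⟨_, cmod.1⟩, cmod.2.1, cmod.2.2.1, fun _ => cmod.2.1 .MokMain (Ne.symm hl), canon_implications₁₃ _ _ _,
    ?_, ⟨b, S⟩⟩
  constructor
  · intro hs
    cases hb : l.onlyFull
    · exact absurd hs.2.2 fun hk =>
        KMSW2014.LeafSupport.not_scope_of (KMSW2014.LeafSupport.scope_fails l hb 0) (hk 0)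
    · rfl
  · intro h
    exact ⟨b, S, scope_of_onlyFull l h⟩

/-- [MR18]'s TWO READINGS SEPARATED in one model: every input of the book granted (all-ones), Mok at the carver's
countermodel for its general weighted fundamental lemma, KMSW without its import of Mok; every thirteenth-tranche edge
valid; the orthogonal case holds, the printed statements fail.  So binding B6's odd-orthogonal case (and through it
C28) to [MR18]-as-printed would have put KMSW's scope and Mok's leaves into the metaplectic line's displayed support;
the orthogonal reading keeps it at the book's 24. [cite: MoeglinRenard2018, p0008:L37-38 (bookkeeping proved here)] -/
theorem mr_readings_separated :
    ∃ (μ : Mok2015.Nodes) (κ : KMSW2014.Nodes),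
      Implications13 νtop μ κ (canon νtop μ κ) (canon₂ νtop μ κ) (canon₅ νtop μ κ) (canon₁₂ νtop μ κ) (canon₁₃ νtop κ) ∧
        (canon₁₃ νtop κ).MRpadicOrth ∧ (canon₁₂ νtop μ κ).LLSoddOrth ∧ (canon₁₁ νtop).LiMpApackets ∧
        ¬ (canon₁₃ νtop κ).MRpadic :=
  have T := thirteenth_mok_cm .WFL_general
  ⟨_, _, T.2.2.2.2.1, T.2.2.2.2.2.1.2, T.2.2.2.2.2.2.2.1, T.2.2.2.2.2.2.2.2, T.2.2.2.2.2.1.1⟩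

/-! ## 18. Fourteenth tranche (v1.11, after `Downstream3.lean` v3): exact support of the control E41 (Mœglin 2014)

Canonical reading: `MoeglinStable` := the conjunction of its edge's seven premises (`A11_twisted`, `TWFL`,
`WFL_nonstandard`, `FL`, `TwistedTF`, `MW_Stab`, `LLC_GLN`).  Certified: the edge holds in that reading for every ν
(`canon_implications₁₄`); E41 holds in the all-ones assignment (`fourteenth_holds_top`); in the carver's countermodel
`cm l` for a book leaf `l` — every book edge valid, every other leaf true, `l` false — E41 HOLDS whenever `l` is none of
the eight leaves `LLC_GLN`, `A11_twisted`, `W4_Thm38`, `WFL_general`, `WFL_nonstandard`, `FL`, `TwistedTF`, `MW_Stab`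
(`moeglinStable_cm_holds`), in particular for each of the SEVEN PREPRINT LEAVES (AGIKMS ×5, KM26, CK26) while
everything the book establishes fails there (`moeglinStable_indep_preprint_layer`) — E41 is independent of the
[A24]–[A27] / AGIKMS / LIR layer —, and E41 FAILS in `cm l` for each of those eight leaves (`moeglinStable_cm_fails`;
for `W4_Thm38` and `WFL_general` through the derived node `TWFL`, false in the least model): its support is exactly
those 8 of the 24, the two unwritten weighted fundamental lemmas among them.  `moeglinStable_vs_book` puts the two
facts side by side for the AGIKMS Theorem-1.8.1 leaf. -/

section Canon14

variable (ν : Nodes)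

/-- The canonical reading of the fourteenth tranche. [cite: Moeglin2014Stable, Thm 32 (canonical model; bookkeeping)] -/
abbrev canon₁₄ : Consumers14 where
  MoeglinStable := ν.A11_twisted ∧ ν.TWFL ∧ ν.WFL_nonstandard ∧ ν.FL ∧ ν.TwistedTF ∧ ν.MW_Stab ∧ ν.LLC_GLN

/-- E41's edge holds in the canonical reading, for every ν. [cite: Moeglin2014Stable, Thm 32 (bookkeeping proved here)] -/
theorem canon_implications₁₄ : Implications14 ν (canon₁₄ ν) where
  moeglin := fun a b c d e f g => ⟨a, b, c, d, e, f, g⟩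

end Canon14

/-- With every input of the book (all-ones assignment) E41 holds — via the tranche's `moeglinStable_of_bookInputs`. [cite: Moeglin2014Stable, Thm 32 (bookkeeping proved here)] -/
theorem fourteenth_holds_top : (canon₁₄ νtop).MoeglinStable :=
  moeglinStable_of_bookInputs (canon_implications₁₄ νtop) bookInputs_top

/-- E41 HOLDS in the carver's countermodel for every book leaf outside its eight-leaf support: the seven premises are
other leaves (true there) or — `TWFL` — derived from other leaves by the supply edge [W4, Thm 3.8]. [cite: Moeglin2014Stable, p0005:L30 with Waldspurger2008 Thm 3.8 (bookkeeping proved here)] -/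
theorem moeglinStable_cm_holds (l : LeafSupport.Leaf) (h₁ : l ≠ .A11_twisted) (h₂ : l ≠ .W4_Thm38)
    (h₃ : l ≠ .WFL_general) (h₄ : l ≠ .WFL_nonstandard) (h₅ : l ≠ .FL) (h₆ : l ≠ .TwistedTF) (h₇ : l ≠ .MW_Stab)
    (h₈ : l ≠ .LLC_GLN) : (canon₁₄ (LeafSupport.mkN (LeafSupport.cm l))).MoeglinStable :=
  have cmod := LeafSupport.countermodel l
  have o := cmod.2.1
  have n : (LeafSupport.mkN (LeafSupport.cm l)).WFL_nonstandard := o .WFL_nonstandard (Ne.symm h₄)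
  ⟨o .A11_twisted (Ne.symm h₁),
    cmod.1.supply.twfl (o .W4_Thm38 (Ne.symm h₂)) (o .WFL_general (Ne.symm h₃)) n, n, o .FL (Ne.symm h₅),
    o .TwistedTF (Ne.symm h₆), o .MW_Stab (Ne.symm h₇), o .LLC_GLN (Ne.symm h₈)⟩

/-- E41 IS INDEPENDENT OF THE 2024–2026 PREPRINT LAYER: in the carver's countermodel for each of the seven preprint
leaves (AGIKMS Thm 1.8.1 / 1.9.1 / 1.10.5 / Cor. D.2.1 / App. E, [KM26], [CK26]) — every book edge valid, every other
leaf true, E41's edge valid in the canonical reading — Mœglin's stable-packet parametrisation HOLDS while everything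
the book establishes FAILS at every rank.  No other typed downstream statement of the register has this property (each
consumes `∀ N, ν.Everything N` or a Chapter-9 / KMSW / Mok node). [cite: Moeglin2014Stable, p0002:L5, p0005:L30 (bookkeeping proved here)] -/
theorem moeglinStable_indep_preprint_layer (l : LeafSupport.Leaf)
    (hl : l = .AGIKMS_181 ∨ l = .AGIKMS_191 ∨ l = .AGIKMS_1105 ∨ l = .AGIKMS_D21 ∨ l = .AGIKMS_AppE ∨ l = .KM26 ∨
      l = .CK26) :
    Implications14 (LeafSupport.mkN (LeafSupport.cm l)) (canon₁₄ (LeafSupport.mkN (LeafSupport.cm l))) ∧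
      (canon₁₄ (LeafSupport.mkN (LeafSupport.cm l))).MoeglinStable ∧
      ¬ ∀ N, (LeafSupport.mkN (LeafSupport.cm l)).Everything N := by
  refine ⟨canon_implications₁₄ _, ?_, not_B_cm l⟩
  rcases hl with rfl | rfl | rfl | rfl | rfl | rfl | rfl <;>
    exact moeglinStable_cm_holds _ (by decide) (by decide) (by decide) (by decide) (by decide) (by decide) (by decide)
      (by decide)

/-- E41's SUPPORT, the other half: in the carver's countermodel for each of the eight leaves `LLC_GLN`, `A11_twisted`,
`W4_Thm38`, `WFL_general`, `WFL_nonstandard`, `FL`, `TwistedTF`, `MW_Stab` (edge valid, canonical reading) E41 FAILS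
— for `W4_Thm38` and `WFL_general` because the derived `TWFL` is false in the least model.  So E41 rests on exactly
these 8 of the 24 book leaves, the two UNWRITTEN weighted fundamental lemmas included (`WFL_general` through `TWFL`,
`WFL_nonstandard` directly). [cite: Moeglin2014Stable, p0005:L30 (bookkeeping proved here)] -/
theorem moeglinStable_cm_fails (l : LeafSupport.Leaf)
    (hl : l = .A11_twisted ∨ l = .W4_Thm38 ∨ l = .WFL_general ∨ l = .WFL_nonstandard ∨ l = .FL ∨ l = .TwistedTF ∨
      l = .MW_Stab ∨ l = .LLC_GLN) :
    Implications14 (LeafSupport.mkN (LeafSupport.cm l)) (canon₁₄ (LeafSupport.mkN (LeafSupport.cm l))) ∧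
      ¬ (canon₁₄ (LeafSupport.mkN (LeafSupport.cm l))).MoeglinStable := by
  refine ⟨canon_implications₁₄ _, ?_⟩
  rcases hl with rfl | rfl | rfl | rfl | rfl | rfl | rfl | rfl <;> intro h
  · exact absurd ((LeafSupport.prop_mk _ 0 .A11_twisted).1 h.1) (by decide)
  · exact absurd ((LeafSupport.prop_mk _ 0 .TWFL).1 h.2.1) (by decide)
  · exact absurd ((LeafSupport.prop_mk _ 0 .TWFL).1 h.2.1) (by decide)
  · exact absurd ((LeafSupport.prop_mk _ 0 .WFL_nonstandard).1 h.2.2.1) (by decide)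
  · exact absurd ((LeafSupport.prop_mk _ 0 .FL).1 h.2.2.2.1) (by decide)
  · exact absurd ((LeafSupport.prop_mk _ 0 .TwistedTF).1 h.2.2.2.2.1) (by decide)
  · exact absurd ((LeafSupport.prop_mk _ 0 .MW_Stab).1 h.2.2.2.2.2.1) (by decide)
  · exact absurd ((LeafSupport.prop_mk _ 0 .LLC_GLN).1 h.2.2.2.2.2.2) (by decide)

/-- SIDE BY SIDE for the AGIKMS Theorem-1.8.1 leaf (the supplier of [A27]): in its countermodel every typed BOOK
consumer of the first tranche fails (`BookConsumersFail`, from `book_leaf_support`'s ingredients: canonical reading)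
while E41 holds. [cite: Moeglin2014Stable, p0005:L30; AGIKMS2024 Thm 1.8.1 (bookkeeping proved here)] -/
theorem moeglinStable_vs_book :
    (canon₁₄ (LeafSupport.mkN (LeafSupport.cm .AGIKMS_181))).MoeglinStable ∧
      ¬ (canon (LeafSupport.mkN (LeafSupport.cm .AGIKMS_181)) μtop κtop).TaibiInner ∧
      ¬ (canon₂ (LeafSupport.mkN (LeafSupport.cm .AGIKMS_181)) μtop κtop).XuMoeglinParam ∧
      ¬ (canon₅ (LeafSupport.mkN (LeafSupport.cm .AGIKMS_181)) μtop κtop).AtobeMinguez ∧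
      ¬ (canon₁₂ (LeafSupport.mkN (LeafSupport.cm .AGIKMS_181)) μtop κtop).LLSoddOrth :=
  have nb := not_B_cm .AGIKMS_181
  ⟨(moeglinStable_indep_preprint_layer .AGIKMS_181 (Or.inl rfl)).2.1, nb, nb, nb, nb⟩

/-! ## 19. Fifteenth tranche (v1.12, after `Downstream3.lean` v4): exact supports of B. Xu's global L-packets of GSp(2n), GO(2n) (row A15), of his similitude LLC, and of row A14

Canonical reading: `XuLifting` := `∀ N, ν.Everything N`; `XuGlobal` := the book's `Everything` together with the
premise conjunctions of the two similitude stabilisations (`canon.StabOrdSim`, `canon.StabTwSim`) and the three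
published leaves the edge names (`LLC_GLN`, `FL`, `ArchInputs_published`); `XuSimLLC` := the same conjoined with
`∀ N, μ.Everything N`.  Certified: every fifteenth-tranche edge holds in that reading for arbitrary ν, μ, κ
(`canon_implications₁₅`); the three statements hold in the all-ones assignments (`fifteenth_holds_top`); BOOK side:
all three FAIL in each of the 24 book countermodels (`fifteenth_book_cm`) — every book leaf is load-bearing for A14,
for A15's main theorems and for its Thm 8.12; MOK side: in each of the 29 Mok countermodels (Mok's section and supply
edges and every other Mok leaf hold, the removed leaf fails; book and KMSW at the all-ones assignment) A14, A15's main
theorems and row A7 HOLD while the similitude LLC FAILS (`fifteenth_mok_cm`) — every Mok leaf is load-bearing for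
Thm 8.12 (through the η-twisted endoscopic groups U_{E/F}(n) of §10) and none for Thms 1.1/1.2; KMSW side: no κ occurs
in the three edges, and in each KMSW countermodel all three statements hold (`fifteenth_kmsw_cm`); ONE model separates
the two A15 statements with every input of the book granted (`xu_supports_separated`). -/

section Canon15

variable (ν : Nodes) (μ : Mok2015.Nodes) (κ : KMSW2014.Nodes)

/-- The canonical reading of the fifteenth tranche. [cite: Xu2025Global, Thms 1.1/1.2, 8.12; Xu2016Lifting §6.5 (canonical model; bookkeeping)] -/
abbrev canon₁₅ : Consumers15 where
  XuLifting := ∀ N, ν.Everything N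
  XuGlobal := (∀ N, ν.Everything N) ∧ (ν.FL ∧ ν.WFL_split ∧ ν.WFL_general ∧ ν.STF_Arthur) ∧
    (ν.TWFL ∧ ν.WFL_nonstandard ∧ ν.FL ∧ ν.TwistedTF ∧ ν.MW_Stab) ∧ (ν.LLC_GLN ∧ ν.FL ∧ ν.ArchInputs_published)
  XuSimLLC := ((∀ N, ν.Everything N) ∧ (ν.FL ∧ ν.WFL_split ∧ ν.WFL_general ∧ ν.STF_Arthur) ∧
    (ν.TWFL ∧ ν.WFL_nonstandard ∧ ν.FL ∧ ν.TwistedTF ∧ ν.MW_Stab) ∧ (ν.LLC_GLN ∧ ν.FL ∧ ν.ArchInputs_published)) ∧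
    (∀ N, μ.Everything N)

/-- Every fifteenth-tranche edge holds in the canonical reading (with the first-tranche canonical consumers), for
arbitrary ν, μ, κ. [cite: Xu2025Global, Thms 1.1/1.2, 8.12; Xu2016Lifting §6.5 (bookkeeping proved here)] -/
theorem canon_implications₁₅ : Implications15 ν μ (canon ν μ κ) (canon₁₅ ν μ) where
  xuLifting := fun a => a
  xuGlobal := fun a s t _ l f r => ⟨a, s, t, l, f, r⟩
  xuSimLLC := fun a m s t _ _ l f r => ⟨⟨a, s, t, l, f, r⟩, m⟩

end Canon15

/-- With every input of the book and of Mok's memoir (all-ones assignments): A14, A15's main theorems and its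
similitude LLC hold — via the tranche's own composition theorems. [cite: Xu2025Global, Thms 1.1/1.2, 8.12 (bookkeeping proved here)] -/
theorem fifteenth_holds_top :
    (canon₁₅ νtop μtop).XuLifting ∧ (canon₁₅ νtop μtop).XuGlobal ∧ (canon₁₅ νtop μtop).XuSimLLC :=
  have I := canon_implications νtop μtop κtop
  have K := canon_implications₁₅ νtop μtop κtop
  ⟨xuLifting_of_leaves K bookInputs_top, xu_two_supports I K bookInputs_top mokInputs_top⟩

/-- BOOK side: in each of the 24 book countermodels (canonical reading, every fifteenth-tranche edge valid; Mok and
KMSW at the all-ones assignment) A14, A15's main theorems and its similitude LLC all FAIL — every book leaf is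
load-bearing for the similitude line. [cite: Xu2025Global, Thms 1.1/1.2, 8.12; Xu2016Lifting §6.5 (bookkeeping proved here)] -/
theorem fifteenth_book_cm (l : LeafSupport.Leaf) :
    Implications15 (LeafSupport.mkN (LeafSupport.cm l)) μtop (canon (LeafSupport.mkN (LeafSupport.cm l)) μtop κtop)
        (canon₁₅ (LeafSupport.mkN (LeafSupport.cm l)) μtop) ∧
      ¬ (canon₁₅ (LeafSupport.mkN (LeafSupport.cm l)) μtop).XuLifting ∧
      ¬ (canon₁₅ (LeafSupport.mkN (LeafSupport.cm l)) μtop).XuGlobal ∧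
      ¬ (canon₁₅ (LeafSupport.mkN (LeafSupport.cm l)) μtop).XuSimLLC :=
  ⟨canon_implications₁₅ _ μtop κtop, not_B_cm l, fun h => not_B_cm l h.1, fun h => not_B_cm l h.1.1⟩

/-- MOK side: in each of the 29 Mok countermodels (Mok's section and supply edges and every other Mok leaf hold, the
removed leaf fails; the book at the all-ones assignment; canonical reading, every fifteenth-tranche edge valid): A14,
A15's MAIN THEOREMS and row A7 HOLD, while A15's similitude LLC (Thm 8.12 through Thm 10.1, whose proof globalises
parameters of U_{E/F}(n) and uses their stable trace formulas after [Mok:2014]) FAILS — every one of Mok's 29 leaves,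
his two unwritten weighted fundamental lemmas included, is load-bearing for Thm 8.12 and for nothing else in the
paper. [cite: Xu2025Global, Thm 10.1 proof (p0031:L94, p0033:L20-26) vs Thms 1.1/1.2 (bookkeeping proved here)] -/
theorem fifteenth_mok_cm (l : Mok2015.LeafSupport.Leaf) :
    Mok2015.LeafSupport.Systems (Mok2015.LeafSupport.mkN (Mok2015.LeafSupport.cm l)) ∧
      (∀ l', l' ≠ l → (Mok2015.LeafSupport.mkN (Mok2015.LeafSupport.cm l)).leaf l') ∧
      ¬ (Mok2015.LeafSupport.mkN (Mok2015.LeafSupport.cm l)).leaf l ∧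
      Implications15 νtop (Mok2015.LeafSupport.mkN (Mok2015.LeafSupport.cm l))
        (canon νtop (Mok2015.LeafSupport.mkN (Mok2015.LeafSupport.cm l)) κtop)
        (canon₁₅ νtop (Mok2015.LeafSupport.mkN (Mok2015.LeafSupport.cm l))) ∧
      ((canon₁₅ νtop (Mok2015.LeafSupport.mkN (Mok2015.LeafSupport.cm l))).XuLifting ∧
        (canon₁₅ νtop (Mok2015.LeafSupport.mkN (Mok2015.LeafSupport.cm l))).XuGlobal ∧
        (canon νtop (Mok2015.LeafSupport.mkN (Mok2015.LeafSupport.cm l)) κtop).XuGSp) ∧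
      ¬ (canon₁₅ νtop (Mok2015.LeafSupport.mkN (Mok2015.LeafSupport.cm l))).XuSimLLC :=
  have cmod := Mok2015.LeafSupport.countermodel l
  have nm := not_M_cm l
  have I := canon_implications νtop (Mok2015.LeafSupport.mkN (Mok2015.LeafSupport.cm l)) κtop
  have K := canon_implications₁₅ νtop (Mok2015.LeafSupport.mkN (Mok2015.LeafSupport.cm l)) κtop
  ⟨cmod.1, cmod.2.1, cmod.2.2.1, K,
    ⟨xuLifting_of_leaves K bookInputs_top, xuGlobal_of_leaves I K bookInputs_top, xu_of_leaves I bookInputs_top⟩,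
    fun h => nm h.2⟩

/-- KMSW side: no statement of Kaletha–Mínguez–Shin–White occurs in the three edges; in each of KMSW's countermodels
(KMSW's edges and every other KMSW leaf hold, the removed leaf fails; book and Mok at the all-ones assignment; every
fifteenth-tranche edge valid) all three statements hold. [claim: KalethaMinguezShinWhite2014, under-review] (bookkeeping proved here) -/
theorem fifteenth_kmsw_cm (l : KMSW2014.LeafSupport.Leaf) :
    (∃ ωκ, KMSW2014.LeafSupport.Systems (KMSW2014.LeafSupport.mkN (KMSW2014.LeafSupport.cm l)) ωκ) ∧
      (∀ l', l' ≠ l → (KMSW2014.LeafSupport.mkN (KMSW2014.LeafSupport.cm l)).leaf l') ∧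
      ¬ (KMSW2014.LeafSupport.mkN (KMSW2014.LeafSupport.cm l)).leaf l ∧
      Implications15 νtop μtop (canon νtop μtop (KMSW2014.LeafSupport.mkN (KMSW2014.LeafSupport.cm l)))
        (canon₁₅ νtop μtop) ∧
      ((canon₁₅ νtop μtop).XuLifting ∧ (canon₁₅ νtop μtop).XuGlobal ∧ (canon₁₅ νtop μtop).XuSimLLC) :=
  have cmod := KMSW2014.LeafSupport.countermodel l
  ⟨⟨_, cmod.1⟩, cmod.2.1, cmod.2.2.1, canon_implications₁₅ _ _ _, fifteenth_holds_top⟩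

/-- A15's TWO SUPPORTS SEPARATED in one model: every input of the book granted (all-ones), Mok at the carver's
countermodel for his general weighted fundamental lemma; every fifteenth-tranche edge valid; the global L-packets
(Thms 1.1/1.2) hold, the similitude LLC (Thm 8.12) fails.  So binding Mok's memoir into the main theorems' edge would
have mis-displayed their support; leaving it out of Thm 8.12's edge would have under-displayed its. [cite: Xu2025Global, Thms 1.1/1.2 vs Thm 8.12 (bookkeeping proved here)] -/
theorem xu_supports_separated :
    ∃ μ : Mok2015.Nodes, Implications15 νtop μ (canon νtop μ κtop) (canon₁₅ νtop μ) ∧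
      (canon₁₅ νtop μ).XuGlobal ∧ ¬ (canon₁₅ νtop μ).XuSimLLC :=
  have T := fifteenth_mok_cm .WFL_general
  ⟨_, T.2.2.2.1, T.2.2.2.2.1.2.1, T.2.2.2.2.2⟩

/-! ## 20. Sixteenth tranche (v1.13, after `Downstream3.lean` v5): exact support of B. Xu's p-adic Arthur packets of GSp(2n), GO(2n) (row A16)

Canonical reading: `XuApadic` := the reading of `XuSimLLC` (the book's `Everything`, the two similitude
stabilisations, the three published leaves, and `∀ N, μ.Everything N`) — its other premises `XuGSp`, `XuMoeglinParam`,
`LLC_GLN` are already inside.  Certified: the edge holds in that reading for arbitrary ν, μ, κ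
(`canon_implications₁₆`); A16 holds in the all-ones assignments (`sixteenth_holds_top`); BOOK side: A16 FAILS in each
of the 24 book countermodels (`sixteenth_book_cm`); MOK side: in each of the 29 Mok countermodels A16 FAILS while A7,
B2 and A15's main theorems hold (`sixteenth_mok_cm`) — every Mok leaf is load-bearing for the p-adic Arthur packets of
the similitude groups, two citations deep; KMSW side: no κ in the edge, A16 holds in each KMSW countermodel
(`sixteenth_kmsw_cm`). -/

section Canon16

variable (ν : Nodes) (μ : Mok2015.Nodes) (κ : KMSW2014.Nodes)

/-- The canonical reading of the sixteenth tranche. [cite: Xu2024Apadic, Thm 6.4 (canonical model; bookkeeping)] -/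
abbrev canon₁₆ : Consumers16 where
  XuApadic := ((∀ N, ν.Everything N) ∧ (ν.FL ∧ ν.WFL_split ∧ ν.WFL_general ∧ ν.STF_Arthur) ∧
    (ν.TWFL ∧ ν.WFL_nonstandard ∧ ν.FL ∧ ν.TwistedTF ∧ ν.MW_Stab) ∧ (ν.LLC_GLN ∧ ν.FL ∧ ν.ArchInputs_published)) ∧
    (∀ N, μ.Everything N)

/-- A16's edge holds in the canonical reading (with the first-, second- and fifteenth-tranche canonical consumers),
for arbitrary ν, μ, κ. [cite: Xu2024Apadic, Thm 6.4 (bookkeeping proved here)] -/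
theorem canon_implications₁₆ : Implications16 ν (canon ν μ κ) (canon₂ ν μ κ) (canon₁₅ ν μ) (canon₁₆ ν μ) where
  xuApadic := fun _ _ _ s _ => s

end Canon16

/-- With every input of the book and of Mok's memoir (all-ones assignments) A16 holds — via the tranche's own
composition theorem. [cite: Xu2024Apadic, Thm 6.4 (bookkeeping proved here)] -/
theorem sixteenth_holds_top : (canon₁₆ νtop μtop).XuApadic :=
  xuApadic_of_leaves (canon_implications νtop μtop κtop) (canon_implications₂ νtop μtop κtop)
    (canon_implications₁₅ νtop μtop κtop) (canon_implications₁₆ νtop μtop κtop) bookInputs_top mokInputs_top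

/-- BOOK side: in each of the 24 book countermodels (canonical reading, the edge valid; Mok and KMSW at the all-ones
assignment) A16 FAILS. [cite: Xu2024Apadic, Thm 6.4 (bookkeeping proved here)] -/
theorem sixteenth_book_cm (l : LeafSupport.Leaf) :
    Implications16 (LeafSupport.mkN (LeafSupport.cm l)) (canon (LeafSupport.mkN (LeafSupport.cm l)) μtop κtop)
        (canon₂ (LeafSupport.mkN (LeafSupport.cm l)) μtop κtop) (canon₁₅ (LeafSupport.mkN (LeafSupport.cm l)) μtop)
        (canon₁₆ (LeafSupport.mkN (LeafSupport.cm l)) μtop) ∧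
      ¬ (canon₁₆ (LeafSupport.mkN (LeafSupport.cm l)) μtop).XuApadic :=
  ⟨canon_implications₁₆ _ μtop κtop, fun h => not_B_cm l h.1.1⟩

/-- MOK side: in each of the 29 Mok countermodels (Mok's section and supply edges and every other Mok leaf hold, the
removed leaf fails; the book at the all-ones assignment; canonical reading, the sixteenth- and fifteenth-tranche
edges valid): A16 FAILS while A7, B2 and A15's main theorems HOLD — Mok's 29 leaves, his two unwritten weighted
fundamental lemmas included, are load-bearing for the p-adic Arthur packets of GSp(2n), GO(2n) through
[Xu:Lpacket] Thm 8.12 ← Thm 10.1 ← [Mok:2014]. [cite: Xu2024Apadic, p0013:L5 with Xu2025Global p0031:L94 (bookkeeping proved here)] -/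
theorem sixteenth_mok_cm (l : Mok2015.LeafSupport.Leaf) :
    Mok2015.LeafSupport.Systems (Mok2015.LeafSupport.mkN (Mok2015.LeafSupport.cm l)) ∧
      (∀ l', l' ≠ l → (Mok2015.LeafSupport.mkN (Mok2015.LeafSupport.cm l)).leaf l') ∧
      ¬ (Mok2015.LeafSupport.mkN (Mok2015.LeafSupport.cm l)).leaf l ∧
      (Implications16 νtop (canon νtop (Mok2015.LeafSupport.mkN (Mok2015.LeafSupport.cm l)) κtop)
          (canon₂ νtop (Mok2015.LeafSupport.mkN (Mok2015.LeafSupport.cm l)) κtop)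
          (canon₁₅ νtop (Mok2015.LeafSupport.mkN (Mok2015.LeafSupport.cm l)))
          (canon₁₆ νtop (Mok2015.LeafSupport.mkN (Mok2015.LeafSupport.cm l))) ∧
        Implications15 νtop (Mok2015.LeafSupport.mkN (Mok2015.LeafSupport.cm l))
          (canon νtop (Mok2015.LeafSupport.mkN (Mok2015.LeafSupport.cm l)) κtop)
          (canon₁₅ νtop (Mok2015.LeafSupport.mkN (Mok2015.LeafSupport.cm l)))) ∧
      ((canon νtop (Mok2015.LeafSupport.mkN (Mok2015.LeafSupport.cm l)) κtop).XuGSp ∧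
        (canon₂ νtop (Mok2015.LeafSupport.mkN (Mok2015.LeafSupport.cm l)) κtop).XuMoeglinParam ∧
        (canon₁₅ νtop (Mok2015.LeafSupport.mkN (Mok2015.LeafSupport.cm l))).XuGlobal) ∧
      ¬ (canon₁₆ νtop (Mok2015.LeafSupport.mkN (Mok2015.LeafSupport.cm l))).XuApadic :=
  have cmod := Mok2015.LeafSupport.countermodel l
  have nm := not_M_cm l
  have I := canon_implications νtop (Mok2015.LeafSupport.mkN (Mok2015.LeafSupport.cm l)) κtop
  have J := canon_implications₂ νtop (Mok2015.LeafSupport.mkN (Mok2015.LeafSupport.cm l)) κtop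
  have K := canon_implications₁₅ νtop (Mok2015.LeafSupport.mkN (Mok2015.LeafSupport.cm l)) κtop
  ⟨cmod.1, cmod.2.1, cmod.2.2.1, ⟨canon_implications₁₆ _ _ κtop, K⟩,
    ⟨xu_of_leaves I bookInputs_top, xuMoeglinParam_of_leaves J bookInputs_top, xuGlobal_of_leaves I K bookInputs_top⟩,
    fun h => nm h.2⟩

/-- KMSW side: no statement of Kaletha–Mínguez–Shin–White occurs in A16's edge; in each KMSW countermodel (book and
Mok at the all-ones assignment, the edge valid) A16 holds. [claim: KalethaMinguezShinWhite2014, under-review] (bookkeeping proved here) -/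
theorem sixteenth_kmsw_cm (l : KMSW2014.LeafSupport.Leaf) :
    (∃ ωκ, KMSW2014.LeafSupport.Systems (KMSW2014.LeafSupport.mkN (KMSW2014.LeafSupport.cm l)) ωκ) ∧
      ¬ (KMSW2014.LeafSupport.mkN (KMSW2014.LeafSupport.cm l)).leaf l ∧
      Implications16 νtop (canon νtop μtop (KMSW2014.LeafSupport.mkN (KMSW2014.LeafSupport.cm l)))
        (canon₂ νtop μtop (KMSW2014.LeafSupport.mkN (KMSW2014.LeafSupport.cm l))) (canon₁₅ νtop μtop)
        (canon₁₆ νtop μtop) ∧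
      (canon₁₆ νtop μtop).XuApadic :=
  have cmod := KMSW2014.LeafSupport.countermodel l
  ⟨⟨_, cmod.1⟩, cmod.2.2.1, canon_implications₁₆ _ _ _, sixteenth_holds_top⟩

end Support

end Downstream

end Literature.NumberTheory.Automorphic.Arthur2013
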